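import Literature.MathematicalPhysics.QuantumFieldTheory.BalabanImbrieJaffe1984to88.BIJ88Close231WholeTorusFlatCwt
import Literature.MathematicalPhysics.QuantumFieldTheory.BalabanImbrieJaffe1984to88.BIJ88DeltaLocClose235General
import Literature.MathematicalPhysics.QuantumFieldTheory.BalabanImbrieJaffe1984to88.BIJ85NeumannPropagatorRegularClose
import Literature.MathematicalPhysics.QuantumFieldTheory.BalabanImbrieJaffe1984to88.BIJ85NeumannPropagatorRegularDeriv

/-!
# `BalabanImbrieJaffe1984to88.BIJ88Close231RegularTorusCwt` — T. Bałaban, J. Imbrie, A. Jaffe, *Effective action and cluster properties of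
the abelian Higgs model*, Commun. Math. Phys. **114** (1988) 257–315 [BalabanImbrieJaffe1988], §2 (2.30)/(2.31)/(2.35)/(2.36) p. 263 [PDF 7]
**WITH THE REGION `Ω = T_η` (THE WHOLE TORUS) AT A (2.23)-REGULAR NON-FLAT BACKGROUND `u = e^{ieεA}`, FOR THE PRINTED LOCALIZATION DATA OF
RECORD WITH BIG-BLOCK CUBES** — the torus weights `λ_α` of (2.27) and the cut-off `ζ″` of (2.29) of p29 gen 26's `BIJ88LocWeights227Torus`
inside a reference no-wrap box `Ω₀`, the cubes `□_α` replaced by their BIG-BLOCK HULLS (unions of the `L^k·L^s`-blocks of `T^{(0)}` meeting them: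
print's *"cubes … built from cubes of size M = O(1) as in [6]"*, `M ↔ L^s`); (2.30) and (2.31) in operator form, (2.31) in kernel form, (2.35),
(2.36) for `Δ_{k,loc}(u)`, and (v1.1/v1.2, §6–§7) the COVARIANT-DERIVATIVE analogues of (2.31) and (2.30) — ALL HYPOTHESIS-FREE BUT FOR THE
(2.23)-REGULARITY OF `A` and the geometric parameters: r01 gen 26's regular-background providers of [7] (1.10)/(1.11)–(1.12) (`BIJ85NeumannPropagatorRegularClose` §4) fed BY
NAME into p31 gen 20 v1.1's row-restricted chain (`BIJ88DeltaLocClose235General` §10, the `_gen` family), the row bookkeeping (ii″) from r18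
gen 23's `rowHyp_ii_torus` by the monotonicity `□_α ⊆ bbHull □_α`.

statement-level skeleton of published theorems with citation tags; proofs where landed; nothing here is a claim about the Yang–Mills mass gap

PDF held: `paper:balaban1988-cmp114-bij-abelian-higgs-effective-action` (journal page = PDF page + 256; p. 263 = PDF 7; page render
`HOME/lit-balaban-p31/renders/original-p007-x2.png` re-read this session).

CITATION HEADER (lean-in-tree rule).  lit-balaban cell (HOME `run/shared/lean/pub/lit-balaban/`), Phase 2, seat r18 gen 24 (unit `lit-balaban-r18`,
literature-prover-lit-balaban-r18-g24-0; C2 §§1–4 fold owner), free-target protocol G.5-34(d), TAKING line HOME/STATUS.md 2026-08-23T01:26Z (item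
(ε) of the owner's `HOME/lit-balaban-r18/C2S14-CLOSURE.md` v1.16i §5: *"the row-bookkeeping instantiation r01 §4 ↦ p31 §10 at the (2.27)/(2.29)
torus data of record"*, nobody's TAKING at 01:19Z; stem check: no `…Close231Regular…` stem; notices to p31 / r01 / p29).  Rows of
`HOME/lit-balaban-r18/ROWS-C2.md` served (LOCATED MEMBERS, cells only; heads unchanged): **C2.Eq2.30** (head p02's `BIJ88OpDecay230Proof`),
**C2.Eq2.31** (head p08's hence-step), **C2.Eq2.35** / **C2.Eq2.36** (head p02's `BIJ88Close235Proof`), **C2.Eq2.27** (DEF row; the cubes *"built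
from cubes of size M"*).  Files USED BY NAME, nothing restated: r01 g26 `BIJ85NeumannPropagatorRegularClose` (`input110_regular_univ`,
`input110_regular_deep`, `input112_regular_deep`; p346673), p31 g20 `BIJ88DeltaLocClose235General` v1.1 (`opDecay230_gen`, `opClose231_gen`,
`close231_kernel_gen`, `close235_gen`, `decay236_gen`; p346675), r18 g23 `BIJ88Close231WholeTorusFlatCwt`
(`rowHyp_ii_torus`; p344568), p29 gen 26/27 `BIJ88LocWeights227Torus` (`cubeFam`/`lamFam`/`labels`/`lamT`, `rowHyp_i`/`rowHyp_iii`,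
`sum_abs_lamT_le_one`, `cutoff_eq_zero_of_le`, `cutoff_mem_unitInterval`, `mem_and_depth_of_mem_blockK`, `activeLabels` +
`card_subtype_activeLabels_le`, `mem_activeLabels_of_ne_zero_of_deep`), r01's dictionary `BIJ85CovariantHiggsDictionary.expGauge`, gen 15's
`BIJ88DeltaLoc234Torus` (`gLocT`, `deltaLocT`, `deltaRegion`), `BIJ88NeumannPropagator227Torus.gBox`, p13's `BIJ88Cutoffs21.cutoff`, p38's metric
`B5Ineq137Torus.T`.

## The print (verbatim, p. 263)

*"To localize the dependence on u, we interpolate in a smooth fashion between operators with Neumann boundary conditions on small cubes. Let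
{□_α} be the collection of (1/2L) r(e_{k−1})-cubes that can be built from cubes of size M = O(1) as in [6]. … The boundary conditions are always
at a distance O(r(e_k)) from x₁, x₂, so a straightforward application of the random walk expansion of [6] shows that
|(G_{k,loc}(u)f)(x)| ≦ ce^{−c dist(suppt f,x)}‖f‖_∞, (2.30) |(G_{k,loc}(u)f − G_k(Ω,u)f)(x)| ≦ e^{−cr(e_k)}e^{−c dist(suppt f,x)}‖f‖_∞, (2.31) for
dist(x,Ω^c) ≧ O(r(e_k)). [Each G_k(□_α,u) is close to G_k(Ω,u) for the relevant x₁, x₂, therefore the convex combination and G_{k,loc} are close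
also.] We assume that u is smooth in the □_α's entering the sum in (2.27); for (2.31) we assume smoothness throughout the subset Ω ⊂ T_η. …
Hence |Δ_{k,loc}(u;x₁,x₂) − Δ_k(Ω,u;x₁,x₂)| ≦ e^{−cr(e_k)}e^{−c|x₁−x₂|} for dist({x₁,x₂},Ω^c) > O(r(e_k)), (2.35) |Δ_{k,loc}(u;x₁,x₂)| ≦ ce^{−c|x₁−x₂|},
(2.36)"*.  Here `Ω = T_η` (`Ω^c = ∅`); the smoothness of `u` *"throughout"* `T_η` is taken in the (2.23)-regular form of [BalabanImbrieJaffe1985]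
p. 326 / [7]: `u = e^{ieεA}` with `L^kε|e|/e_k·|∂A| ≦ c·e_k^{β−1}/L^k` on the whole torus, `0 < e_k ≦ e₁` — the hypothesis under which r01's
providers deliver [7]'s (1.10)/(1.12); the data of record live in a reference box `Ω₀ ⊂ T_η`, and *"for dist(x,Ω^c) ≧ O(r(e_k))"* / *"the relevant
x"* becomes: `x` at chart depth `≥ R₀ + R` in `Ω₀` with `R > R₀′ + 1 = 2rS + 2L^kL^s(d+2) + 1` ([7] p. 573 *"for x with dist(x, Ω^c) ≧ R₀"*,
here with respect to the cubes `□_α`: every cube active on the row of `x` contains the `(R₀′+1)`-ball about `x` and keeps the torus margin `R`).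

## What is proved (0 `sorry`; no `Prop`-valued fact; 3 definitions with body — `bbHull`, `deepRows`, `rowMargin` — and the abbrev `cubeFamB`)

* §1 `bbHull b X` (the union of the side-`b` blocks of the absolute grid meeting `X`), `mem_bbHull`, `subset_bbHull`, `not_mem_of_not_mem_bbHull`,
  **`bbHull_bigBlock`** (membership depends only on `⌊z_μ/b⌋` — r01's big-block-union hypothesis).
* §2 `cubeFamB` (the hulls of p29's cubes `cubeFam`, `b = L^kL^s`), `deepRows ρ B` (the rows whose sup-torus `ρ`-ball lies in `B`), `mem_deepRows`,
  **`rowHyp_ii_hull`**: at chart depth `≥ R₀ + R`, `ρ < R`, an active pair `(x,y)` has `x ∈ deepRows ρ (bbHull □_α)`, `y ∈ bbHull □_α`, and every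
  `w ∉ bbHull □_α` at sup-torus distance `≥ R` from both — p31 v1.1's row hypothesis (ii″), from gen 23's `rowHyp_ii_torus`.
* §3 `rowMargin L D k s = 2(5(L^kL^s)/8 + L^k) + 2(L^kL^s)(D+1) + 1` (r01's `R₀′ + 1`), **`inputs_regular`**: r01's three providers at ONE set of
  constants (`s ≥ max s₀`, `c₀ = max`, `e₁ = min`, the (1.10) rate `1/(4L^s)` weakened to `1/(8L^s)`), stated EXACTLY in p31's `_gen` shapes:
  (H1.10) for `G_k(T^{(0)},u)` at every row, (H1.10″) for every big-block union `B` at its `rowMargin`-deep rows, (H1.12″) for every big-block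
  union `B ⊆ T^{(0)}` at its `rowMargin`-deep rows with depths to `T ∖ B`.
* §4 **`opClose231_regular_torus_cwt`** ((2.31) operator form), **`close231_regular_torus_kernel_cwt`** ((2.31) kernel form),
  **`opDecay230_regular_cwt`** ((2.30) operator form) — `∃ s₀ ∀ s ≥ s₀ ∃ c₀ e₁ > 0` (from `(d, L, a, e, c, β, s)`) ∀ torus (`P.d = d+1`,
  `P.L = L`) ∀ `1 ≤ k ≤ K`, `k + s ≤ m + K`, `3L^kL^s ≤ |T^{(0)}|` ∀ `A` regular on `T^{(0)}` (`0 < e_k ≤ e₁`) ∀ reference box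
  `Ω₀ = c·L^k + Π_i[0, L^kM₀_i)` with torus gap `≥ R` ∀ grid spacing `s_g ≥ 1`, half-width `W ≥ 2s_g/3 + R₀/2 + R`, radii `R > rowMargin`,
  `0 ≤ R₁ < R₀` ∀ fine row `x ∈ Ω₀` of chart depth `≥ R₀ + R` ∀ `f` (`‖f‖_∞ ≤ F`, supported at sup-torus distance `≥ D ≥ 0` from `x`):
  `‖(G_{k,loc}(u)f − G_k(T_η,u)f)(x)‖ ≤ (L^kε)²c₀(m·e^{−2δ₀R/L^k} + e^{−(δ₀/2)R₁/L^k})e^{−(δ₀/2)D/L^k}F`,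
  `‖G_{k,loc}(u;x,y) − G_k(T_η,u;x,y)‖ ≤ (L^kε)²c₀(e^{−2δ₀R/L^k} + e^{−(δ₀/2)R₁/L^k})e^{−(δ₀/2)|x−y|_T/L^k}` (all `y`),
  `‖(G_{k,loc}(u)f)(x)‖ ≤ (L^kε)²·m·c₀e^{−δ₀D/L^k}F`, with `δ₀ = 1/(8L^s)`, `m = (⌊(L^k−1+R₀)/s_g⌋+3)^{d+1}` (p29's multiplicity), `u = expGauge P e A`.
* §5 **`close235_regular_torus_cwt`** ((2.35): ∀ `y₁` whose `k`-block lies in `Ω₀` with chart margin `R₀ + R` ∀ `y₂`,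
  `‖Δ_{k,loc}(u;y₁,y₂) − Δ_k(T_η,u;y₁,y₂)‖ ≤ A·a_kc₀e^{δ₀/2}(m·e^{−2δ₀R/L^k} + e^{−(δ₀/2)R₁/L^k})e^{−(δ₀/2)|y₁−y₂|_{T^{(k)}}}`),
  **`decay236_regular_cwt`** ((2.36) for `Δ_{k,loc}(u)`: `≤ A([y₁=y₂] + m·a_kc₀e^{δ₀}e^{−δ₀|y₁−y₂|_{T^{(k)}}})`), `A = α_kL^{k(d+1)}` (gen 15's
  counting normalization); the (2.36) member for the REGION form `Δ_k(Ω, e^{ieεA})` on a general big-block region is p31 gen 20's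
  `BIJ88Decay236RegularRegion.decay236_region_regular` (p347255) — not repeated here.  At the printed radii `R, R₁ = r(e_k)L^k` (and
  `L^s = M = O(1)`) every bracket is the print's `e^{−cr(e_k)}` at every level `k`.
* §6 (v1.1, APPEND-ONLY) **`deriv231_regular_torus_cwt`** — THE COVARIANT-DERIVATIVE ANALOGUE OF (2.31) WITH `Ω = T_η` AT THE REGULAR
  BACKGROUND (p. 263: *"Bounds analogous to (2.30), (2.31) hold for covariant derivatives …"*): same data, `R > rowMargin + 1`, every bond
  `⟨x, x+e_μ⟩` with both endpoints in `Ω₀` at chart depth `≥ R₀ + R`: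
  `‖D_u(G_{k,loc}(u)f)(⟨x,μ⟩) − D_u(G_k(T_η,u)f)(⟨x,μ⟩)‖ ≤ (L^kε)·c₀·[m(1 + L^k((R₀−R₁)⁻¹ + s_g⁻¹))e^{−δ₀(2R−1)/L^k} + (1 + L^k(R₀−R₁)⁻¹)e^{−(δ₀/2)(R₁−1)/L^k}]·e^{−(δ₀/2)D/L^k}·F`,
  `D_u = covD ε⁻¹ (cfg u)` — r18 gen 23's four-term proof (p29's `covD_gLocT_sub_apply` + tails, verbatim) with r01 gen 26's regular-background
  DERIVATIVE providers `BIJ85NeumannPropagatorRegularDeriv.input112_deriv_regular_deep` / `input110_deriv_regular_univ` (p347438) and the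
  value providers of §3 as the four inputs (`set_option maxHeartbeats 400000` on this one theorem: long bookkeeping, no heavy automation).
* §7 (v1.2, APPEND-ONLY) **`deriv230_regular_cwt`** — THE COVARIANT-DERIVATIVE ANALOGUE OF (2.30) AT THE REGULAR BACKGROUND, same data and
  hypotheses as §6: `‖D_u(G_{k,loc}(u)f)(⟨x,μ⟩)‖ ≤ (L^kε)·c₀·m·(1 + L^k((R₀−R₁)⁻¹ + s_g⁻¹))·e^{−δ₀D/L^k}·F` — p29's two-term proof of
  `deriv230_flat_cwt` (`covD_gLocT_apply`, `norm_rowSource_sub_le`, verbatim) with r01's `input110_deriv_regular_deep` for the hulls active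
  at `x + e_μ` and §3's value member of (1.10) on the difference sources, both at `rowMargin`-deep rows.
* §8 (v1.3, APPEND-ONLY) **`opClose231_regular_torus_cwt_nonvacuous`** — NON-VACUITY: the hypotheses of `opClose231_regular_torus_cwt` are
  jointly satisfiable, thresholds included — given `(a, e, c, β)` take `s = s₀` and the constants `c₀, e₁`, THEN the torus `ℤ/(2·3^{s+7})`
  (`d = 1`, `L = 3`, `m = s + 6`, `K = 1`), `k = 1`, `A = 0` (regular at `e_k = e₁`), `Ω₀ = [0, 3^{s+5})`, `s_g = 1`, `R = rowMargin + 1`,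
  `R₀ = 1`, `R₁ = 0`, `W = rowMargin + 3`, `x ≡ rowMargin + 2`: every displayed hypothesis holds (`rowMargin 3 1 1 s ≤ 16·3^s + 7`), so the
  (2.31) operator bound holds there for every source.
* §9 (v1.4, APPEND-ONLY) **`opClose231_regular_torus_cwt_gaugeOrbit`**, **`opDecay230_regular_cwt_gaugeOrbit`** — THE GAUGE ORBIT: the
  (2.31) and (2.30) operator members hold VERBATIM (same thresholds and constants) at every gauge transform `u = (e^{ieεA})^h` of a
  (2.23)-regular background — the form in which [I] §4.5 meets the small-field region after an axial gauge fixing; by p31's covariance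
  `gLocT_gaugeAct` / `gBox_gaugeAct` (`G(u^h) = M_hG(u)M_hᴴ`; the hulls are `k`-block unions, `isBlockUnion_cubeFamB` ← r01's
  `isBlockUnion_of_bigBlocks`), `|h| = 1`, and the rotated source `h̄f` having the size and support of `f`.

HONEST SCOPE / DIVERGENCE.  (i) VALUE members (§4–§5) and the COVARIANT-DERIVATIVE analogues of (2.31)/(2.30) (§6–§7) only: the Hölder analogues (the
p. 263 sentence after (2.33), orders `θ ≤ 1` and `1 + θ`) at regular `u` are NOT here (r01's Hölder providers = his announced file 3; p29 g29's
`BIJ88LocDeriv230SmallFieldTorus` and p30's lane treat derivative/Hölder members at bondwise-small `u`).  (ii) `u` is `e^{ieεA}` with `A` (2.23)-regular ON THE WHOLE TORUS — or, for the VALUE members (2.31)/(2.30) in operator form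
(§9, v1.4), ANY GAUGE TRANSFORM `(e^{ieεA})^h` of it; [I] §4.5's representation of the small-field region by such `A` after an axial gauge
fixing is itself not invoked (p33's lane) — the smallest honest reading of *"smoothness throughout the subset Ω ⊂ T_η"* with `Ω = T_η` that
the tree's inputs support; bondwise- or plaquette-small `u` beyond the gauge orbit of a regular `A` need the k-uniform OPERATOR-form inputs
(p27 g34's lane) — not here.  (iii) `Ω = T_η` only (the `Ω = Ω₀` no-wrap-box comparison would need `Ω₀` itself
big-block aligned; not taken).  (iv) THE CUBES ARE THE BIG-BLOCK HULLS of p29's cubes, not p29's cubes (whose `L^k`-block ranges `[tLo, tHi)` are not aligned to the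
`L^s`-grid in general, so they need not be big-block unions): a different admissible choice of the printed `{□_α}` (print builds them from
`M`-cubes), same weights and cut-off; consequently `G_{k,loc}(u)` here is the (2.28) object for THIS cube family — gen 22/23's flat `Ω = T_η` members are for
p29's cubes.  (v) Constants: `s₀`, `e₁`, `c₀` existential (p35's [B1] thresholds through r01; `c₀ = max`, `e₁ = min` of the three providers),
`δ₀ = 1/(8L^s)` explicit; the thresholds are not computable from the tree's statements, but the hypotheses are jointly satisfiable once the
torus is chosen AFTER them — §8 (v1.3) gives the witness for `opClose231_regular_torus_cwt` at `A = 0` (regular for every `e_k`) on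
`ℤ/(2·3^{s₀+7})`; the other members' hypothesis blocks differ only by the bond endpoint / block-site data and are met the same way (not spelled
out).  (vi) Row depth
`R₀ + R` with `R > rowMargin = O(L^kL^s)` (`+ 1` in §6): print's *"O(r(e_k))"* margin in `L^k`-units once `L^s ≲ r(e_k)`.  Imports: r18 g23
`BIJ88Close231WholeTorusFlatCwt` (→ p29's data files, `BIJ88LocDeriv231FlatTorus`), p31 `BIJ88DeltaLocClose235General`, r01
`BIJ85NeumannPropagatorRegularClose` and (v1.1) `BIJ85NeumannPropagatorRegularDeriv`.  Literature + Mathlib only.  Unit `lit-balaban-r18`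
(literature-prover-lit-balaban-r18-g24-0), 2026-08-23; v1.1 = v1 (p347978) + §6 and one import line, every v1 declaration byte-identical;
v1.2 = v1.1 (p349012) + §7, every v1.1 declaration byte-identical; v1.3 = v1.2 (p349837) + §8, every v1.2 declaration byte-identical;
v1.4 = v1.3 (p350499) + §9, every v1.3 declaration byte-identical.  NOT summit progress.
-/

open scoped BigOperators Matrix ComplexConjugate
open Finset Matrix

namespace Literature.MathematicalPhysics.QuantumFieldTheory.BalabanImbrieJaffe1984to88.BIJ88Close231RegularTorusCwt

open Literature.MathematicalPhysics.QuantumFieldTheory.Balaban1983to89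
open BIJ88Sect3Statements (U1)
open BIJ85BlockAveragesTorus BIJ85BlockAveragesTorusK
open BIJ88NeumannPropagator227Torus (gBox)
open BIJ88DeltaLoc234Torus (gLocT deltaLocT deltaRegion)
open BIJ88NeumannPropagatorFlatDecayCube (cubeT boxCoord)
open BIJ88Cutoffs21 (cutoff)
open BIJ88LocWeights227Torus
open BIJ88Close231WholeTorusFlatCwt (rowHyp_ii_torus lt_T_of_not_mem)
open BIJ85CovariantHiggsDictionary (expGauge)
open BIJ88DeltaLocClose235General (opDecay230_gen opClose231_gen close231_kernel_gen decay236_gen close235_gen)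
open BIJ85NeumannPropagatorRegularClose (input110_regular_univ input110_regular_deep input112_regular_deep)

noncomputable section

variable {P : Params}

/-! ## §1 The big-block hull: the cubes of (2.27) «built from cubes of size M = O(1) as in [6]», `M ↔ L^s` -/

section Hull

/-- **The big-block hull** of a set of fine torus sites: the union of the blocks `{z : ⌊z_μ/b⌋ = const}` (side `b` sites, on the absolute grid of
`T^{(0)}`) that meet `X`.  With `b = L^k·L^s` these are the «cubes of size M = O(1)» (in `T_η` units, `M = L^s`) of which the printed cubes `□_α` of
(2.27) are built — the shape required by the (2.23)-regular region propagator estimates of [BalabanImbrieJaffe1985] p.326 / [7] (r01's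
`BIJ85NeumannPropagatorRegularClose`: membership invariant under equal `⌊z_μ/(L^kL^s)⌋`). [cite: BalabanImbrieJaffe1988, (2.27) p.263] -/
def bbHull (b : ℕ) (X : Finset (Balaban1983to89.Site P 0)) : Finset (Balaban1983to89.Site P 0) :=
  univ.filter fun z => ∃ y ∈ X, ∀ μ, (z μ).val / b = (y μ).val / b

/-- unfolding of `bbHull` (dictionary lemma for the big-block hull of the (2.27) cubes). [cite: BalabanImbrieJaffe1988, (2.27) p.263] -/
theorem mem_bbHull {b : ℕ} {X : Finset (Balaban1983to89.Site P 0)} {z : Balaban1983to89.Site P 0} :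
    z ∈ bbHull b X ↔ ∃ y ∈ X, ∀ μ, (z μ).val / b = (y μ).val / b := by
  simp [bbHull]

/-- `X ⊆ bbHull b X`. [cite: BalabanImbrieJaffe1988, (2.27) p.263] -/
theorem subset_bbHull (b : ℕ) (X : Finset (Balaban1983to89.Site P 0)) : X ⊆ bbHull b X :=
  fun z hz => mem_bbHull.2 ⟨z, hz, fun _ => rfl⟩

/-- a point outside the hull is outside the set (dictionary lemma for the (2.27) cubes). [cite: BalabanImbrieJaffe1988, (2.27) p.263] -/
theorem not_mem_of_not_mem_bbHull {b : ℕ} {X : Finset (Balaban1983to89.Site P 0)} {w : Balaban1983to89.Site P 0}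
    (hw : w ∉ bbHull b X) : w ∉ X := fun h => hw (subset_bbHull b X h)

/-- **The hull is a union of big blocks** (r01's region hypothesis): membership depends only on the block `⌊z_μ/b⌋`.
[cite: BalabanImbrieJaffe1988, (2.27) p.263] -/
theorem bbHull_bigBlock (b : ℕ) (X : Finset (Balaban1983to89.Site P 0)) (z z' : Balaban1983to89.Site P 0)
    (h : ∀ μ, (z μ).val / b = (z' μ).val / b) : z ∈ bbHull b X ↔ z' ∈ bbHull b X := by
  constructor
  · rintro hz
    obtain ⟨y, hy, hzy⟩ := mem_bbHull.1 hz
    exact mem_bbHull.2 ⟨y, hy, fun μ => (h μ).symm.trans (hzy μ)⟩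
  · rintro hz'
    obtain ⟨y, hy, hzy⟩ := mem_bbHull.1 hz'
    exact mem_bbHull.2 ⟨y, hy, fun μ => (h μ).trans (hzy μ)⟩

end Hull

/-! ## §2 The printed torus data with big-block cubes, and their row hypotheses at chart depth `≥ R₀ + R` -/

section Data

variable {d : ℕ} (hPd : P.d = d + 1) {n : ℕ} {c M0 : Fin (d + 1) → ℕ} {s W : ℕ}

/-- **The big-block cube family**: the hulls `bbHull b □_α` of p29's torus cubes of record `cubeFam` (gen 26), indexed by the same label set.
[cite: BalabanImbrieJaffe1988, (2.27) p.263] -/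
abbrev cubeFamB (n : ℕ) (c M0 : Fin (d + 1) → ℕ) (s W b : ℕ) : ↥(labels n M0 s) → Finset (Balaban1983to89.Site P 0) :=
  fun α => bbHull b (cubeFam hPd n c M0 s W α)

/-- **The deep rows of a set** (`[7]` p.573 «for x with dist(x, Ω^c) ≧ R₀»; r01's row condition): the sites whose sup-torus ball of radius `ρ`
lies in `B`. [cite: BalabanImbrieJaffe1988, (2.31) p.263] -/
def deepRows (ρ : ℝ) (B : Finset (Balaban1983to89.Site P 0)) : Finset (Balaban1983to89.Site P 0) :=
  univ.filter fun x => ∀ y, B5Ineq137Torus.T P 0 x y ≤ ρ → y ∈ B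

/-- unfolding of `deepRows` ([7] p.573 «for x with dist(x, Ω^c) ≧ R₀», dictionary lemma). [cite: BalabanImbrieJaffe1988, (2.31) p.263] -/
theorem mem_deepRows {ρ : ℝ} {B : Finset (Balaban1983to89.Site P 0)} {x : Balaban1983to89.Site P 0} :
    x ∈ deepRows ρ B ↔ ∀ y, B5Ineq137Torus.T P 0 x y ≤ ρ → y ∈ B := by
  simp [deepRows]

/-- **Row hypothesis (ii″) for the big-block cubes** (p31 v1.1's `_gen` shape, torus-exterior depths): at a fine site `x ∈ Ω₀` of chart depth
`≥ R₀ + R` with `ρ < R`, an active pair `(x, y)` has `x` a `ρ`-deep row of `bbHull b □_α`, `y ∈ bbHull b □_α`, and every `w ∉ bbHull b □_α` at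
sup-torus distance `≥ R` from `x` and from `y` — gen 23's `rowHyp_ii_torus` for `□_α` and the monotonicity `□_α ⊆ bbHull b □_α`.
[cite: BalabanImbrieJaffe1988, (2.27) p.263] -/
theorem rowHyp_ii_hull (hn : 1 ≤ n) (hs : 0 < s) (hfit : ∀ i, c i * n + n * M0 i ≤ P.sitesPerDir 0) {R R₀ ρ : ℝ} (hR : 0 ≤ R)
    (hR₀ : 0 ≤ R₀) (hρ : ρ < R) (hgap : ∀ i, ((n * M0 i : ℕ) : ℝ) + R ≤ P.sitesPerDir 0) (hW : 2 * (s : ℝ) / 3 + R₀ / 2 + R ≤ W) (b : ℕ)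
    {ζ'' : Balaban1983to89.Site P 0 → Balaban1983to89.Site P 0 → ℝ} (hζ : ∀ x y, R₀ ≤ B5Ineq137Torus.T P 0 x y → ζ'' x y = 0)
    {x : Balaban1983to89.Site P 0} (hx : x ∈ (cubeT hPd n c fun i => n * M0 i))
    (hdeep : ∀ i, R₀ + R ≤ (boxCoord hPd n c x i : ℝ) ∧ (boxCoord hPd n c x i : ℝ) + (R₀ + R) ≤ (n * M0 i : ℕ) - 1) :
    ∀ (α : ↥(labels n M0 s)) (y : Balaban1983to89.Site P 0), ζ'' x y * lamFam hPd n c M0 s α x y ≠ 0 →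
      x ∈ deepRows ρ (cubeFamB hPd n c M0 s W b α) ∧ y ∈ cubeFamB hPd n c M0 s W b α ∧
        ∀ w, w ∉ cubeFamB hPd n c M0 s W b α → R ≤ B5Ineq137Torus.T P 0 x w ∧ R ≤ B5Ineq137Torus.T P 0 y w := by
  intro α y hne
  obtain ⟨hxα, hyα, hfar⟩ := rowHyp_ii_torus hPd hn hs hfit hR hR₀ hgap hW hζ hx hdeep α y hne
  refine ⟨mem_deepRows.2 fun z hz => ?_, subset_bbHull _ _ hyα, fun w hw => hfar w (not_mem_of_not_mem_bbHull hw)⟩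
  by_contra hzα
  have h := (hfar z (not_mem_of_not_mem_bbHull (X := cubeFam hPd n c M0 s W α) fun h => hzα h)).1
  linarith

end Data

/-! ## §3 The three [7]-inputs at a (2.23)-regular `u = e^{ieεA}` on the whole torus, at ONE set of constants, in p31's `_gen` shapes -/

section Inputs

/-- **r01's printed row margin** `R₀′ + 1 = 2rS + 2L^kL^s(D+1) + 1` (`rS = 5(L^kL^s)/8 + L^k`, `D = P.d` directions) of
`BIJ85NeumannPropagatorRegularClose.input112_regular_deep` («for x ∈ Ω, dist(x, Ω^c) ≧ R₀» / «with the same restrictions on x»), as a natural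
number. [cite: Balaban1983RegularityDecay, Theorem p.573 (1.11)–(1.12)] -/
def rowMargin (L D k s : ℕ) : ℕ := 2 * (5 * (L ^ k * L ^ s) / 8 + L ^ k) + 2 * (L ^ k * L ^ s) * (D + 1) + 1

/-- kernel: `e^{−δ'E} ≤ e^{−δE}` for `δ ≤ δ'`, `E ≥ 0`. [folklore] -/
private theorem exp_le_exp_of_rate {δ δ' E : ℝ} (hδ : δ ≤ δ') (hE : 0 ≤ E) : Real.exp (-(δ' * E)) ≤ Real.exp (-(δ * E)) :=
  Real.exp_le_exp.2 (neg_le_neg (mul_le_mul_of_nonneg_right hδ hE))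

/-- **THE THREE INPUTS OF p31's ROW-RESTRICTED CHAIN AT A (2.23)-REGULAR BACKGROUND ON THE WHOLE TORUS, AT ONE SET OF CONSTANTS.**  For
`D ≥ 1` directions, `L ≥ 2`, `a > 0`, a charge `e` and a regularity pair `(c, β)`, `β > 0`: there is `s₀` and, for every big-block exponent
`s ≥ s₀`, constants `c₀, e₁ > 0` such that on every torus of the series (`P.d = D`, `P.L = L`), at every level `1 ≤ k ≤ K` with `k + s ≤ m + K`,
`3L^kL^s ≤ |T^{(0)}|`, for every real bond field `A` that is (2.23)-regular ON THE WHOLE TORUS (`L^kε|e|/e_k·|∂A| ≤ c·e_k^{β−1}/L^k`,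
`0 < e_k ≤ e₁`) and `u = e^{ieεA}` (`expGauge P e A`), with `δ₀ = 1/(8L^s)` and `G_k(X,u) = gBox (α_kL^{kD}) ε⁻¹ u k X`:
(H1.10) for `X = T^{(0)}` at EVERY row (p31's `hGΩ` with `X₀ = T^{(0)}`); (H1.10″) for every big-block union `B` at its `(R₀′+1)`-deep rows
(p31's `hG` with `X_α = deepRows (R₀′+1) B`); (H1.12″) for every big-block union `B ⊆ T^{(0)}` at its `(R₀′+1)`-deep rows, depths to `T ∖ B`
(p31's `hC`) — r01 gen 26's `input110_regular_univ` / `input110_regular_deep` / `input112_regular_deep` BY NAME, at a common `s ≥ max s₀`,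
`c₀ = max`, `e₁ = min`, and the rate `1/(4L^s)` of the two (1.10) members weakened to `1/(8L^s)` (`0 ≤ D` is a binder of the `_gen` shapes).
[cite: BalabanImbrieJaffe1985, p.326 «also satisfy the regularity and decay estimates of [7]»]
[cite: Balaban1983RegularityDecay, Theorem p.573 (1.10), (1.11)–(1.12)] -/
theorem inputs_regular (D L : ℕ) (hD : 1 ≤ D) (hL : 2 ≤ L) {a : ℝ} (ha : 0 < a) (e creg β : ℝ) (hcreg : 0 ≤ creg) (hβ : 0 < β) :
    ∃ s₀ : ℕ, ∀ s : ℕ, s₀ ≤ s → ∃ c₀ e₁ : ℝ, 0 < c₀ ∧ 0 < e₁ ∧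
      ∀ (P : Params), P.d = D → P.L = L → ∀ {k : ℕ}, 1 ≤ k → k ≤ P.K → k + s ≤ P.m + P.K →
      3 * (L ^ k * L ^ s) ≤ P.sitesPerDir 0 →
      ∀ (A : PBond P 0 → ℝ) {ec : ℝ}, 0 < ec → ec ≤ e₁ →
      (∀ (z : Balaban1983to89.Site P 0) (μ ν : Fin P.d),
          P.spacing k * |e| / ec * |A ⟨z.shift μ, ν⟩ - A ⟨z, ν⟩| ≤ creg * ec ^ (β - 1) / (L : ℝ) ^ k) →
      (∀ x ∈ (univ : Finset (Balaban1983to89.Site P 0)), ∀ (f : Balaban1983to89.Site P 0 → ℂ) (F Ds : ℝ), (∀ y, ‖f y‖ ≤ F) → 0 ≤ Ds →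
          (∀ y, f y ≠ 0 → Ds ≤ B5Ineq137Torus.T P 0 x y) →
          ‖(gBox (B1RG242Torus.α P a k * (P.L : ℝ) ^ (k * P.d)) P.eps⁻¹ (expGauge P e A) k univ *ᵥ f) x‖ ≤
            P.spacing k ^ 2 * (c₀ * Real.exp (-(1 / (8 * (L : ℝ) ^ s) * (((P.L : ℝ) ^ k)⁻¹ * Ds))) * F)) ∧
      (∀ (B : Finset (Balaban1983to89.Site P 0)),
        (∀ z z' : Balaban1983to89.Site P 0, (∀ μ, (z μ).val / (L ^ k * L ^ s) = (z' μ).val / (L ^ k * L ^ s)) → (z ∈ B ↔ z' ∈ B)) →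
        ∀ x ∈ deepRows ((rowMargin L D k s : ℕ) : ℝ) B, ∀ (f : Balaban1983to89.Site P 0 → ℂ) (F Ds : ℝ), (∀ y, ‖f y‖ ≤ F) → 0 ≤ Ds →
          (∀ y, f y ≠ 0 → Ds ≤ B5Ineq137Torus.T P 0 x y) →
          ‖(gBox (B1RG242Torus.α P a k * (P.L : ℝ) ^ (k * P.d)) P.eps⁻¹ (expGauge P e A) k B *ᵥ f) x‖ ≤
            P.spacing k ^ 2 * (c₀ * Real.exp (-(1 / (8 * (L : ℝ) ^ s) * (((P.L : ℝ) ^ k)⁻¹ * Ds))) * F)) ∧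
      (∀ (B : Finset (Balaban1983to89.Site P 0)),
        (∀ z z' : Balaban1983to89.Site P 0, (∀ μ, (z μ).val / (L ^ k * L ^ s) = (z' μ).val / (L ^ k * L ^ s)) → (z ∈ B ↔ z' ∈ B)) →
        ∀ x ∈ deepRows ((rowMargin L D k s : ℕ) : ℝ) B, ∀ (f : Balaban1983to89.Site P 0 → ℂ) (F Ds Db Df : ℝ), (∀ y, ‖f y‖ ≤ F) →
          (∀ y, y ∉ B → f y = 0) → 0 ≤ Ds → (∀ y, f y ≠ 0 → Ds ≤ B5Ineq137Torus.T P 0 x y) → 0 ≤ Db →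
          (∀ w, w ∉ B → Db ≤ B5Ineq137Torus.T P 0 x w) → 0 ≤ Df → (∀ y, f y ≠ 0 → ∀ w, w ∉ B → Df ≤ B5Ineq137Torus.T P 0 y w) →
          ‖(gBox (B1RG242Torus.α P a k * (P.L : ℝ) ^ (k * P.d)) P.eps⁻¹ (expGauge P e A) k B *ᵥ f) x -
              (gBox (B1RG242Torus.α P a k * (P.L : ℝ) ^ (k * P.d)) P.eps⁻¹ (expGauge P e A) k univ *ᵥ f) x‖ ≤
            P.spacing k ^ 2 * (c₀ * Real.exp (-(1 / (8 * (L : ℝ) ^ s) * (((P.L : ℝ) ^ k)⁻¹ * Ds))) *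
              Real.exp (-(1 / (8 * (L : ℝ) ^ s) * (((P.L : ℝ) ^ k)⁻¹ * (Db + Df)))) * F)) := by
  obtain ⟨s₁, H1⟩ := input110_regular_univ D L hD hL ha e creg β hcreg hβ
  obtain ⟨s₂, H2⟩ := input110_regular_deep D L hD hL ha e creg β hcreg hβ
  obtain ⟨s₃, H3⟩ := input112_regular_deep D L hD hL ha e creg β hcreg hβ
  refine ⟨max s₁ (max s₂ s₃), fun s hs => ?_⟩
  have hs₁ : s₁ ≤ s := (le_max_left _ _).trans hs
  have hs₂ : s₂ ≤ s := ((le_max_left _ _).trans (le_max_right _ _)).trans hs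
  have hs₃ : s₃ ≤ s := ((le_max_right _ _).trans (le_max_right _ _)).trans hs
  obtain ⟨c₁, e₁, hc₁, he₁, G1⟩ := H1 s hs₁
  obtain ⟨c₂, e₂, hc₂, he₂, G2⟩ := H2 s hs₂
  obtain ⟨c₃, e₃, hc₃, he₃, G3⟩ := H3 s hs₃
  refine ⟨max c₁ (max c₂ c₃), min e₁ (min e₂ e₃), lt_max_of_lt_left hc₁, lt_min he₁ (lt_min he₂ he₃), ?_⟩
  intro P hPd hPL k hk1 hkK hks hsize A ec hec hece hreg
  have hLr : (0 : ℝ) < L := by exact_mod_cast (show 0 < L by omega)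
  have hLs : (0 : ℝ) < (L : ℝ) ^ s := pow_pos hLr s
  have hPk : (0 : ℝ) < (P.L : ℝ) ^ k := pow_pos P.cast_L_pos k
  have hrate : 1 / (8 * (L : ℝ) ^ s) ≤ 1 / (4 * (L : ℝ) ^ s) :=
    one_div_le_one_div_of_le (by positivity) (by nlinarith)
  have hsk2 : 0 ≤ P.spacing k ^ 2 := sq_nonneg _
  refine ⟨?_, ?_, ?_⟩
  · -- (H1.10) on the whole torus, every row
    intro x _ f F Ds hF hDs hsupp
    have hF0 : 0 ≤ F := (norm_nonneg _).trans (hF x)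
    have h := G1 P hPd hPL hk1 hkK hks hsize A hec (hece.trans (min_le_left _ _)) hreg x f F Ds hF hsupp
    refine h.trans (mul_le_mul_of_nonneg_left ?_ hsk2)
    refine mul_le_mul_of_nonneg_right (mul_le_mul (le_max_left _ _)
      (exp_le_exp_of_rate hrate (mul_nonneg (inv_pos.2 hPk).le hDs)) (Real.exp_pos _).le
      (hc₁.le.trans (le_max_left _ _))) hF0
  · -- (H1.10″) for a big-block union at its deep rows
    intro B hB x hx f F Ds hF hDs hsupp
    have hF0 : 0 ≤ F := (norm_nonneg _).trans (hF x)
    have hrow : ∀ y, B5Ineq137Torus.T P 0 x y ≤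
        ((2 * (5 * (L ^ k * L ^ s) / 8 + L ^ k) + 2 * (L ^ k * L ^ s) * (D + 1) : ℕ) : ℝ) → y ∈ B := by
      intro y hy
      refine (mem_deepRows.1 hx) y (hy.trans ?_)
      unfold rowMargin
      exact_mod_cast Nat.le_succ _
    have h := G2 P hPd hPL hk1 hkK hks hsize B hB A hec (hece.trans ((min_le_right _ _).trans (min_le_left _ _)))
      (fun z _ μ ν => hreg z μ ν) x hrow f F Ds hF hsupp
    refine h.trans (mul_le_mul_of_nonneg_left ?_ hsk2)
    refine mul_le_mul_of_nonneg_right (mul_le_mul ((le_max_left _ _).trans (le_max_right _ _))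
      (exp_le_exp_of_rate hrate (mul_nonneg (inv_pos.2 hPk).le hDs)) (Real.exp_pos _).le
      (hc₁.le.trans (le_max_left _ _))) hF0
  · -- (H1.12″) for a big-block union against the whole torus, at its deep rows, depths to `T ∖ B`
    intro B hB x hx f F Ds Db Df hF hfB _ hsupp _ hDb _ hDf
    have hF0 : 0 ≤ F := (norm_nonneg _).trans (hF x)
    have hrow : ∀ y, B5Ineq137Torus.T P 0 x y ≤
        ((2 * (5 * (L ^ k * L ^ s) / 8 + L ^ k) + 2 * (L ^ k * L ^ s) * (D + 1) + 1 : ℕ) : ℝ) → y ∈ B := by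
      intro y hy
      refine (mem_deepRows.1 hx) y ?_
      unfold rowMargin
      exact hy
    have huniv : ∀ z z' : Balaban1983to89.Site P 0,
        (∀ μ, (z μ).val / (L ^ k * L ^ s) = (z' μ).val / (L ^ k * L ^ s)) →
          (z ∈ (univ : Finset (Balaban1983to89.Site P 0)) ↔ z' ∈ (univ : Finset (Balaban1983to89.Site P 0))) :=
      fun z z' _ => by simp
    have h := G3 P hPd hPL hk1 hkK hks hsize B univ hB huniv (subset_univ B) A hec
      (hece.trans ((min_le_right _ _).trans (min_le_right _ _))) (fun z _ μ ν => hreg z μ ν) x hrow f F Ds Db Df hF hfB hsupp hDb hDf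
    refine h.trans (mul_le_mul_of_nonneg_left ?_ hsk2)
    refine mul_le_mul_of_nonneg_right (mul_le_mul_of_nonneg_right (mul_le_mul_of_nonneg_right
      ((le_max_right _ _).trans (le_max_right _ _)) (Real.exp_pos _).le) (Real.exp_pos _).le) hF0

end Inputs

/-! ## §4 (2.31) (operator and kernel forms) with `Ω = T_η` at a (2.23)-regular background, for the printed torus data with big-block cubes -/

section Members

variable {d : ℕ}

/-- kernel: a deeper chart margin implies a shallower one. [folklore] -/
private theorem depth_mono (hPd : P.d = d + 1) {n : ℕ} {c M0 : Fin (d + 1) → ℕ} {D D' : ℝ} (hDD : D ≤ D')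
    {x : Balaban1983to89.Site P 0}
    (hdeep : ∀ i, D' ≤ (boxCoord hPd n c x i : ℝ) ∧ (boxCoord hPd n c x i : ℝ) + D' ≤ (n * M0 i : ℕ) - 1) :
    ∀ i, D ≤ (boxCoord hPd n c x i : ℝ) ∧ (boxCoord hPd n c x i : ℝ) + D ≤ (n * M0 i : ℕ) - 1 :=
  fun i => ⟨hDD.trans (hdeep i).1, by linarith [(hdeep i).2]⟩

/-- kernel: `|ζ″| ≤ 1` for p13's cut-off. [folklore] -/
private theorem abs_cutoff_le_one (R₁ R₀ : ℝ) (x y : Balaban1983to89.Site P 0) : |cutoff R₁ R₀ (B5Ineq137Torus.T P 0) x y| ≤ 1 :=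
  abs_le.2 ⟨by linarith [(cutoff_mem_unitInterval R₁ R₀ x y).1], (cutoff_mem_unitInterval R₁ R₀ x y).2⟩

/-- **(2.31), OPERATOR FORM, `Ω = T_η`, AT A (2.23)-REGULAR NON-FLAT BACKGROUND `u = e^{ieεA}`, FOR THE PRINTED LOCALIZATION DATA WITH
BIG-BLOCK CUBES** (p. 263: *"|(G_{k,loc}(u)f − G_k(Ω,u)f)(x)| ≦ e^{−cr(e_k)}e^{−c dist(suppt f,x)}‖f‖_∞ (2.31) for dist(x, Ω^c) ≧ O(r(e_k)).
[Each G_k(□_α,u) is close to G_k(Ω,u) for the relevant x₁, x₂ …] … for (2.31) we assume smoothness throughout the subset Ω ⊂ T_η"*; here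
`Ω = T_η` and `u = e^{ieεA}` with `A` (2.23)-regular on the whole torus).  For `d + 1` directions, `L ≥ 2`, `a > 0`, `e`, `(c, β)`: `∃ s₀`,
`∀ s ≥ s₀`, `∃ c₀, e₁ > 0` (from `(d, L, a, e, c, β, s)` only) such that on every torus of the series, at every level `1 ≤ k ≤ K` with
`k + s ≤ m + K`, `3L^kL^s ≤ |T^{(0)}|`, for every `A` (2.23)-regular on `T^{(0)}` (`0 < e_k ≤ e₁`), every reference no-wrap box
`Ω₀ = c·L^k + Π_i[0, L^k·M₀_i)` leaving a torus gap `≥ R`, cube spacing `s_g ≥ 1`, half-width `W ≥ 2s_g/3 + R₀/2 + R`, radii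
`R > R₀′ + 1 = 2rS + 2L^kL^s(d+2) + 1`, `0 ≤ R₁ < R₀`, every fine row `x ∈ Ω₀` of chart depth `≥ R₀ + R`, and every `f` with `‖f‖_∞ ≤ F` supported
at sup-torus distance `≥ D ≥ 0` from `x`:
`‖(G_{k,loc}(u)f − G_k(T_η,u)f)(x)‖ ≤ (L^kε)²·c₀·(m·e^{−2δ₀R/L^k} + e^{−(δ₀/2)R₁/L^k})·e^{−(δ₀/2)D/L^k}·F`, `δ₀ = 1/(8L^s)`,
`m = (⌊(L^k − 1 + R₀)/s_g⌋ + 3)^{d+1}`, where `G_{k,loc}(u)` is built from the BIG-BLOCK HULLS `bbHull (L^kL^s) □_α` of p29's torus cubes,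
p29's weights `λ_α` (2.27) and p13's cut-off `ζ″` (2.29) — p31 v1.1's `opClose231_gen` BY NAME with `X₀ = T^{(0)}`, `X_α` = the
`(R₀′+1)`-deep rows of the hulls, its three inputs from §3 (r01's (2.23)-regular providers) and row hypotheses (i)/(ii″)/(iii) from p29 §3 /
`rowHyp_ii_hull`; bracket `= e^{−cr(e_k)}` at the printed radii `R, R₁ ~ r(e_k)L^k`. [cite: BalabanImbrieJaffe1988, (2.31) p.263] -/
theorem opClose231_regular_torus_cwt (d L : ℕ) (hL : 2 ≤ L) {a : ℝ} (ha : 0 < a) (e creg β : ℝ) (hcreg : 0 ≤ creg) (hβ : 0 < β) :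
    ∃ s₀ : ℕ, ∀ s : ℕ, s₀ ≤ s → ∃ c₀ e₁ : ℝ, 0 < c₀ ∧ 0 < e₁ ∧
      ∀ (P : Params) (hPd : P.d = d + 1), P.L = L → ∀ (k : ℕ), 1 ≤ k → k ≤ P.K → k + s ≤ P.m + P.K →
      3 * (L ^ k * L ^ s) ≤ P.sitesPerDir 0 →
      ∀ (A : PBond P 0 → ℝ) (ec : ℝ), 0 < ec → ec ≤ e₁ →
      (∀ (z : Balaban1983to89.Site P 0) (μ ν : Fin P.d),
          P.spacing k * |e| / ec * |A ⟨z.shift μ, ν⟩ - A ⟨z, ν⟩| ≤ creg * ec ^ (β - 1) / (L : ℝ) ^ k) →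
      ∀ (c M0 : Fin (d + 1) → ℕ), (∀ i, c i * P.L ^ k + P.L ^ k * M0 i ≤ P.sitesPerDir 0) →
      ∀ (sg W : ℕ), 1 ≤ sg → ∀ (R R₀ R₁ : ℝ), ((rowMargin L (d + 1) k s : ℕ) : ℝ) < R → 0 ≤ R₁ → R₁ < R₀ →
        2 * (sg : ℝ) / 3 + R₀ / 2 + R ≤ W → (∀ i, ((P.L ^ k * M0 i : ℕ) : ℝ) + R ≤ P.sitesPerDir 0) →
      ∀ (x : Balaban1983to89.Site P 0), x ∈ (cubeT hPd (P.L ^ k) c fun i => P.L ^ k * M0 i) →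
        (∀ i, R₀ + R ≤ (boxCoord hPd (P.L ^ k) c x i : ℝ) ∧ (boxCoord hPd (P.L ^ k) c x i : ℝ) + (R₀ + R) ≤ (P.L ^ k * M0 i : ℕ) - 1) →
      ∀ (f : Balaban1983to89.Site P 0 → ℂ) (F D : ℝ), (∀ y, ‖f y‖ ≤ F) → 0 ≤ D → (∀ y, f y ≠ 0 → D ≤ B5Ineq137Torus.T P 0 x y) →
        ‖(gLocT (B1RG242Torus.α P a k * (P.L : ℝ) ^ (k * P.d)) P.eps⁻¹ (expGauge P e A) k
              (cubeFamB hPd (P.L ^ k) c M0 sg W (L ^ k * L ^ s)) (lamFam hPd (P.L ^ k) c M0 sg)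
              (cutoff R₁ R₀ (B5Ineq137Torus.T P 0)) *ᵥ f) x -
            (gBox (B1RG242Torus.α P a k * (P.L : ℝ) ^ (k * P.d)) P.eps⁻¹ (expGauge P e A) k univ *ᵥ f) x‖ ≤
          P.spacing k ^ 2 * (c₀ * (((⌊(((P.L : ℝ) ^ k) - 1 + R₀) / sg⌋₊ : ℝ) + 3) ^ (d + 1) *
              Real.exp (-(1 / (8 * (L : ℝ) ^ s) * (((P.L : ℝ) ^ k)⁻¹ * (2 * R)))) +
                Real.exp (-(1 / (8 * (L : ℝ) ^ s) / 2 * (((P.L : ℝ) ^ k)⁻¹ * R₁)))) *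
            Real.exp (-(1 / (8 * (L : ℝ) ^ s) / 2 * (((P.L : ℝ) ^ k)⁻¹ * D))) * F) := by
  obtain ⟨s₀, H⟩ := inputs_regular (d + 1) L (Nat.succ_pos d) hL ha e creg β hcreg hβ
  refine ⟨s₀, fun s hs => ?_⟩
  obtain ⟨c₀, e₁, hc₀, he₁, I⟩ := H s hs
  refine ⟨c₀, e₁, hc₀, he₁, ?_⟩
  intro P hPd hPL k hk1 hkK hks hsize A ec hec hece hreg c M0 hfit0 sg W hsg R R₀ R₁ hRm hR₁ hR10 hW hgap x hx hdeep f F D hF hD hsupp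
  obtain ⟨I1, -, I3⟩ := I P hPd hPL hk1 hkK hks hsize A hec hece hreg
  have hn : 1 ≤ P.L ^ k := Nat.one_le_pow _ _ P.L_pos
  have hk : 0 + k ≤ P.m + P.K := by omega
  have hR₀ : 0 ≤ R₀ := hR₁.trans hR10.le
  have hR : 0 ≤ R := le_trans (Nat.cast_nonneg _) hRm.le
  have hζ0 := cutoff_eq_zero_of_le (P := P) hR10
  have hF0 : 0 ≤ F := (norm_nonneg _).trans (hF x)
  have hδ₀ : (0 : ℝ) ≤ 1 / (8 * (L : ℝ) ^ s) := by positivity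
  have hdeep₀ := depth_mono hPd (show R₀ ≤ R₀ + R by linarith) hdeep
  set S : Finset ↥(labels (P.L ^ k) M0 sg) :=
    (activeLabels hPd (P.L ^ k) c sg R₀ (blkIter k x)).subtype fun α => α ∈ labels (P.L ^ k) M0 sg with hSdef
  have hS : ∀ (α : ↥(labels (P.L ^ k) M0 sg)) (y : Balaban1983to89.Site P 0),
      cutoff R₁ R₀ (B5Ineq137Torus.T P 0) x y * lamFam hPd (P.L ^ k) c M0 sg α x y ≠ 0 → f y ≠ 0 → α ∈ S := by
    intro α y hne _
    rw [hSdef, Finset.mem_subtype]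
    exact mem_activeLabels_of_ne_zero_of_deep hk hsg hfit0 hζ0 (mem_blockK.2 rfl) hdeep₀ hne
  have hB := opClose231_gen (B1RG242Torus.α P a k * (P.L : ℝ) ^ (k * P.d)) P.eps⁻¹ (expGauge P e A) univ univ
    (cubeFamB hPd (P.L ^ k) c M0 sg W (L ^ k * L ^ s))
    (fun α => deepRows ((rowMargin L (d + 1) k s : ℕ) : ℝ) (cubeFamB hPd (P.L ^ k) c M0 sg W (L ^ k * L ^ s) α))
    (lam := lamFam hPd (P.L ^ k) c M0 sg) (ζ'' := cutoff R₁ R₀ (B5Ineq137Torus.T P 0))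
    (sum_abs_lamT_le_one hfit0) (cutoff_mem_unitInterval R₁ R₀) hδ₀ hc₀.le I1
    (fun α x hx f F D Db Df hF hfB hD hsD hDb hsDb hDf hsDf =>
      I3 (cubeFamB hPd (P.L ^ k) c M0 sg W (L ^ k * L ^ s) α) (bbHull_bigBlock _ _) x hx f F D Db Df hF hfB hD hsD hDb hsDb hDf hsDf)
    x (mem_univ x) hR (rowHyp_i hPd hfit0 hζ0 hx hdeep₀)
    (rowHyp_ii_hull hPd hn hsg hfit0 hR hR₀ hRm hgap hW (L ^ k * L ^ s) hζ0 hx hdeep) (rowHyp_iii hR10 x) f hF hD hsupp S hS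
  refine hB.trans ?_
  have hcard : (S.card : ℝ) ≤ (⌊(((P.L : ℝ) ^ k) - 1 + R₀) / sg⌋₊ + 3) ^ (d + 1) := by
    have h1 := card_subtype_activeLabels_le (hPd := hPd) (c := c) (M0 := M0) hn hsg hR₀ (blkIter k x)
    have e1 : (((P.L ^ k : ℕ) : ℕ) : ℝ) = (P.L : ℝ) ^ k := by push_cast; rfl
    rw [hSdef]
    rw [e1] at h1
    exact h1
  have hE1 := (Real.exp_pos (-(1 / (8 * (L : ℝ) ^ s) * (((P.L : ℝ) ^ k)⁻¹ * (2 * R))))).le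
  have hE2 := (Real.exp_pos (-(1 / (8 * (L : ℝ) ^ s) / 2 * (((P.L : ℝ) ^ k)⁻¹ * D)))).le
  refine mul_le_mul_of_nonneg_left ?_ (sq_nonneg _)
  refine mul_le_mul_of_nonneg_right (mul_le_mul_of_nonneg_right (mul_le_mul_of_nonneg_left ?_ hc₀.le) hE2) hF0
  exact add_le_add (mul_le_mul_of_nonneg_right hcard hE1) le_rfl

/-- **(2.31), KERNEL FORM, `Ω = T_η`, AT A (2.23)-REGULAR NON-FLAT BACKGROUND, FOR THE PRINTED DATA WITH BIG-BLOCK CUBES**: with the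
data and hypotheses of `opClose231_regular_torus_cwt`, for every fine row `x ∈ Ω₀` of chart depth `≥ R₀ + R` and EVERY `y ∈ T^{(0)}`:
`‖G_{k,loc}(u; x, y) − G_k(T_η, u; x, y)‖ ≤ (L^kε)²·c₀·(e^{−2δ₀R/L^k} + e^{−(δ₀/2)R₁/L^k})·e^{−(δ₀/2)|x−y|_T/L^k}`, `δ₀ = 1/(8L^s)`, `u = e^{ieεA}`
— p31 v1.1's `close231_kernel_gen` BY NAME (convexity absorbs the multiplicity). [cite: BalabanImbrieJaffe1988, (2.31) p.263] -/
theorem close231_regular_torus_kernel_cwt (d L : ℕ) (hL : 2 ≤ L) {a : ℝ} (ha : 0 < a) (e creg β : ℝ) (hcreg : 0 ≤ creg)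
    (hβ : 0 < β) :
    ∃ s₀ : ℕ, ∀ s : ℕ, s₀ ≤ s → ∃ c₀ e₁ : ℝ, 0 < c₀ ∧ 0 < e₁ ∧
      ∀ (P : Params) (hPd : P.d = d + 1), P.L = L → ∀ (k : ℕ), 1 ≤ k → k ≤ P.K → k + s ≤ P.m + P.K →
      3 * (L ^ k * L ^ s) ≤ P.sitesPerDir 0 →
      ∀ (A : PBond P 0 → ℝ) (ec : ℝ), 0 < ec → ec ≤ e₁ →
      (∀ (z : Balaban1983to89.Site P 0) (μ ν : Fin P.d),
          P.spacing k * |e| / ec * |A ⟨z.shift μ, ν⟩ - A ⟨z, ν⟩| ≤ creg * ec ^ (β - 1) / (L : ℝ) ^ k) →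
      ∀ (c M0 : Fin (d + 1) → ℕ), (∀ i, c i * P.L ^ k + P.L ^ k * M0 i ≤ P.sitesPerDir 0) →
      ∀ (sg W : ℕ), 1 ≤ sg → ∀ (R R₀ R₁ : ℝ), ((rowMargin L (d + 1) k s : ℕ) : ℝ) < R → 0 ≤ R₁ → R₁ < R₀ →
        2 * (sg : ℝ) / 3 + R₀ / 2 + R ≤ W → (∀ i, ((P.L ^ k * M0 i : ℕ) : ℝ) + R ≤ P.sitesPerDir 0) →
      ∀ (x : Balaban1983to89.Site P 0), x ∈ (cubeT hPd (P.L ^ k) c fun i => P.L ^ k * M0 i) →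
        (∀ i, R₀ + R ≤ (boxCoord hPd (P.L ^ k) c x i : ℝ) ∧ (boxCoord hPd (P.L ^ k) c x i : ℝ) + (R₀ + R) ≤ (P.L ^ k * M0 i : ℕ) - 1) →
      ∀ y : Balaban1983to89.Site P 0,
        ‖gLocT (B1RG242Torus.α P a k * (P.L : ℝ) ^ (k * P.d)) P.eps⁻¹ (expGauge P e A) k
              (cubeFamB hPd (P.L ^ k) c M0 sg W (L ^ k * L ^ s)) (lamFam hPd (P.L ^ k) c M0 sg)
              (cutoff R₁ R₀ (B5Ineq137Torus.T P 0)) x y -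
            gBox (B1RG242Torus.α P a k * (P.L : ℝ) ^ (k * P.d)) P.eps⁻¹ (expGauge P e A) k univ x y‖ ≤
          P.spacing k ^ 2 * (c₀ * (Real.exp (-(1 / (8 * (L : ℝ) ^ s) * (((P.L : ℝ) ^ k)⁻¹ * (2 * R)))) +
              Real.exp (-(1 / (8 * (L : ℝ) ^ s) / 2 * (((P.L : ℝ) ^ k)⁻¹ * R₁)))) *
            Real.exp (-(1 / (8 * (L : ℝ) ^ s) / 2 * (((P.L : ℝ) ^ k)⁻¹ * B5Ineq137Torus.T P 0 x y)))) := by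
  obtain ⟨s₀, H⟩ := inputs_regular (d + 1) L (Nat.succ_pos d) hL ha e creg β hcreg hβ
  refine ⟨s₀, fun s hs => ?_⟩
  obtain ⟨c₀, e₁, hc₀, he₁, I⟩ := H s hs
  refine ⟨c₀, e₁, hc₀, he₁, ?_⟩
  intro P hPd hPL k hk1 hkK hks hsize A ec hec hece hreg c M0 hfit0 sg W hsg R R₀ R₁ hRm hR₁ hR10 hW hgap x hx hdeep y
  obtain ⟨I1, -, I3⟩ := I P hPd hPL hk1 hkK hks hsize A hec hece hreg
  have hn : 1 ≤ P.L ^ k := Nat.one_le_pow _ _ P.L_pos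
  have hR₀ : 0 ≤ R₀ := hR₁.trans hR10.le
  have hR : 0 ≤ R := le_trans (Nat.cast_nonneg _) hRm.le
  have hζ0 := cutoff_eq_zero_of_le (P := P) hR10
  have hδ₀ : (0 : ℝ) ≤ 1 / (8 * (L : ℝ) ^ s) := by positivity
  have hdeep₀ := depth_mono hPd (show R₀ ≤ R₀ + R by linarith) hdeep
  exact close231_kernel_gen (B1RG242Torus.α P a k * (P.L : ℝ) ^ (k * P.d)) P.eps⁻¹ (expGauge P e A) univ univ
    (cubeFamB hPd (P.L ^ k) c M0 sg W (L ^ k * L ^ s))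
    (fun α => deepRows ((rowMargin L (d + 1) k s : ℕ) : ℝ) (cubeFamB hPd (P.L ^ k) c M0 sg W (L ^ k * L ^ s) α))
    (lam := lamFam hPd (P.L ^ k) c M0 sg) (ζ'' := cutoff R₁ R₀ (B5Ineq137Torus.T P 0))
    (sum_abs_lamT_le_one hfit0) (cutoff_mem_unitInterval R₁ R₀) hδ₀ hc₀.le I1
    (fun α x hx f F D Db Df hF hfB hD hsD hDb hsDb hDf hsDf =>
      I3 (cubeFamB hPd (P.L ^ k) c M0 sg W (L ^ k * L ^ s) α) (bbHull_bigBlock _ _) x hx f F D Db Df hF hfB hD hsD hDb hsDb hDf hsDf)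
    x (mem_univ x) hR (rowHyp_i hPd hfit0 hζ0 hx hdeep₀)
    (rowHyp_ii_hull hPd hn hsg hfit0 hR hR₀ hRm hgap hW (L ^ k * L ^ s) hζ0 hx hdeep) (rowHyp_iii hR10 x) y

/-- **(2.30), OPERATOR FORM, AT A (2.23)-REGULAR NON-FLAT BACKGROUND, FOR THE PRINTED DATA WITH BIG-BLOCK CUBES** (p. 263:
*"|(G_{k,loc}(u)f)(x)| ≦ ce^{−c dist(suppt f,x)}‖f‖_∞, (2.30) … We assume that u is smooth in the □_α's entering the sum in (2.27)"*; here
`u = e^{ieεA}`, `A` (2.23)-regular on the whole torus): with the data and hypotheses of `opClose231_regular_torus_cwt`, for every fine row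
`x ∈ Ω₀` of chart depth `≥ R₀ + R` and every `f` with `‖f‖_∞ ≤ F` supported at sup-torus distance `≥ D ≥ 0` from `x`:
`‖(G_{k,loc}(u)f)(x)‖ ≤ (L^kε)²·m·c₀·e^{−δ₀D/L^k}·F`, `δ₀ = 1/(8L^s)`, `m = (⌊(L^k − 1 + R₀)/s_g⌋ + 3)^{d+1}` — p31 v1.1's `opDecay230_gen` BY
NAME, (H1.10″) for the big-block cubes from §3, the row activity from `rowHyp_ii_hull`. [cite: BalabanImbrieJaffe1988, (2.30) p.263] -/
theorem opDecay230_regular_cwt (d L : ℕ) (hL : 2 ≤ L) {a : ℝ} (ha : 0 < a) (e creg β : ℝ) (hcreg : 0 ≤ creg) (hβ : 0 < β) :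
    ∃ s₀ : ℕ, ∀ s : ℕ, s₀ ≤ s → ∃ c₀ e₁ : ℝ, 0 < c₀ ∧ 0 < e₁ ∧
      ∀ (P : Params) (hPd : P.d = d + 1), P.L = L → ∀ (k : ℕ), 1 ≤ k → k ≤ P.K → k + s ≤ P.m + P.K →
      3 * (L ^ k * L ^ s) ≤ P.sitesPerDir 0 →
      ∀ (A : PBond P 0 → ℝ) (ec : ℝ), 0 < ec → ec ≤ e₁ →
      (∀ (z : Balaban1983to89.Site P 0) (μ ν : Fin P.d),
          P.spacing k * |e| / ec * |A ⟨z.shift μ, ν⟩ - A ⟨z, ν⟩| ≤ creg * ec ^ (β - 1) / (L : ℝ) ^ k) →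
      ∀ (c M0 : Fin (d + 1) → ℕ), (∀ i, c i * P.L ^ k + P.L ^ k * M0 i ≤ P.sitesPerDir 0) →
      ∀ (sg W : ℕ), 1 ≤ sg → ∀ (R R₀ R₁ : ℝ), ((rowMargin L (d + 1) k s : ℕ) : ℝ) < R → 0 ≤ R₁ → R₁ < R₀ →
        2 * (sg : ℝ) / 3 + R₀ / 2 + R ≤ W → (∀ i, ((P.L ^ k * M0 i : ℕ) : ℝ) + R ≤ P.sitesPerDir 0) →
      ∀ (x : Balaban1983to89.Site P 0), x ∈ (cubeT hPd (P.L ^ k) c fun i => P.L ^ k * M0 i) →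
        (∀ i, R₀ + R ≤ (boxCoord hPd (P.L ^ k) c x i : ℝ) ∧ (boxCoord hPd (P.L ^ k) c x i : ℝ) + (R₀ + R) ≤ (P.L ^ k * M0 i : ℕ) - 1) →
      ∀ (f : Balaban1983to89.Site P 0 → ℂ) (F D : ℝ), (∀ y, ‖f y‖ ≤ F) → 0 ≤ D → (∀ y, f y ≠ 0 → D ≤ B5Ineq137Torus.T P 0 x y) →
        ‖(gLocT (B1RG242Torus.α P a k * (P.L : ℝ) ^ (k * P.d)) P.eps⁻¹ (expGauge P e A) k
              (cubeFamB hPd (P.L ^ k) c M0 sg W (L ^ k * L ^ s)) (lamFam hPd (P.L ^ k) c M0 sg)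
              (cutoff R₁ R₀ (B5Ineq137Torus.T P 0)) *ᵥ f) x‖ ≤
          P.spacing k ^ 2 * ((((⌊(((P.L : ℝ) ^ k) - 1 + R₀) / sg⌋₊ : ℝ) + 3) ^ (d + 1)) *
            (c₀ * Real.exp (-(1 / (8 * (L : ℝ) ^ s) * (((P.L : ℝ) ^ k)⁻¹ * D))) * F)) := by
  obtain ⟨s₀, H⟩ := inputs_regular (d + 1) L (Nat.succ_pos d) hL ha e creg β hcreg hβ
  refine ⟨s₀, fun s hs => ?_⟩
  obtain ⟨c₀, e₁, hc₀, he₁, I⟩ := H s hs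
  refine ⟨c₀, e₁, hc₀, he₁, ?_⟩
  intro P hPd hPL k hk1 hkK hks hsize A ec hec hece hreg c M0 hfit0 sg W hsg R R₀ R₁ hRm hR₁ hR10 hW hgap x hx hdeep f F D hF hD hsupp
  obtain ⟨-, I2, -⟩ := I P hPd hPL hk1 hkK hks hsize A hec hece hreg
  have hn : 1 ≤ P.L ^ k := Nat.one_le_pow _ _ P.L_pos
  have hk : 0 + k ≤ P.m + P.K := by omega
  have hR₀ : 0 ≤ R₀ := hR₁.trans hR10.le
  have hR : 0 ≤ R := le_trans (Nat.cast_nonneg _) hRm.le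
  have hζ0 := cutoff_eq_zero_of_le (P := P) hR10
  have hF0 : 0 ≤ F := (norm_nonneg _).trans (hF x)
  have hdeep₀ := depth_mono hPd (show R₀ ≤ R₀ + R by linarith) hdeep
  set S : Finset ↥(labels (P.L ^ k) M0 sg) :=
    (activeLabels hPd (P.L ^ k) c sg R₀ (blkIter k x)).subtype fun α => α ∈ labels (P.L ^ k) M0 sg with hSdef
  have hS : ∀ (α : ↥(labels (P.L ^ k) M0 sg)) (y : Balaban1983to89.Site P 0),
      cutoff R₁ R₀ (B5Ineq137Torus.T P 0) x y * lamFam hPd (P.L ^ k) c M0 sg α x y ≠ 0 → f y ≠ 0 → α ∈ S := by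
    intro α y hne _
    rw [hSdef, Finset.mem_subtype]
    exact mem_activeLabels_of_ne_zero_of_deep hk hsg hfit0 hζ0 (mem_blockK.2 rfl) hdeep₀ hne
  have hB := opDecay230_gen (k := k) (B1RG242Torus.α P a k * (P.L : ℝ) ^ (k * P.d)) P.eps⁻¹ (expGauge P e A)
    (cubeFamB hPd (P.L ^ k) c M0 sg W (L ^ k * L ^ s))
    (fun α => deepRows ((rowMargin L (d + 1) k s : ℕ) : ℝ) (cubeFamB hPd (P.L ^ k) c M0 sg W (L ^ k * L ^ s) α))
    (lam := lamFam hPd (P.L ^ k) c M0 sg) (ζ'' := cutoff R₁ R₀ (B5Ineq137Torus.T P 0))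
    (sum_abs_lamT_le_one hfit0) (abs_cutoff_le_one R₁ R₀) (δ₀ := 1 / (8 * (L : ℝ) ^ s)) hc₀.le
    (fun α x hx f F D hF hD hsD => I2 (cubeFamB hPd (P.L ^ k) c M0 sg W (L ^ k * L ^ s) α) (bbHull_bigBlock _ _) x hx f F D hF hD hsD)
    x f hF hD hsupp (fun α y hne => (rowHyp_ii_hull hPd hn hsg hfit0 hR hR₀ hRm hgap hW (L ^ k * L ^ s) hζ0 hx hdeep α y hne).1) S hS
  refine hB.trans ?_
  have hcard : (S.card : ℝ) ≤ (⌊(((P.L : ℝ) ^ k) - 1 + R₀) / sg⌋₊ + 3) ^ (d + 1) := by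
    have h1 := card_subtype_activeLabels_le (hPd := hPd) (c := c) (M0 := M0) hn hsg hR₀ (blkIter k x)
    have e1 : (((P.L ^ k : ℕ) : ℕ) : ℝ) = (P.L : ℝ) ^ k := by push_cast; rfl
    rw [hSdef]
    rw [e1] at h1
    exact h1
  refine mul_le_mul_of_nonneg_left (mul_le_mul_of_nonneg_right hcard ?_) (sq_nonneg _)
  exact mul_nonneg (mul_nonneg hc₀.le (Real.exp_pos _).le) hF0

end Members

/-! ## §5 (2.35) with `Ω = T_η` and (2.36) at a (2.23)-regular background, for the printed torus data with big-block cubes -/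

section DeltaMembers

variable {d : ℕ}

/-- **(2.35), `Ω = T_η`, AT A (2.23)-REGULAR NON-FLAT BACKGROUND, FOR THE PRINTED DATA WITH BIG-BLOCK CUBES** (p. 263:
*"|Δ_{k,loc}(u;x₁,x₂) − Δ_k(Ω,u;x₁,x₂)| ≦ e^{−cr(e_k)}e^{−c|x₁−x₂|} for dist({x₁,x₂},Ω^c) > O(r(e_k)), (2.35)"*; here `Ω = T_η`,
`u = e^{ieεA}`): with the data and hypotheses of `opClose231_regular_torus_cwt`, for every `k`-lattice site `y₁` whose block lies in `Ω₀` with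
chart margin `R₀ + R` and EVERY `y₂ ∈ T^{(k)}`:
`‖Δ_{k,loc}(u; y₁, y₂) − Δ_k(T_η, u; y₁, y₂)‖ ≤ A·a_k·c₀e^{δ₀/2}·(m·e^{−2δ₀R/L^k} + e^{−(δ₀/2)R₁/L^k})·e^{−(δ₀/2)|y₁−y₂|_{T^{(k)}}}`, `δ₀ = 1/(8L^s)`,
`m = (⌊(L^k − 1 + R₀)/s_g⌋ + 3)^{d+1}`, `A = α_kL^{k(d+1)}` (gen 15's counting normalization) — p31 v1.1's `close235_gen` BY NAME.
[cite: BalabanImbrieJaffe1988, (2.35) p.263] -/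
theorem close235_regular_torus_cwt (d L : ℕ) (hL : 2 ≤ L) {a : ℝ} (ha : 0 < a) (e creg β : ℝ) (hcreg : 0 ≤ creg) (hβ : 0 < β) :
    ∃ s₀ : ℕ, ∀ s : ℕ, s₀ ≤ s → ∃ c₀ e₁ : ℝ, 0 < c₀ ∧ 0 < e₁ ∧
      ∀ (P : Params) (hPd : P.d = d + 1), P.L = L → ∀ (k : ℕ), 1 ≤ k → k ≤ P.K → k + s ≤ P.m + P.K →
      3 * (L ^ k * L ^ s) ≤ P.sitesPerDir 0 →
      ∀ (A : PBond P 0 → ℝ) (ec : ℝ), 0 < ec → ec ≤ e₁ →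
      (∀ (z : Balaban1983to89.Site P 0) (μ ν : Fin P.d),
          P.spacing k * |e| / ec * |A ⟨z.shift μ, ν⟩ - A ⟨z, ν⟩| ≤ creg * ec ^ (β - 1) / (L : ℝ) ^ k) →
      ∀ (c M0 : Fin (d + 1) → ℕ), (∀ i, c i * P.L ^ k + P.L ^ k * M0 i ≤ P.sitesPerDir 0) →
      ∀ (sg W : ℕ), 1 ≤ sg → ∀ (R R₀ R₁ : ℝ), ((rowMargin L (d + 1) k s : ℕ) : ℝ) < R → 0 ≤ R₁ → R₁ < R₀ →
        2 * (sg : ℝ) / 3 + R₀ / 2 + R ≤ W → (∀ i, ((P.L ^ k * M0 i : ℕ) : ℝ) + R ≤ P.sitesPerDir 0) →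
      ∀ (y₁ y₂ : Balaban1983to89.Site P (0 + k)),
        (∀ μ, (c (Fin.cast hPd μ) : ℝ) * P.L ^ k + (R₀ + R) ≤ (P.L : ℝ) ^ k * (y₁ μ).val ∧
          (P.L : ℝ) ^ k * (y₁ μ).val + P.L ^ k + (R₀ + R) ≤ (c (Fin.cast hPd μ) : ℝ) * P.L ^ k + (P.L : ℝ) ^ k * M0 (Fin.cast hPd μ)) →
        ‖deltaLocT (B1RG242Torus.α P a k * (P.L : ℝ) ^ (k * P.d)) P.eps⁻¹ (expGauge P e A) k
              (cubeFamB hPd (P.L ^ k) c M0 sg W (L ^ k * L ^ s)) (lamFam hPd (P.L ^ k) c M0 sg)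
              (cutoff R₁ R₀ (B5Ineq137Torus.T P 0)) y₁ y₂ -
            deltaRegion (B1RG242Torus.α P a k * (P.L : ℝ) ^ (k * P.d)) P.eps⁻¹ (expGauge P e A) k univ y₁ y₂‖ ≤
          (B1RG242Torus.α P a k * (P.L : ℝ) ^ (k * P.d)) * (B1.aSeq a P.L k * (c₀ * Real.exp (1 / (8 * (L : ℝ) ^ s) / 2)) *
            (((⌊(((P.L : ℝ) ^ k) - 1 + R₀) / sg⌋₊ : ℝ) + 3) ^ (d + 1) *
                Real.exp (-(1 / (8 * (L : ℝ) ^ s) * (((P.L : ℝ) ^ k)⁻¹ * (2 * R)))) +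
              Real.exp (-(1 / (8 * (L : ℝ) ^ s) / 2 * (((P.L : ℝ) ^ k)⁻¹ * R₁)))) *
            Real.exp (-(1 / (8 * (L : ℝ) ^ s) / 2 * B5Ineq137Torus.T P (0 + k) y₁ y₂))) := by
  obtain ⟨s₀, H⟩ := inputs_regular (d + 1) L (Nat.succ_pos d) hL ha e creg β hcreg hβ
  refine ⟨s₀, fun s hs => ?_⟩
  obtain ⟨c₀, e₁, hc₀, he₁, I⟩ := H s hs
  refine ⟨c₀, e₁, hc₀, he₁, ?_⟩
  intro P hPd hPL k hk1 hkK hks hsize A ec hec hece hreg c M0 hfit0 sg W hsg R R₀ R₁ hRm hR₁ hR10 hW hgap y₁ y₂ hdeepB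
  obtain ⟨I1, -, I3⟩ := I P hPd hPL hk1 hkK hks hsize A hec hece hreg
  have hn : 1 ≤ P.L ^ k := Nat.one_le_pow _ _ P.L_pos
  have hk : 0 + k ≤ P.m + P.K := by omega
  have hR₀ : 0 ≤ R₀ := hR₁.trans hR10.le
  have hR : 0 ≤ R := le_trans (Nat.cast_nonneg _) hRm.le
  have hζ0 := cutoff_eq_zero_of_le (P := P) hR10
  have hδ₀ : (0 : ℝ) ≤ 1 / (8 * (L : ℝ) ^ s) := by positivity
  have hxdeep := fun x (hx : x ∈ blockK k y₁) => mem_and_depth_of_mem_blockK hPd hk hfit0 (by linarith : 0 ≤ R₀ + R) hdeepB hx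
  have hxdeep₀ := fun x (hx : x ∈ blockK k y₁) => depth_mono hPd (show R₀ ≤ R₀ + R by linarith) (hxdeep x hx).2
  set S : Finset ↥(labels (P.L ^ k) M0 sg) :=
    (activeLabels hPd (P.L ^ k) c sg R₀ y₁).subtype fun α => α ∈ labels (P.L ^ k) M0 sg with hSdef
  have hS : ∀ x ∈ blockK k y₁, ∀ (α : ↥(labels (P.L ^ k) M0 sg)) (y : Balaban1983to89.Site P 0),
      cutoff R₁ R₀ (B5Ineq137Torus.T P 0) x y * lamFam hPd (P.L ^ k) c M0 sg α x y ≠ 0 → α ∈ S := by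
    intro x hx α y hne
    rw [hSdef, Finset.mem_subtype]
    exact mem_activeLabels_of_ne_zero_of_deep hk hsg hfit0 hζ0 hx (hxdeep₀ x hx) hne
  have hB := close235_gen hk1 hk ha P.eps⁻¹ (expGauge P e A) univ univ
    (cubeFamB hPd (P.L ^ k) c M0 sg W (L ^ k * L ^ s))
    (fun α => deepRows ((rowMargin L (d + 1) k s : ℕ) : ℝ) (cubeFamB hPd (P.L ^ k) c M0 sg W (L ^ k * L ^ s) α))
    (lam := lamFam hPd (P.L ^ k) c M0 sg) (ζ'' := cutoff R₁ R₀ (B5Ineq137Torus.T P 0))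
    (sum_abs_lamT_le_one hfit0) (cutoff_mem_unitInterval R₁ R₀) hδ₀ hc₀.le I1
    (fun α x hx f F D Db Df hF hfB hD hsD hDb hsDb hDf hsDf =>
      I3 (cubeFamB hPd (P.L ^ k) c M0 sg W (L ^ k * L ^ s) α) (bbHull_bigBlock _ _) x hx f F D Db Df hF hfB hD hsD hDb hsDb hDf hsDf)
    hR y₁ y₂ (fun x _ => mem_univ x) (fun x hx => rowHyp_i hPd hfit0 hζ0 (hxdeep x hx).1 (hxdeep₀ x hx))
    (fun x hx => rowHyp_ii_hull hPd hn hsg hfit0 hR hR₀ hRm hgap hW (L ^ k * L ^ s) hζ0 (hxdeep x hx).1 (hxdeep x hx).2)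
    (fun x _ => rowHyp_iii hR10 x) S hS
  refine hB.trans ?_
  have hak : 0 < B1.aSeq a P.L k := B1.aSeq_pos ha (B1RG242Torus.one_lt_cast_L P) hk1
  have hα : 0 < B1RG242Torus.α P a k := mul_pos hak (inv_pos.mpr (pow_pos (P.spacing_pos k) 2))
  have hA : 0 < B1RG242Torus.α P a k * (P.L : ℝ) ^ (k * P.d) := mul_pos hα (pow_pos P.cast_L_pos _)
  have hcard : (S.card : ℝ) ≤ (⌊(((P.L : ℝ) ^ k) - 1 + R₀) / sg⌋₊ + 3) ^ (d + 1) := by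
    have h1 := card_subtype_activeLabels_le (hPd := hPd) (c := c) (M0 := M0) hn hsg hR₀ y₁
    have e1 : (((P.L ^ k : ℕ) : ℕ) : ℝ) = (P.L : ℝ) ^ k := by push_cast; rfl
    rw [hSdef]
    rw [e1] at h1
    exact h1
  have hE1 := (Real.exp_pos (-(1 / (8 * (L : ℝ) ^ s) * (((P.L : ℝ) ^ k)⁻¹ * (2 * R))))).le
  have hE3 := (Real.exp_pos (-(1 / (8 * (L : ℝ) ^ s) / 2 * (B5Ineq137Torus.T P (0 + k) y₁ y₂)))).le
  refine mul_le_mul_of_nonneg_left ?_ hA.le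
  refine mul_le_mul_of_nonneg_right ?_ hE3
  refine mul_le_mul_of_nonneg_left ?_ (mul_pos hak (mul_pos hc₀ (Real.exp_pos _))).le
  exact add_le_add (mul_le_mul_of_nonneg_right hcard hE1) le_rfl

/-- **(2.36) FOR `Δ_{k,loc}(u)` AT A (2.23)-REGULAR NON-FLAT BACKGROUND, FOR THE PRINTED DATA WITH BIG-BLOCK CUBES** (p. 263:
*"|Δ_{k,loc}(u;x₁,x₂)| ≦ ce^{−c|x₁−x₂|}, (2.36)"*; `u = e^{ieεA}`): with the data and hypotheses of `opClose231_regular_torus_cwt`, for every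
`k`-lattice site `y₁` whose block lies in `Ω₀` with chart margin `R₀ + R` and every `y₂`:
`‖Δ_{k,loc}(u; y₁, y₂)‖ ≤ A·([y₁ = y₂] + m·a_k·c₀e^{δ₀}·e^{−δ₀|y₁−y₂|_{T^{(k)}}})`, `δ₀ = 1/(8L^s)` — p31 v1.1's `decay236_gen` BY NAME, (H1.10″)
for the big-block cubes from §3. [cite: BalabanImbrieJaffe1988, (2.36) p.263] -/
theorem decay236_regular_cwt (d L : ℕ) (hL : 2 ≤ L) {a : ℝ} (ha : 0 < a) (e creg β : ℝ) (hcreg : 0 ≤ creg) (hβ : 0 < β) :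
    ∃ s₀ : ℕ, ∀ s : ℕ, s₀ ≤ s → ∃ c₀ e₁ : ℝ, 0 < c₀ ∧ 0 < e₁ ∧
      ∀ (P : Params) (hPd : P.d = d + 1), P.L = L → ∀ (k : ℕ), 1 ≤ k → k ≤ P.K → k + s ≤ P.m + P.K →
      3 * (L ^ k * L ^ s) ≤ P.sitesPerDir 0 →
      ∀ (A : PBond P 0 → ℝ) (ec : ℝ), 0 < ec → ec ≤ e₁ →
      (∀ (z : Balaban1983to89.Site P 0) (μ ν : Fin P.d),
          P.spacing k * |e| / ec * |A ⟨z.shift μ, ν⟩ - A ⟨z, ν⟩| ≤ creg * ec ^ (β - 1) / (L : ℝ) ^ k) →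
      ∀ (c M0 : Fin (d + 1) → ℕ), (∀ i, c i * P.L ^ k + P.L ^ k * M0 i ≤ P.sitesPerDir 0) →
      ∀ (sg W : ℕ), 1 ≤ sg → ∀ (R R₀ R₁ : ℝ), ((rowMargin L (d + 1) k s : ℕ) : ℝ) < R → 0 ≤ R₁ → R₁ < R₀ →
        2 * (sg : ℝ) / 3 + R₀ / 2 + R ≤ W → (∀ i, ((P.L ^ k * M0 i : ℕ) : ℝ) + R ≤ P.sitesPerDir 0) →
      ∀ (y₁ y₂ : Balaban1983to89.Site P (0 + k)),
        (∀ μ, (c (Fin.cast hPd μ) : ℝ) * P.L ^ k + (R₀ + R) ≤ (P.L : ℝ) ^ k * (y₁ μ).val ∧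
          (P.L : ℝ) ^ k * (y₁ μ).val + P.L ^ k + (R₀ + R) ≤ (c (Fin.cast hPd μ) : ℝ) * P.L ^ k + (P.L : ℝ) ^ k * M0 (Fin.cast hPd μ)) →
        ‖deltaLocT (B1RG242Torus.α P a k * (P.L : ℝ) ^ (k * P.d)) P.eps⁻¹ (expGauge P e A) k
              (cubeFamB hPd (P.L ^ k) c M0 sg W (L ^ k * L ^ s)) (lamFam hPd (P.L ^ k) c M0 sg)
              (cutoff R₁ R₀ (B5Ineq137Torus.T P 0)) y₁ y₂‖ ≤
          (B1RG242Torus.α P a k * (P.L : ℝ) ^ (k * P.d)) *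
            ((if y₁ = y₂ then 1 else 0) +
              (((⌊(((P.L : ℝ) ^ k) - 1 + R₀) / sg⌋₊ : ℝ) + 3) ^ (d + 1)) * B1.aSeq a P.L k *
                (c₀ * Real.exp (1 / (8 * (L : ℝ) ^ s))) * Real.exp (-(1 / (8 * (L : ℝ) ^ s) * B5Ineq137Torus.T P (0 + k) y₁ y₂))) := by
  obtain ⟨s₀, H⟩ := inputs_regular (d + 1) L (Nat.succ_pos d) hL ha e creg β hcreg hβ
  refine ⟨s₀, fun s hs => ?_⟩
  obtain ⟨c₀, e₁, hc₀, he₁, I⟩ := H s hs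
  refine ⟨c₀, e₁, hc₀, he₁, ?_⟩
  intro P hPd hPL k hk1 hkK hks hsize A ec hec hece hreg c M0 hfit0 sg W hsg R R₀ R₁ hRm hR₁ hR10 hW hgap y₁ y₂ hdeepB
  obtain ⟨-, I2, -⟩ := I P hPd hPL hk1 hkK hks hsize A hec hece hreg
  have hn : 1 ≤ P.L ^ k := Nat.one_le_pow _ _ P.L_pos
  have hk : 0 + k ≤ P.m + P.K := by omega
  have hR₀ : 0 ≤ R₀ := hR₁.trans hR10.le
  have hR : 0 ≤ R := le_trans (Nat.cast_nonneg _) hRm.le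
  have hζ0 := cutoff_eq_zero_of_le (P := P) hR10
  have hδ₀ : (0 : ℝ) ≤ 1 / (8 * (L : ℝ) ^ s) := by positivity
  have hxdeep := fun x (hx : x ∈ blockK k y₁) => mem_and_depth_of_mem_blockK hPd hk hfit0 (by linarith : 0 ≤ R₀ + R) hdeepB hx
  have hxdeep₀ := fun x (hx : x ∈ blockK k y₁) => depth_mono hPd (show R₀ ≤ R₀ + R by linarith) (hxdeep x hx).2
  set S : Finset ↥(labels (P.L ^ k) M0 sg) :=
    (activeLabels hPd (P.L ^ k) c sg R₀ y₁).subtype fun α => α ∈ labels (P.L ^ k) M0 sg with hSdef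
  have hS : ∀ x ∈ blockK k y₁, ∀ (α : ↥(labels (P.L ^ k) M0 sg)) (y : Balaban1983to89.Site P 0),
      cutoff R₁ R₀ (B5Ineq137Torus.T P 0) x y * lamFam hPd (P.L ^ k) c M0 sg α x y ≠ 0 → α ∈ S := by
    intro x hx α y hne
    rw [hSdef, Finset.mem_subtype]
    exact mem_activeLabels_of_ne_zero_of_deep hk hsg hfit0 hζ0 hx (hxdeep₀ x hx) hne
  have hB := decay236_gen hk1 hk ha P.eps⁻¹ (expGauge P e A)
    (cubeFamB hPd (P.L ^ k) c M0 sg W (L ^ k * L ^ s))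
    (fun α => deepRows ((rowMargin L (d + 1) k s : ℕ) : ℝ) (cubeFamB hPd (P.L ^ k) c M0 sg W (L ^ k * L ^ s) α))
    (lam := lamFam hPd (P.L ^ k) c M0 sg) (ζ'' := cutoff R₁ R₀ (B5Ineq137Torus.T P 0))
    (sum_abs_lamT_le_one hfit0) (abs_cutoff_le_one R₁ R₀) hδ₀ hc₀.le
    (fun α x hx f F D hF hD hsD => I2 (cubeFamB hPd (P.L ^ k) c M0 sg W (L ^ k * L ^ s) α) (bbHull_bigBlock _ _) x hx f F D hF hD hsD)
    y₁ y₂ (fun x hx α y hne => (rowHyp_ii_hull hPd hn hsg hfit0 hR hR₀ hRm hgap hW (L ^ k * L ^ s) hζ0 (hxdeep x hx).1 (hxdeep x hx).2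
      α y hne).1) S hS
  refine hB.trans ?_
  have hak : 0 < B1.aSeq a P.L k := B1.aSeq_pos ha (B1RG242Torus.one_lt_cast_L P) hk1
  have hα : 0 < B1RG242Torus.α P a k := mul_pos hak (inv_pos.mpr (pow_pos (P.spacing_pos k) 2))
  have hA : 0 < B1RG242Torus.α P a k * (P.L : ℝ) ^ (k * P.d) := mul_pos hα (pow_pos P.cast_L_pos _)
  have hcard : (S.card : ℝ) ≤ (⌊(((P.L : ℝ) ^ k) - 1 + R₀) / sg⌋₊ + 3) ^ (d + 1) := by
    have h1 := card_subtype_activeLabels_le (hPd := hPd) (c := c) (M0 := M0) hn hsg hR₀ y₁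
    have e1 : (((P.L ^ k : ℕ) : ℕ) : ℝ) = (P.L : ℝ) ^ k := by push_cast; rfl
    rw [hSdef]
    rw [e1] at h1
    exact h1
  refine mul_le_mul_of_nonneg_left (add_le_add le_rfl ?_) hA.le
  refine mul_le_mul_of_nonneg_right (mul_le_mul_of_nonneg_right (mul_le_mul_of_nonneg_right hcard hak.le)
    (mul_pos hc₀ (Real.exp_pos _)).le) ?_
  exact (Real.exp_pos _).le

end DeltaMembers

/-! ## §6 (v1.1) The COVARIANT-DERIVATIVE analogue of (2.31) with `Ω = T_η` at a (2.23)-regular background, for the printed torus data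
with big-block cubes -/

section Deriv

variable {d : ℕ}

open BIJ88Sect3Statements (cfg covD)
open BIJ88NeumannPropagatorFlatClose231 (norm_rowSource_le rowSource_ne_zero abs_lam_le_one)
open BIJ88LocDeriv230FlatTorus (exists_abs_cutoff_sub_le T_shift_le_one abs_T_shift_sub_le norm_rowSource_sub_le)
open BIJ88LocDeriv231FlatTorus (covD_gLocT_sub_apply norm_tail_le norm_tailDiff_le T_gt_of_tail_ne_zero T_gt_of_tailDiff_ne_zero)
open BIJ85NeumannPropagatorRegularDeriv (input110_deriv_regular_univ input112_deriv_regular_deep)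
open BIJ88Cutoffs21 (cutoff_nonneg cutoff_le_one)

set_option maxHeartbeats 400000 in
/-- **THE COVARIANT-DERIVATIVE ANALOGUE OF (2.31) WITH `Ω = T_η` AT A (2.23)-REGULAR NON-FLAT BACKGROUND `u = e^{ieεA}`, FOR THE PRINTED
LOCALIZATION DATA WITH BIG-BLOCK CUBES** (p. 263: *"Bounds analogous to (2.30), (2.31) hold for covariant derivatives and Hölder derivatives of
G_{k,loc}(u) of order less than two"* — the (2.31)-analogue for the covariant derivative, region `Ω = T_η`, *"smoothness throughout"* in the
(2.23)-regular form).  `∃ s₀ ∀ s ≥ s₀ ∃ c₀ e₁ > 0` (from `(d, L, a, e, c, β, s)`) such that on every torus of the series (`P.d = d+1`, `P.L = L ≥ 2`),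
at every level `1 ≤ k ≤ K`, `k + s ≤ m + K`, `3L^kL^s ≤ |T^{(0)}|`, for every `A` (2.23)-regular on `T^{(0)}` (`0 < e_k ≤ e₁`), every reference
no-wrap box `Ω₀ = c·L^k + Π_i[0, L^kM₀_i)` shorter than the torus with torus gap `≥ R`, grid spacing `s_g ≥ 1`, half-width
`W ≥ 2s_g/3 + R₀/2 + R`, radii `R > rowMargin + 1`, `0 ≤ R₁ < R₀`, every bond `⟨x, x+e_μ⟩` with BOTH endpoints in `Ω₀` at chart depth `≥ R₀ + R`,
and every `f` with `‖f‖_∞ ≤ F` supported at sup-torus distance `≥ D ≥ 0` from `x`: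
`‖D_u(G_{k,loc}(u)f)(⟨x,μ⟩) − D_u(G_k(T_η,u)f)(⟨x,μ⟩)‖ ≤`
`(L^kε)·c₀·[m(1 + L^k((R₀−R₁)⁻¹ + s_g⁻¹))e^{−δ₀(2R−1)/L^k} + (1 + L^k(R₀−R₁)⁻¹)e^{−(δ₀/2)(R₁−1)/L^k}]·e^{−(δ₀/2)D/L^k}·F`, `δ₀ = 1/(8L^s)`,
`m = (⌊(L^k−1+R₀)/s_g⌋+3)^{d+1}`, `D_u = covD ε⁻¹ (cfg u)` — r18 gen 23's four-term proof (`deriv231_wholeTorus_flat_cwt`: p29's bond identity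
`covD_gLocT_sub_apply` and tails, VERBATIM) with the four flat inputs replaced by r01's (2.23)-regular providers: the derivative member of
(1.11)–(1.12) for `bbHull □_α ⊆ T^{(0)}` (`input112_deriv_regular_deep`, p347438), the value member of (1.12) and of (1.10) on the torus
(§3 `inputs_regular`), the derivative member of (1.10) on the torus (`input110_deriv_regular_univ`); the cubes active at either endpoint are
`rowMargin`-deep around the source `x` because `R > rowMargin + 1` (`rowHyp_ii_hull` at the far endpoint and `|T(x+e_μ,·) − T(x,·)| ≤ 1`).
[cite: BalabanImbrieJaffe1988, (2.31) p.263] -/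
theorem deriv231_regular_torus_cwt (d L : ℕ) (hL : 2 ≤ L) {a : ℝ} (ha : 0 < a) (e creg β : ℝ) (hcreg : 0 ≤ creg) (hβ : 0 < β) :
    ∃ s₀ : ℕ, ∀ s : ℕ, s₀ ≤ s → ∃ c₀ e₁ : ℝ, 0 < c₀ ∧ 0 < e₁ ∧
      ∀ (P : Params) (hPd : P.d = d + 1), P.L = L → ∀ (k : ℕ), 1 ≤ k → k ≤ P.K → k + s ≤ P.m + P.K →
      3 * (L ^ k * L ^ s) ≤ P.sitesPerDir 0 →
      ∀ (A : PBond P 0 → ℝ) (ec : ℝ), 0 < ec → ec ≤ e₁ →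
      (∀ (z : Balaban1983to89.Site P 0) (μ ν : Fin P.d),
          P.spacing k * |e| / ec * |A ⟨z.shift μ, ν⟩ - A ⟨z, ν⟩| ≤ creg * ec ^ (β - 1) / (L : ℝ) ^ k) →
      ∀ (c M0 : Fin (d + 1) → ℕ), (∀ i, c i * P.L ^ k + P.L ^ k * M0 i ≤ P.sitesPerDir 0) → (∀ i, P.L ^ k * M0 i < P.sitesPerDir 0) →
      ∀ (sg W : ℕ), 1 ≤ sg → ∀ (R R₀ R₁ : ℝ), ((rowMargin L (d + 1) k s : ℕ) : ℝ) + 1 < R → 0 ≤ R₁ → R₁ < R₀ →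
        2 * (sg : ℝ) / 3 + R₀ / 2 + R ≤ W → (∀ i, ((P.L ^ k * M0 i : ℕ) : ℝ) + R ≤ P.sitesPerDir 0) →
      ∀ (x : Balaban1983to89.Site P 0) (μ : Fin P.d),
        x ∈ (cubeT hPd (P.L ^ k) c fun i => P.L ^ k * M0 i) →
        (∀ i, R₀ + R ≤ (boxCoord hPd (P.L ^ k) c x i : ℝ) ∧ (boxCoord hPd (P.L ^ k) c x i : ℝ) + (R₀ + R) ≤ (P.L ^ k * M0 i : ℕ) - 1) →
        x.shift μ ∈ (cubeT hPd (P.L ^ k) c fun i => P.L ^ k * M0 i) →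
        (∀ i, R₀ + R ≤ (boxCoord hPd (P.L ^ k) c (x.shift μ) i : ℝ) ∧
          (boxCoord hPd (P.L ^ k) c (x.shift μ) i : ℝ) + (R₀ + R) ≤ (P.L ^ k * M0 i : ℕ) - 1) →
      ∀ (f : Balaban1983to89.Site P 0 → ℂ) (F D : ℝ), (∀ y, ‖f y‖ ≤ F) → 0 ≤ D → (∀ y, f y ≠ 0 → D ≤ B5Ineq137Torus.T P 0 x y) →
        ‖covD P.eps⁻¹ (cfg (expGauge P e A))
              (gLocT (B1RG242Torus.α P a k * (P.L : ℝ) ^ (k * P.d)) P.eps⁻¹ (expGauge P e A) k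
                (cubeFamB hPd (P.L ^ k) c M0 sg W (L ^ k * L ^ s)) (lamFam hPd (P.L ^ k) c M0 sg)
                (cutoff R₁ R₀ (B5Ineq137Torus.T P 0)) *ᵥ f) ⟨x, μ⟩ -
            covD P.eps⁻¹ (cfg (expGauge P e A))
              (gBox (B1RG242Torus.α P a k * (P.L : ℝ) ^ (k * P.d)) P.eps⁻¹ (expGauge P e A) k univ *ᵥ f) ⟨x, μ⟩‖ ≤
          P.spacing k * (c₀ * ((((⌊(((P.L : ℝ) ^ k) - 1 + R₀) / sg⌋₊ : ℝ) + 3) ^ (d + 1)) *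
                (1 + (P.L : ℝ) ^ k * ((R₀ - R₁)⁻¹ + (sg : ℝ)⁻¹)) *
                Real.exp (-(1 / (8 * (L : ℝ) ^ s) * (((P.L : ℝ) ^ k)⁻¹ * (2 * R - 1)))) +
              (1 + (P.L : ℝ) ^ k * (R₀ - R₁)⁻¹) * Real.exp (-(1 / (8 * (L : ℝ) ^ s) / 2 * (((P.L : ℝ) ^ k)⁻¹ * (R₁ - 1))))) *
            Real.exp (-(1 / (8 * (L : ℝ) ^ s) / 2 * (((P.L : ℝ) ^ k)⁻¹ * D))) * F) := by
  obtain ⟨s₁, H1⟩ := input112_deriv_regular_deep (d + 1) L (Nat.succ_pos d) hL ha e creg β hcreg hβ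
  obtain ⟨s₂, H23⟩ := inputs_regular (d + 1) L (Nat.succ_pos d) hL ha e creg β hcreg hβ
  obtain ⟨s₃, H3⟩ := input110_deriv_regular_univ (d + 1) L (Nat.succ_pos d) hL ha e creg β hcreg hβ
  obtain ⟨K, hK0, hK⟩ := exists_abs_cutoff_sub_le
  set Λ₀ : ℝ := max K (3 * Real.pi * (d + 1 : ℕ) / 2) with hΛ₀def
  have hΛ₀0 : 0 ≤ Λ₀ := hK0.trans (le_max_left _ _)
  have hΛ₀K : K ≤ Λ₀ := le_max_left _ _
  refine ⟨max s₁ (max s₂ s₃), fun s hs => ?_⟩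
  have hs₁ : s₁ ≤ s := (le_max_left _ _).trans hs
  have hs₂ : s₂ ≤ s := ((le_max_left _ _).trans (le_max_right _ _)).trans hs
  have hs₃ : s₃ ≤ s := ((le_max_right _ _).trans (le_max_right _ _)).trans hs
  obtain ⟨c₁, e₁, hc₁, he₁, G1⟩ := H1 s hs₁
  obtain ⟨c₂, e₂, hc₂, he₂, G23⟩ := H23 s hs₂
  obtain ⟨c₃, e₃, hc₃, he₃, G3⟩ := H3 s hs₃
  set C : ℝ := max (max c₁ (2 * c₂ * Λ₀ + 1)) (max c₃ (c₂ * Λ₀ + 1)) with hCdef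
  have hC1 : c₁ ≤ C := (le_max_left _ _).trans (le_max_left _ _)
  have hC2 : 2 * c₂ * Λ₀ + 1 ≤ C := (le_max_right _ _).trans (le_max_left _ _)
  have hC3 : c₃ ≤ C := (le_max_left _ _).trans (le_max_right _ _)
  have hC4 : c₂ * Λ₀ + 1 ≤ C := (le_max_right _ _).trans (le_max_right _ _)
  have hC0 : 0 ≤ C := hc₁.le.trans hC1
  refine ⟨C, min e₁ (min e₂ e₃), lt_of_lt_of_le hc₁ hC1, lt_min he₁ (lt_min he₂ he₃), ?_⟩
  intro P hPd hPL k hk1 hkK hks hsize A ec hec hece hreg c M0 hfit0 hN0 sg W hsg R R₀ R₁ hRm hR₁ hR10 hW hgap x μ hx hdeep hxe hdeepe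
    f F D hF hD hsupp
  obtain ⟨I1, -, I3⟩ := G23 P hPd hPL hk1 hkK hks hsize A hec (hece.trans ((min_le_right _ _).trans (min_le_left _ _))) hreg
  have hece₁ : ec ≤ e₁ := hece.trans (min_le_left _ _)
  have hece₃ : ec ≤ e₃ := hece.trans ((min_le_right _ _).trans (min_le_right _ _))
  have hn : 1 ≤ P.L ^ k := Nat.one_le_pow _ _ P.L_pos
  have hk : 0 + k ≤ P.m + P.K := by omega
  have hρR : ((rowMargin L (d + 1) k s : ℕ) : ℝ) < R := by linarith
  have hR1 : 1 < R := by
    have : (0 : ℝ) ≤ ((rowMargin L (d + 1) k s : ℕ) : ℝ) := Nat.cast_nonneg _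
    linarith
  have hR0 : 0 ≤ R := zero_le_one.trans hR1.le
  have hR₀ : 0 ≤ R₀ := hR₁.trans hR10.le
  have hs0 : 0 < sg := hsg
  have hsr : (0 : ℝ) < sg := by exact_mod_cast hs0
  have hgap' : 0 < R₀ - R₁ := sub_pos.2 hR10
  have hLr : (0 : ℝ) < L := by exact_mod_cast (show 0 < L by omega)
  have hLs : (0 : ℝ) < (L : ℝ) ^ s := pow_pos hLr s
  have hLpos : (0 : ℝ) < P.L := P.cast_L_pos
  have hLk : (0 : ℝ) < (P.L : ℝ) ^ k := pow_pos hLpos _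
  have hε : 0 < ((P.L : ℝ) ^ k)⁻¹ := inv_pos.mpr hLk
  have hF0 : 0 ≤ F := (norm_nonneg _).trans (hF x)
  have hsp0 : 0 < P.spacing k := P.spacing_pos k
  have heps : 0 < P.eps := P.eps_pos
  have hζ0 := cutoff_eq_zero_of_le (P := P) hR10
  have hdeep₀ := depth_mono hPd (show R₀ ≤ R₀ + R by linarith) hdeep
  have hdeepe₀ := depth_mono hPd (show R₀ ≤ R₀ + R by linarith) hdeepe
  -- the rate and its comparisons
  set δ : ℝ := 1 / (8 * (L : ℝ) ^ s) with hδdef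
  have hδ0 : 0 < δ := by positivity
  have hδ4 : δ ≤ 1 / (4 * (L : ℝ) ^ s) := one_div_le_one_div_of_le (by positivity) (by nlinarith)
  -- abbreviations
  set A' : ℝ := B1RG242Torus.α P a k * (P.L : ℝ) ^ (k * P.d) with hA'def
  set U : GaugeField P 0 U1 := expGauge P e A with hUdef
  set ζ := cutoff R₁ R₀ (B5Ineq137Torus.T P 0) with hζdef
  set x' := x.shift μ with hx'def
  set cubeB := cubeFamB hPd (P.L ^ k) c M0 sg W (L ^ k * L ^ s) with hcubeBdef
  set G₀ := gBox A' P.eps⁻¹ U k univ with hG₀def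
  set m : ℝ := ((⌊(((P.L : ℝ) ^ k) - 1 + R₀) / sg⌋₊ : ℝ) + 3) ^ (d + 1) with hmdef
  have hm0 : 0 ≤ m := by rw [hmdef]; positivity
  set E : ℝ := Real.exp (-(δ / 2 * (((P.L : ℝ) ^ k)⁻¹ * D))) with hEdef
  set E2R : ℝ := Real.exp (-(δ * (((P.L : ℝ) ^ k)⁻¹ * (2 * R - 1)))) with hE2Rdef
  set ER1 : ℝ := Real.exp (-(δ / 2 * (((P.L : ℝ) ^ k)⁻¹ * (R₁ - 1)))) with hER1def
  have hE0 : 0 < E := Real.exp_pos _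
  have hE2R0 : 0 < E2R := Real.exp_pos _
  have hER10 : 0 < ER1 := Real.exp_pos _
  have hεD : 0 ≤ ((P.L : ℝ) ^ k)⁻¹ * D := mul_nonneg hε.le hD
  have hε2R : 0 ≤ ((P.L : ℝ) ^ k)⁻¹ * (2 * R - 1) := mul_nonneg hε.le (by linarith)
  have hED : ∀ {δ'}, δ ≤ δ' → Real.exp (-(δ' * (((P.L : ℝ) ^ k)⁻¹ * D))) ≤ E := by
    intro δ' hδ'
    refine (exp_le_exp_of_rate hδ' hεD).trans (Real.exp_le_exp.2 ?_)
    have := mul_nonneg hδ0.le hεD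
    linarith
  have hE2 : ∀ {δ'}, δ ≤ δ' → Real.exp (-(δ' * (((P.L : ℝ) ^ k)⁻¹ * (R - 1 + R)))) ≤ E2R := by
    intro δ' hδ'
    rw [show R - 1 + R = 2 * R - 1 by ring]
    exact exp_le_exp_of_rate hδ' hε2R
  set D' : ℝ := max D (R₁ - 1) with hD'def
  have hD'D : D ≤ D' := le_max_left _ _
  have hD'R : R₁ - 1 ≤ D' := le_max_right _ _
  have hD'0 : 0 ≤ D' := hD.trans hD'D
  have hED' : ∀ {δ'}, δ ≤ δ' → Real.exp (-(δ' * (((P.L : ℝ) ^ k)⁻¹ * D'))) ≤ E * ER1 := by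
    intro δ' hδ'
    rw [hEdef, hER1def, ← Real.exp_add]
    refine Real.exp_le_exp.2 ?_
    have hD'0' : 0 ≤ ((P.L : ℝ) ^ k)⁻¹ * D' := mul_nonneg hε.le hD'0
    have h1 : δ * (((P.L : ℝ) ^ k)⁻¹ * D') ≤ δ' * (((P.L : ℝ) ^ k)⁻¹ * D') := mul_le_mul_of_nonneg_right hδ' hD'0'
    have h2 : δ / 2 * (((P.L : ℝ) ^ k)⁻¹ * D) + δ / 2 * (((P.L : ℝ) ^ k)⁻¹ * (R₁ - 1)) ≤ δ * (((P.L : ℝ) ^ k)⁻¹ * D') := by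
      have : D + (R₁ - 1) ≤ 2 * D' := by linarith
      calc δ / 2 * (((P.L : ℝ) ^ k)⁻¹ * D) + δ / 2 * (((P.L : ℝ) ^ k)⁻¹ * (R₁ - 1))
          = δ / 2 * (((P.L : ℝ) ^ k)⁻¹ * (D + (R₁ - 1))) := by ring
        _ ≤ δ / 2 * (((P.L : ℝ) ^ k)⁻¹ * (2 * D')) :=
            mul_le_mul_of_nonneg_left (mul_le_mul_of_nonneg_left this hε.le) (by positivity)
        _ = δ * (((P.L : ℝ) ^ k)⁻¹ * D') := by ring
    linarith
  -- the sources
  set g' : ↥(labels (P.L ^ k) M0 sg) → Balaban1983to89.Site P 0 → ℂ :=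
    fun α y => (ζ x' y : ℂ) * (lamFam hPd (P.L ^ k) c M0 sg α x' y : ℂ) * f y with hg'def
  set dg : ↥(labels (P.L ^ k) M0 sg) → Balaban1983to89.Site P 0 → ℂ :=
    fun α y => ((ζ x' y : ℂ) * (lamFam hPd (P.L ^ k) c M0 sg α x' y : ℂ) - (ζ x y : ℂ) * (lamFam hPd (P.L ^ k) c M0 sg α x y : ℂ)) * f y
    with hdgdef
  set q' : Balaban1983to89.Site P 0 → ℂ := fun y => ((ζ x' y : ℂ) - 1) * f y with hq'def
  set dq : Balaban1983to89.Site P 0 → ℂ := fun y => ((ζ x' y : ℂ) - (ζ x y : ℂ)) * f y with hdqdef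
  -- the four-term identity (row hypothesis (i) at both endpoints)
  have hid : covD P.eps⁻¹ (cfg U) (gLocT A' P.eps⁻¹ U k cubeB (lamFam hPd (P.L ^ k) c M0 sg) ζ *ᵥ f) ⟨x, μ⟩ -
      covD P.eps⁻¹ (cfg U) (G₀ *ᵥ f) ⟨x, μ⟩ =
      ∑ α, (covD P.eps⁻¹ (cfg U) (gBox A' P.eps⁻¹ U k (cubeB α) *ᵥ g' α) ⟨x, μ⟩ - covD P.eps⁻¹ (cfg U) (G₀ *ᵥ g' α) ⟨x, μ⟩) +
      ∑ α, ((P.eps⁻¹ : ℝ) : ℂ) * ((gBox A' P.eps⁻¹ U k (cubeB α) *ᵥ dg α) x - (G₀ *ᵥ dg α) x) +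
      covD P.eps⁻¹ (cfg U) (G₀ *ᵥ q') ⟨x, μ⟩ + ((P.eps⁻¹ : ℝ) : ℂ) * (G₀ *ᵥ dq) x :=
    covD_gLocT_sub_apply P.eps⁻¹ (cfg U) A' P.eps⁻¹ U k cubeB (lamFam hPd (P.L ^ k) c M0 sg) ζ G₀ f ⟨x, μ⟩
      (rowHyp_i hPd hfit0 hζ0 hxe hdeepe₀) (rowHyp_i hPd hfit0 hζ0 hx hdeep₀)
  rw [hid]
  -- the active-label sets of the two endpoints
  set Sx : Finset ↥(labels (P.L ^ k) M0 sg) := (activeLabels hPd (P.L ^ k) c sg R₀ (blkIter k x)).subtype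
    fun α => α ∈ labels (P.L ^ k) M0 sg with hSxdef
  set Sx' : Finset ↥(labels (P.L ^ k) M0 sg) := (activeLabels hPd (P.L ^ k) c sg R₀ (blkIter k x')).subtype
    fun α => α ∈ labels (P.L ^ k) M0 sg with hSx'def
  have hcardx : (Sx.card : ℝ) ≤ m := by
    have h1 := card_subtype_activeLabels_le (hPd := hPd) (c := c) (M0 := M0) hn hs0 hR₀ (blkIter k x)
    have e1 : (((P.L ^ k : ℕ) : ℕ) : ℝ) = (P.L : ℝ) ^ k := by push_cast; rfl
    rw [hSxdef, hmdef]; rw [e1] at h1; exact h1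
  have hcardx' : (Sx'.card : ℝ) ≤ m := by
    have h1 := card_subtype_activeLabels_le (hPd := hPd) (c := c) (M0 := M0) hn hs0 hR₀ (blkIter k x')
    have e1 : (((P.L ^ k : ℕ) : ℕ) : ℝ) = (P.L : ℝ) ^ k := by push_cast; rfl
    rw [hSx'def, hmdef]; rw [e1] at h1; exact h1
  have hSx : ∀ (α : ↥(labels (P.L ^ k) M0 sg)) (y : Balaban1983to89.Site P 0),
      ζ x y * lamFam hPd (P.L ^ k) c M0 sg α x y ≠ 0 → α ∈ Sx := by
    intro α y hne
    rw [hSxdef, Finset.mem_subtype]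
    exact mem_activeLabels_of_ne_zero_of_deep hk hs0 hfit0 hζ0 (mem_blockK.2 rfl) hdeep₀ hne
  have hSx' : ∀ (α : ↥(labels (P.L ^ k) M0 sg)) (y : Balaban1983to89.Site P 0),
      ζ x' y * lamFam hPd (P.L ^ k) c M0 sg α x' y ≠ 0 → α ∈ Sx' := by
    intro α y hne
    rw [hSx'def, Finset.mem_subtype]
    exact mem_activeLabels_of_ne_zero_of_deep hk hs0 hfit0 hζ0 (mem_blockK.2 rfl) hdeepe₀ hne
  have hcardU : ((Sx ∪ Sx').card : ℝ) ≤ 2 * m := by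
    have h1 : ((Sx ∪ Sx').card : ℝ) ≤ (Sx.card : ℝ) + (Sx'.card : ℝ) := by exact_mod_cast Finset.card_union_le _ _
    linarith
  -- geometry of an active hull READ AGAINST THE WHOLE TORUS, at either endpoint: the source `x` is `rowMargin`-deep in the hull,
  -- `T_η ∖ hull` is `≥ R − 1` away from `x` and `≥ R` away from every active source
  have hgeo' : ∀ (α : ↥(labels (P.L ^ k) M0 sg)) (y₀ : Balaban1983to89.Site P 0), ζ x' y₀ * lamFam hPd (P.L ^ k) c M0 sg α x' y₀ ≠ 0 →
      x ∈ deepRows ((rowMargin L (d + 1) k s : ℕ) : ℝ) (cubeB α) ∧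
      (∀ w, w ∉ cubeB α → R - 1 ≤ B5Ineq137Torus.T P 0 x w) ∧
      (∀ y, ζ x' y * lamFam hPd (P.L ^ k) c M0 sg α x' y ≠ 0 → y ∈ cubeB α ∧ ∀ w, w ∉ cubeB α → R ≤ B5Ineq137Torus.T P 0 y w) := by
    intro α y₀ hy₀
    have H := rowHyp_ii_hull hPd hn hs0 hfit0 hR0 hR₀ hρR hgap hW (L ^ k * L ^ s) hζ0 hxe hdeepe
    obtain ⟨-, -, hfar⟩ := H α y₀ hy₀
    have hfarx : ∀ w, w ∉ cubeB α → R - 1 ≤ B5Ineq137Torus.T P 0 x w := by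
      intro w hnot
      have h1 := (hfar w hnot).1
      have h2 := abs_le.1 (abs_T_shift_sub_le x w μ)
      linarith
    refine ⟨mem_deepRows.2 fun y hy => ?_, hfarx, fun y hy => ⟨(H α y hy).2.1, fun w hw => ((H α y hy).2.2 w hw).2⟩⟩
    by_contra hnot
    have := hfarx y hnot
    linarith
  have hgeo : ∀ (α : ↥(labels (P.L ^ k) M0 sg)) (y₀ : Balaban1983to89.Site P 0), ζ x y₀ * lamFam hPd (P.L ^ k) c M0 sg α x y₀ ≠ 0 →
      x ∈ deepRows ((rowMargin L (d + 1) k s : ℕ) : ℝ) (cubeB α) ∧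
      (∀ w, w ∉ cubeB α → R - 1 ≤ B5Ineq137Torus.T P 0 x w) ∧
      (∀ y, ζ x y * lamFam hPd (P.L ^ k) c M0 sg α x y ≠ 0 → y ∈ cubeB α ∧ ∀ w, w ∉ cubeB α → R ≤ B5Ineq137Torus.T P 0 y w) := by
    intro α y₀ hy₀
    have H := rowHyp_ii_hull hPd hn hs0 hfit0 hR0 hR₀ hρR hgap hW (L ^ k * L ^ s) hζ0 hx hdeep
    obtain ⟨hxd, -, hfar⟩ := H α y₀ hy₀
    exact ⟨hxd, fun w hnot => by linarith [(hfar w hnot).1],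
      fun y hy => ⟨(H α y hy).2.1, fun w hw => ((H α y hy).2.2 w hw).2⟩⟩
  have hrow_of_deep : ∀ {α : ↥(labels (P.L ^ k) M0 sg)}, x ∈ deepRows ((rowMargin L (d + 1) k s : ℕ) : ℝ) (cubeB α) →
      ∀ y, B5Ineq137Torus.T P 0 x y ≤
        ((2 * (5 * (L ^ k * L ^ s) / 8 + L ^ k) + 2 * (L ^ k * L ^ s) * (d + 1 + 1) + 1 : ℕ) : ℝ) → y ∈ cubeB α := by
    intro α hxd y hy
    refine (mem_deepRows.1 hxd) y ?_
    unfold rowMargin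
    exact hy
  have hζabs : ∀ z y, |ζ z y| ≤ 1 := fun z y => by
    rw [hζdef, abs_of_nonneg (cutoff_nonneg _ _ _ _ _)]; exact cutoff_le_one _ _ _ _ _
  have huniv : ∀ z z' : Balaban1983to89.Site P 0,
      (∀ ν, (z ν).val / (L ^ k * L ^ s) = (z' ν).val / (L ^ k * L ^ s)) →
        (z ∈ (univ : Finset (Balaban1983to89.Site P 0)) ↔ z' ∈ (univ : Finset (Balaban1983to89.Site P 0))) :=
    fun z z' _ => by simp
  -- TERM 1: the derivative member of (1.11)–(1.12) for `hull □_α ⊂ T_η` at the regular background (r01), for the hulls active at `x'`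
  set B₁ : ℝ := P.spacing k * (c₁ * Real.exp (-(δ * (((P.L : ℝ) ^ k)⁻¹ * D))) *
    Real.exp (-(δ * (((P.L : ℝ) ^ k)⁻¹ * (R - 1 + R)))) * F) with hB₁def
  have hB₁0 : 0 ≤ B₁ := by positivity
  have hterm1 : ∀ α, ‖covD P.eps⁻¹ (cfg U) (gBox A' P.eps⁻¹ U k (cubeB α) *ᵥ g' α) ⟨x, μ⟩ -
      covD P.eps⁻¹ (cfg U) (G₀ *ᵥ g' α) ⟨x, μ⟩‖ ≤ B₁ := by
    intro α
    by_cases hex : ∃ y, ζ x' y * lamFam hPd (P.L ^ k) c M0 sg α x' y ≠ 0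
    · obtain ⟨y₀, hy₀⟩ := hex
      obtain ⟨hxd, hfarx, hsrc⟩ := hgeo' α y₀ hy₀
      have hsuppα : ∀ y, y ∉ cubeB α → g' α y = 0 := by
        intro y hy
        by_contra hne
        exact hy (hsrc y (rowSource_ne_zero hne).1).1
      have hDf : ∀ y, g' α y ≠ 0 → ∀ w, w ∉ cubeB α → R ≤ B5Ineq137Torus.T P 0 y w :=
        fun y hy w hw' => (hsrc y (rowSource_ne_zero hy).1).2 w hw'
      have h1 := G1 P hPd hPL hk1 hkK hks hsize (cubeB α) univ (bbHull_bigBlock _ _) huniv (subset_univ _) A hec hece₁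
        (fun z _ μ' ν => hreg z μ' ν) x (hrow_of_deep hxd) (g' α) F D (R - 1) R
        (fun y => norm_rowSource_le (hζabs x' y) (abs_lam_le_one (sum_abs_lamT_le_one hfit0) α x' y) hF y)
        hsuppα (fun y hy => hsupp y (rowSource_ne_zero hy).2) hfarx hDf μ
      have e1 : covD P.eps⁻¹ (cfg U) (G₀ *ᵥ g' α) ⟨x, μ⟩ =
          covD P.eps⁻¹ (cfg (expGauge P e A)) (gBox A' P.eps⁻¹ (expGauge P e A) k univ *ᵥ g' α) ⟨x, μ⟩ := by rw [hG₀def]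
      rw [e1]
      exact h1
    · push Not at hex
      have h0 : g' α = 0 := by
        funext y; rw [hg'def]; dsimp only; rw [← Complex.ofReal_mul, hex y, Complex.ofReal_zero, zero_mul]; rfl
      rw [h0, mulVec_zero, mulVec_zero]
      simp only [covD, Pi.zero_apply, mul_zero, sub_zero, norm_zero]
      exact hB₁0
  have hzero1 : ∀ α, α ∉ Sx' → covD P.eps⁻¹ (cfg U) (gBox A' P.eps⁻¹ U k (cubeB α) *ᵥ g' α) ⟨x, μ⟩ -
      covD P.eps⁻¹ (cfg U) (G₀ *ᵥ g' α) ⟨x, μ⟩ = 0 := by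
    intro α hα
    have h0 : g' α = 0 := by
      funext y
      by_contra hne
      exact hα (hSx' α y (rowSource_ne_zero hne).1)
    rw [h0, mulVec_zero, mulVec_zero]
    simp only [covD, Pi.zero_apply, mul_zero, sub_zero]
  have hsum1 : ‖∑ α, (covD P.eps⁻¹ (cfg U) (gBox A' P.eps⁻¹ U k (cubeB α) *ᵥ g' α) ⟨x, μ⟩ -
      covD P.eps⁻¹ (cfg U) (G₀ *ᵥ g' α) ⟨x, μ⟩)‖ ≤ m * B₁ := by
    rw [← Finset.sum_subset (Finset.subset_univ Sx') (fun α _ hα => hzero1 α hα)]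
    calc ‖∑ α ∈ Sx', (covD P.eps⁻¹ (cfg U) (gBox A' P.eps⁻¹ U k (cubeB α) *ᵥ g' α) ⟨x, μ⟩ -
            covD P.eps⁻¹ (cfg U) (G₀ *ᵥ g' α) ⟨x, μ⟩)‖
        ≤ ∑ α ∈ Sx', ‖covD P.eps⁻¹ (cfg U) (gBox A' P.eps⁻¹ U k (cubeB α) *ᵥ g' α) ⟨x, μ⟩ -
            covD P.eps⁻¹ (cfg U) (G₀ *ᵥ g' α) ⟨x, μ⟩‖ := norm_sum_le _ _
      _ ≤ ∑ α ∈ Sx', B₁ := Finset.sum_le_sum fun α _ => hterm1 α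
      _ = Sx'.card * B₁ := by rw [Finset.sum_const, nsmul_eq_mul]
      _ ≤ m * B₁ := mul_le_mul_of_nonneg_right hcardx' hB₁0
  -- TERM 2: the value member of (1.11)–(1.12) for `hull □_α ⊂ T_η` (§3), on the difference sources, hulls active at `x` or `x'`
  set Λ : ℝ := K / (R₀ - R₁) + 3 * Real.pi * (d + 1 : ℕ) / (2 * sg) with hΛdef
  have hΛ0 : 0 ≤ Λ := by rw [hΛdef]; positivity
  set B₂ : ℝ := P.spacing k ^ 2 * (c₂ * Real.exp (-(δ * (((P.L : ℝ) ^ k)⁻¹ * D))) *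
    Real.exp (-(δ * (((P.L : ℝ) ^ k)⁻¹ * (R - 1 + R)))) * (Λ * F)) with hB₂def
  have hB₂0 : 0 ≤ B₂ := by positivity
  have hterm2 : ∀ α, ‖(gBox A' P.eps⁻¹ U k (cubeB α) *ᵥ dg α) x - (G₀ *ᵥ dg α) x‖ ≤ B₂ := by
    intro α
    by_cases hex : ∃ y, dg α y ≠ 0
    · obtain ⟨y₀, hy₀⟩ := hex
      have hact : ∀ y, dg α y ≠ 0 →
          ζ x' y * lamFam hPd (P.L ^ k) c M0 sg α x' y ≠ 0 ∨ ζ x y * lamFam hPd (P.L ^ k) c M0 sg α x y ≠ 0 := by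
        intro y hy
        by_contra hno
        rw [not_or, not_not, not_not] at hno
        apply hy
        rw [hdgdef]; dsimp only
        rw [← Complex.ofReal_mul, ← Complex.ofReal_mul, hno.1, hno.2]; simp
      have hxfar : x ∈ deepRows ((rowMargin L (d + 1) k s : ℕ) : ℝ) (cubeB α) ∧
          ∀ w, w ∉ cubeB α → R - 1 ≤ B5Ineq137Torus.T P 0 x w := by
        rcases hact y₀ hy₀ with h1 | h1
        · exact ⟨(hgeo' α y₀ h1).1, (hgeo' α y₀ h1).2.1⟩
        · exact ⟨(hgeo α y₀ h1).1, (hgeo α y₀ h1).2.1⟩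
      obtain ⟨hxd, hfarx⟩ := hxfar
      have hsuppα : ∀ y, y ∉ cubeB α → dg α y = 0 := by
        intro y hy
        by_contra hne
        rcases hact y hne with h1 | h1
        · exact hy ((hgeo' α y h1).2.2 y h1).1
        · exact hy ((hgeo α y h1).2.2 y h1).1
      have hDf : ∀ y, dg α y ≠ 0 → ∀ w, w ∉ cubeB α → R ≤ B5Ineq137Torus.T P 0 y w := by
        intro y hy w hw'
        rcases hact y hy with h1 | h1
        · exact ((hgeo' α y h1).2.2 y h1).2 w hw'
        · exact ((hgeo α y h1).2.2 y h1).2 w hw'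
      have h2 := I3 (cubeB α) (bbHull_bigBlock _ _) x hxd (dg α) (Λ * F) D (R - 1) R
        (fun y => norm_rowSource_sub_le hPd hs0 hfit0 hN0 hK0 hR10 (hK R₁ R₀ hR10 (B5Ineq137Torus.T P 0)) α.1 hx hxe hF y)
        hsuppα hD (fun y hy => hsupp y (right_ne_zero_of_mul hy)) (by linarith) hfarx hR0 hDf
      have e2 : (gBox A' P.eps⁻¹ U k (cubeB α) *ᵥ dg α) x - (G₀ *ᵥ dg α) x =
          (gBox A' P.eps⁻¹ (expGauge P e A) k (cubeB α) *ᵥ dg α) x - (gBox A' P.eps⁻¹ (expGauge P e A) k univ *ᵥ dg α) x := by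
        rw [hG₀def]
      rw [e2]
      exact h2
    · push Not at hex
      have h0 : dg α = 0 := funext hex
      rw [h0, mulVec_zero, mulVec_zero, Pi.zero_apply, sub_zero, norm_zero]
      exact hB₂0
  have hzero2 : ∀ α, α ∉ Sx ∪ Sx' → (gBox A' P.eps⁻¹ U k (cubeB α) *ᵥ dg α) x - (G₀ *ᵥ dg α) x = 0 := by
    intro α hα
    rw [Finset.mem_union, not_or] at hα
    have h0 : dg α = 0 := by
      funext y
      rw [hdgdef]; dsimp only
      have h1 : ζ x' y * lamFam hPd (P.L ^ k) c M0 sg α x' y = 0 := by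
        by_contra hne; exact hα.2 (hSx' α y hne)
      have h2 : ζ x y * lamFam hPd (P.L ^ k) c M0 sg α x y = 0 := by
        by_contra hne; exact hα.1 (hSx α y hne)
      rw [← Complex.ofReal_mul, ← Complex.ofReal_mul, h1, h2]; simp
    rw [h0, mulVec_zero, mulVec_zero, Pi.zero_apply, sub_zero]
  have hsum2 : ‖∑ α, ((P.eps⁻¹ : ℝ) : ℂ) * ((gBox A' P.eps⁻¹ U k (cubeB α) *ᵥ dg α) x - (G₀ *ᵥ dg α) x)‖ ≤
      P.eps⁻¹ * (2 * m * B₂) := by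
    rw [← Finset.mul_sum, norm_mul, Complex.norm_real, Real.norm_eq_abs, abs_of_pos (inv_pos.mpr heps)]
    refine mul_le_mul_of_nonneg_left ?_ (inv_pos.mpr heps).le
    rw [← Finset.sum_subset (Finset.subset_univ (Sx ∪ Sx')) (fun α _ hα => hzero2 α hα)]
    calc ‖∑ α ∈ Sx ∪ Sx', ((gBox A' P.eps⁻¹ U k (cubeB α) *ᵥ dg α) x - (G₀ *ᵥ dg α) x)‖
        ≤ ∑ α ∈ Sx ∪ Sx', ‖(gBox A' P.eps⁻¹ U k (cubeB α) *ᵥ dg α) x - (G₀ *ᵥ dg α) x‖ := norm_sum_le _ _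
      _ ≤ ∑ α ∈ Sx ∪ Sx', B₂ := Finset.sum_le_sum fun α _ => hterm2 α
      _ = (Sx ∪ Sx').card * B₂ := by rw [Finset.sum_const, nsmul_eq_mul]
      _ ≤ 2 * m * B₂ := mul_le_mul_of_nonneg_right hcardU hB₂0
  -- TERM 3: the derivative member of (1.10) for `G_k(T_η,u)` at the regular background (r01), on the tail `q'`
  set B₃ : ℝ := P.spacing k * (c₃ * Real.exp (-(1 / (4 * (L : ℝ) ^ s) * (((P.L : ℝ) ^ k)⁻¹ * D'))) * F) with hB₃def
  have hterm3 : ‖covD P.eps⁻¹ (cfg U) (G₀ *ᵥ q') ⟨x, μ⟩‖ ≤ B₃ := by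
    have hsq : ∀ y, q' y ≠ 0 → D' ≤ B5Ineq137Torus.T P 0 x y := fun y hy => by
      obtain ⟨hf, hT⟩ := T_gt_of_tail_ne_zero hR10 x μ hy
      exact max_le (hsupp y hf) hT.le
    have h3 := G3 P hPd hPL hk1 hkK hks hsize A hec hece₃ hreg x q' F D' (fun y => norm_tail_le x' hF y) hsq μ
    have e3 : covD P.eps⁻¹ (cfg U) (G₀ *ᵥ q') ⟨x, μ⟩ =
        covD P.eps⁻¹ (cfg (expGauge P e A)) (gBox A' P.eps⁻¹ (expGauge P e A) k univ *ᵥ q') ⟨x, μ⟩ := by rw [hG₀def]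
    rw [e3]
    exact h3
  -- TERM 4: the value member of (1.10) for `G_k(T_η,u)` (§3), on the tail difference `dq`
  set B₄ : ℝ := P.spacing k ^ 2 * (c₂ * Real.exp (-(δ * (((P.L : ℝ) ^ k)⁻¹ * D'))) * (K / (R₀ - R₁) * F)) with hB₄def
  have hterm4 : ‖((P.eps⁻¹ : ℝ) : ℂ) * (G₀ *ᵥ dq) x‖ ≤ P.eps⁻¹ * B₄ := by
    rw [norm_mul, Complex.norm_real, Real.norm_eq_abs, abs_of_pos (inv_pos.mpr heps)]
    refine mul_le_mul_of_nonneg_left ?_ (inv_pos.mpr heps).le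
    have hsq : ∀ y, dq y ≠ 0 → D' ≤ B5Ineq137Torus.T P 0 x y := fun y hy => by
      obtain ⟨hf, hT⟩ := T_gt_of_tailDiff_ne_zero hR10 x μ hy
      exact max_le (hsupp y hf) hT.le
    have h4 := I1 x (mem_univ x) dq (K / (R₀ - R₁) * F) D'
      (fun y => norm_tailDiff_le hK0 hR10 (hK R₁ R₀ hR10 (B5Ineq137Torus.T P 0)) x μ hF y) hD'0 hsq
    have e4 : (G₀ *ᵥ dq) x = (gBox A' P.eps⁻¹ (expGauge P e A) k univ *ᵥ dq) x := by rw [hG₀def]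
    rw [e4]
    exact h4
  -- assembling (verbatim from gen 23, with `c₄ = c₂`, `δ₁ = δ₂ = δ₄ = δ`, `δ₃ = 1/(4L^s)`)
  have hscale : P.eps⁻¹ * P.spacing k ^ 2 = P.spacing k * (P.L : ℝ) ^ k := by
    rw [Params.spacing]
    field_simp
  have hΛle : Λ ≤ Λ₀ * ((R₀ - R₁)⁻¹ + (sg : ℝ)⁻¹) := by
    rw [hΛdef, mul_add]
    refine add_le_add ?_ ?_
    · rw [div_eq_mul_inv]
      exact mul_le_mul_of_nonneg_right (le_max_left _ _) (inv_pos.mpr hgap').le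
    · have e5 : 3 * Real.pi * (d + 1 : ℕ) / (2 * sg) = (3 * Real.pi * (d + 1 : ℕ) / 2) * (sg : ℝ)⁻¹ := by
        field_simp
      rw [e5]
      exact mul_le_mul_of_nonneg_right (le_max_right _ _) (inv_pos.mpr hsr).le
  have hKle : K / (R₀ - R₁) ≤ Λ₀ * (R₀ - R₁)⁻¹ := by
    rw [div_eq_mul_inv]; exact mul_le_mul_of_nonneg_right hΛ₀K (inv_pos.mpr hgap').le
  have h1 : m * B₁ ≤ P.spacing k * (C * (m * 1 * E2R) * E * F) := by
    have : B₁ ≤ P.spacing k * (C * E2R * E * F) := by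
      rw [hB₁def]
      refine mul_le_mul_of_nonneg_left ?_ hsp0.le
      have := mul_le_mul (mul_le_mul hC1 (hED le_rfl) (Real.exp_pos _).le hC0) (hE2 le_rfl) (Real.exp_pos _).le (by positivity)
      calc c₁ * Real.exp (-(δ * (((P.L : ℝ) ^ k)⁻¹ * D))) * Real.exp (-(δ * (((P.L : ℝ) ^ k)⁻¹ * (R - 1 + R)))) * F
          ≤ C * E * E2R * F := mul_le_mul_of_nonneg_right this hF0
        _ = C * E2R * E * F := by ring
    calc m * B₁ ≤ m * (P.spacing k * (C * E2R * E * F)) := mul_le_mul_of_nonneg_left this hm0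
      _ = P.spacing k * (C * (m * 1 * E2R) * E * F) := by ring
  have h2 : P.eps⁻¹ * (2 * m * B₂) ≤ P.spacing k * (C * (m * ((P.L : ℝ) ^ k * ((R₀ - R₁)⁻¹ + (sg : ℝ)⁻¹)) * E2R) * E * F) := by
    have e6 : P.eps⁻¹ * (2 * m * B₂) = P.spacing k * ((2 * c₂ * Λ) * m * (P.L : ℝ) ^ k *
        (Real.exp (-(δ * (((P.L : ℝ) ^ k)⁻¹ * D))) * Real.exp (-(δ * (((P.L : ℝ) ^ k)⁻¹ * (R - 1 + R))))) * F) := by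
      rw [hB₂def]
      have : P.eps⁻¹ * (2 * m * (P.spacing k ^ 2 * (c₂ * Real.exp (-(δ * (((P.L : ℝ) ^ k)⁻¹ * D))) *
          Real.exp (-(δ * (((P.L : ℝ) ^ k)⁻¹ * (R - 1 + R)))) * (Λ * F)))) =
          (P.eps⁻¹ * P.spacing k ^ 2) * (2 * c₂ * Λ * m *
            (Real.exp (-(δ * (((P.L : ℝ) ^ k)⁻¹ * D))) * Real.exp (-(δ * (((P.L : ℝ) ^ k)⁻¹ * (R - 1 + R))))) * F) := by ring
      rw [this, hscale]; ring
    rw [e6]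
    refine mul_le_mul_of_nonneg_left ?_ hsp0.le
    have hcoef : 2 * c₂ * Λ * m * (P.L : ℝ) ^ k ≤ C * (m * ((P.L : ℝ) ^ k * ((R₀ - R₁)⁻¹ + (sg : ℝ)⁻¹))) := by
      have h3' : 2 * c₂ * Λ ≤ C * ((R₀ - R₁)⁻¹ + (sg : ℝ)⁻¹) := by
        calc 2 * c₂ * Λ ≤ 2 * c₂ * (Λ₀ * ((R₀ - R₁)⁻¹ + (sg : ℝ)⁻¹)) := mul_le_mul_of_nonneg_left hΛle (by positivity)
          _ = (2 * c₂ * Λ₀) * ((R₀ - R₁)⁻¹ + (sg : ℝ)⁻¹) := by ring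
          _ ≤ C * ((R₀ - R₁)⁻¹ + (sg : ℝ)⁻¹) := mul_le_mul_of_nonneg_right (by linarith) (by positivity)
      calc 2 * c₂ * Λ * m * (P.L : ℝ) ^ k = (2 * c₂ * Λ) * (m * (P.L : ℝ) ^ k) := by ring
        _ ≤ (C * ((R₀ - R₁)⁻¹ + (sg : ℝ)⁻¹)) * (m * (P.L : ℝ) ^ k) := mul_le_mul_of_nonneg_right h3' (by positivity)
        _ = C * (m * ((P.L : ℝ) ^ k * ((R₀ - R₁)⁻¹ + (sg : ℝ)⁻¹))) := by ring
    have hexp : Real.exp (-(δ * (((P.L : ℝ) ^ k)⁻¹ * D))) * Real.exp (-(δ * (((P.L : ℝ) ^ k)⁻¹ * (R - 1 + R)))) ≤ E2R * E := by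
      calc _ ≤ E * E2R := mul_le_mul (hED le_rfl) (hE2 le_rfl) (Real.exp_pos _).le hE0.le
        _ = E2R * E := mul_comm _ _
    calc 2 * c₂ * Λ * m * (P.L : ℝ) ^ k *
          (Real.exp (-(δ * (((P.L : ℝ) ^ k)⁻¹ * D))) * Real.exp (-(δ * (((P.L : ℝ) ^ k)⁻¹ * (R - 1 + R))))) * F
        ≤ C * (m * ((P.L : ℝ) ^ k * ((R₀ - R₁)⁻¹ + (sg : ℝ)⁻¹))) * (E2R * E) * F :=
          mul_le_mul_of_nonneg_right (mul_le_mul hcoef hexp (by positivity) (by positivity)) hF0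
      _ = C * (m * ((P.L : ℝ) ^ k * ((R₀ - R₁)⁻¹ + (sg : ℝ)⁻¹)) * E2R) * E * F := by ring
  have h3 : B₃ ≤ P.spacing k * (C * (1 * ER1) * E * F) := by
    rw [hB₃def]
    refine mul_le_mul_of_nonneg_left ?_ hsp0.le
    calc c₃ * Real.exp (-(1 / (4 * (L : ℝ) ^ s) * (((P.L : ℝ) ^ k)⁻¹ * D'))) * F ≤ C * (E * ER1) * F :=
          mul_le_mul_of_nonneg_right (mul_le_mul hC3 (hED' hδ4) (Real.exp_pos _).le hC0) hF0
      _ = C * (1 * ER1) * E * F := by ring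
  have h4 : P.eps⁻¹ * B₄ ≤ P.spacing k * (C * ((P.L : ℝ) ^ k * (R₀ - R₁)⁻¹ * ER1) * E * F) := by
    have e7 : P.eps⁻¹ * B₄ = P.spacing k * ((c₂ * (K / (R₀ - R₁))) * (P.L : ℝ) ^ k * Real.exp (-(δ * (((P.L : ℝ) ^ k)⁻¹ * D'))) * F) := by
      rw [hB₄def]
      have : P.eps⁻¹ * (P.spacing k ^ 2 * (c₂ * Real.exp (-(δ * (((P.L : ℝ) ^ k)⁻¹ * D'))) * (K / (R₀ - R₁) * F))) =
          (P.eps⁻¹ * P.spacing k ^ 2) * (c₂ * (K / (R₀ - R₁)) * Real.exp (-(δ * (((P.L : ℝ) ^ k)⁻¹ * D'))) * F) := by ring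
      rw [this, hscale]; ring
    rw [e7]
    refine mul_le_mul_of_nonneg_left ?_ hsp0.le
    have hcoef : c₂ * (K / (R₀ - R₁)) * (P.L : ℝ) ^ k ≤ C * ((P.L : ℝ) ^ k * (R₀ - R₁)⁻¹) := by
      have h5 : c₂ * (K / (R₀ - R₁)) ≤ C * (R₀ - R₁)⁻¹ := by
        calc c₂ * (K / (R₀ - R₁)) ≤ c₂ * (Λ₀ * (R₀ - R₁)⁻¹) := mul_le_mul_of_nonneg_left hKle hc₂.le
          _ = (c₂ * Λ₀) * (R₀ - R₁)⁻¹ := by ring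
          _ ≤ C * (R₀ - R₁)⁻¹ := mul_le_mul_of_nonneg_right (by linarith) (inv_pos.mpr hgap').le
      calc c₂ * (K / (R₀ - R₁)) * (P.L : ℝ) ^ k ≤ C * (R₀ - R₁)⁻¹ * (P.L : ℝ) ^ k := mul_le_mul_of_nonneg_right h5 hLk.le
        _ = C * ((P.L : ℝ) ^ k * (R₀ - R₁)⁻¹) := by ring
    calc c₂ * (K / (R₀ - R₁)) * (P.L : ℝ) ^ k * Real.exp (-(δ * (((P.L : ℝ) ^ k)⁻¹ * D'))) * F
        ≤ C * ((P.L : ℝ) ^ k * (R₀ - R₁)⁻¹) * (E * ER1) * F :=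
          mul_le_mul_of_nonneg_right (mul_le_mul hcoef (hED' le_rfl) (Real.exp_pos _).le (by positivity)) hF0
      _ = C * ((P.L : ℝ) ^ k * (R₀ - R₁)⁻¹ * ER1) * E * F := by ring
  refine ((norm_add_le _ _).trans (add_le_add ((norm_add_le _ _).trans (add_le_add ((norm_add_le _ _).trans
    (add_le_add hsum1 hsum2)) hterm3)) hterm4)).trans ?_
  calc m * B₁ + P.eps⁻¹ * (2 * m * B₂) + B₃ + P.eps⁻¹ * B₄
      ≤ P.spacing k * (C * (m * 1 * E2R) * E * F) +
          P.spacing k * (C * (m * ((P.L : ℝ) ^ k * ((R₀ - R₁)⁻¹ + (sg : ℝ)⁻¹)) * E2R) * E * F) +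
        P.spacing k * (C * (1 * ER1) * E * F) + P.spacing k * (C * ((P.L : ℝ) ^ k * (R₀ - R₁)⁻¹ * ER1) * E * F) :=
        add_le_add (add_le_add (add_le_add h1 h2) h3) h4
    _ = P.spacing k * (C * (m * (1 + (P.L : ℝ) ^ k * ((R₀ - R₁)⁻¹ + (sg : ℝ)⁻¹)) * E2R +
          (1 + (P.L : ℝ) ^ k * (R₀ - R₁)⁻¹) * ER1) * E * F) := by
        ring

end Deriv

/-! ## §7 (v1.2) The COVARIANT-DERIVATIVE analogue of (2.30) for `G_{k,loc}(u)` at a (2.23)-regular background, for the printed torus data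
with big-block cubes -/

section Deriv230

variable {d : ℕ}

open BIJ88Sect3Statements (cfg covD)
open BIJ88NeumannPropagatorFlatClose231 (norm_rowSource_le rowSource_ne_zero abs_lam_le_one)
open BIJ88LocDeriv230FlatTorus (exists_abs_cutoff_sub_le abs_T_shift_sub_le norm_rowSource_sub_le covD_gLocT_apply)
open BIJ85NeumannPropagatorRegularDeriv (input110_deriv_regular_deep)
open BIJ88Cutoffs21 (cutoff_nonneg cutoff_le_one)

/-- **THE COVARIANT-DERIVATIVE ANALOGUE OF (2.30) AT A (2.23)-REGULAR NON-FLAT BACKGROUND `u = e^{ieεA}`, FOR THE PRINTED LOCALIZATION DATA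
WITH BIG-BLOCK CUBES** (p. 263: *"Bounds analogous to (2.30), (2.31) hold for covariant derivatives … of G_{k,loc}(u) of order less than
two"* — the (2.30)-analogue for the covariant derivative, *"smoothness throughout"* in the (2.23)-regular form).  `∃ s₀ ∀ s ≥ s₀ ∃ c₀ e₁ > 0`
(from `(d, L, a, e, c, β, s)`) such that on every torus of the series, at every level `1 ≤ k ≤ K`, `k + s ≤ m + K`, `3L^kL^s ≤ |T^{(0)}|`, for
every `A` (2.23)-regular on `T^{(0)}` (`0 < e_k ≤ e₁`), every reference box `Ω₀` (torus gap `≥ R`), grid spacing `s_g ≥ 1`, half-width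
`W ≥ 2s_g/3 + R₀/2 + R`, radii `R > rowMargin + 1`, `0 ≤ R₁ < R₀`, every bond `⟨x, x+e_μ⟩` with both endpoints in `Ω₀` at chart depth
`≥ R₀ + R`, and every `f` with `‖f‖_∞ ≤ F` supported at sup-torus distance `≥ D ≥ 0` from `x`:
`‖D_u(G_{k,loc}(u)f)(⟨x,μ⟩)‖ ≤ (L^kε)·c₀·m·(1 + L^k((R₀−R₁)⁻¹ + s_g⁻¹))·e^{−δ₀D/L^k}·F`, `δ₀ = 1/(8L^s)`, `m = (⌊(L^k−1+R₀)/s_g⌋+3)^{d+1}` —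
p29's two-term proof of `deriv230_flat_cwt` (bond identity `covD_gLocT_apply`, Lipschitz data `norm_rowSource_sub_le`, VERBATIM) with the two
flat inputs replaced by r01's (2.23)-regular providers for the big-block hulls at `rowMargin`-deep rows: the derivative member of (1.10)
(`input110_deriv_regular_deep`, p347438) for the hulls active at `x + e_μ` and the value member of (1.10) (§3 `inputs_regular`) on the difference
sources; the source `x` is `rowMargin`-deep in every hull active at either endpoint because `R > rowMargin + 1` (`rowHyp_ii_hull`).
[cite: BalabanImbrieJaffe1988, (2.30) p.263] -/
theorem deriv230_regular_cwt (d L : ℕ) (hL : 2 ≤ L) {a : ℝ} (ha : 0 < a) (e creg β : ℝ) (hcreg : 0 ≤ creg) (hβ : 0 < β) :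
    ∃ s₀ : ℕ, ∀ s : ℕ, s₀ ≤ s → ∃ c₀ e₁ : ℝ, 0 < c₀ ∧ 0 < e₁ ∧
      ∀ (P : Params) (hPd : P.d = d + 1), P.L = L → ∀ (k : ℕ), 1 ≤ k → k ≤ P.K → k + s ≤ P.m + P.K →
      3 * (L ^ k * L ^ s) ≤ P.sitesPerDir 0 →
      ∀ (A : PBond P 0 → ℝ) (ec : ℝ), 0 < ec → ec ≤ e₁ →
      (∀ (z : Balaban1983to89.Site P 0) (μ ν : Fin P.d),
          P.spacing k * |e| / ec * |A ⟨z.shift μ, ν⟩ - A ⟨z, ν⟩| ≤ creg * ec ^ (β - 1) / (L : ℝ) ^ k) →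
      ∀ (c M0 : Fin (d + 1) → ℕ), (∀ i, c i * P.L ^ k + P.L ^ k * M0 i ≤ P.sitesPerDir 0) → (∀ i, P.L ^ k * M0 i < P.sitesPerDir 0) →
      ∀ (sg W : ℕ), 1 ≤ sg → ∀ (R R₀ R₁ : ℝ), ((rowMargin L (d + 1) k s : ℕ) : ℝ) + 1 < R → 0 ≤ R₁ → R₁ < R₀ →
        2 * (sg : ℝ) / 3 + R₀ / 2 + R ≤ W → (∀ i, ((P.L ^ k * M0 i : ℕ) : ℝ) + R ≤ P.sitesPerDir 0) →
      ∀ (x : Balaban1983to89.Site P 0) (μ : Fin P.d),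
        x ∈ (cubeT hPd (P.L ^ k) c fun i => P.L ^ k * M0 i) →
        (∀ i, R₀ + R ≤ (boxCoord hPd (P.L ^ k) c x i : ℝ) ∧ (boxCoord hPd (P.L ^ k) c x i : ℝ) + (R₀ + R) ≤ (P.L ^ k * M0 i : ℕ) - 1) →
        x.shift μ ∈ (cubeT hPd (P.L ^ k) c fun i => P.L ^ k * M0 i) →
        (∀ i, R₀ + R ≤ (boxCoord hPd (P.L ^ k) c (x.shift μ) i : ℝ) ∧
          (boxCoord hPd (P.L ^ k) c (x.shift μ) i : ℝ) + (R₀ + R) ≤ (P.L ^ k * M0 i : ℕ) - 1) →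
      ∀ (f : Balaban1983to89.Site P 0 → ℂ) (F D : ℝ), (∀ y, ‖f y‖ ≤ F) → 0 ≤ D → (∀ y, f y ≠ 0 → D ≤ B5Ineq137Torus.T P 0 x y) →
        ‖covD P.eps⁻¹ (cfg (expGauge P e A))
            (gLocT (B1RG242Torus.α P a k * (P.L : ℝ) ^ (k * P.d)) P.eps⁻¹ (expGauge P e A) k
              (cubeFamB hPd (P.L ^ k) c M0 sg W (L ^ k * L ^ s)) (lamFam hPd (P.L ^ k) c M0 sg)
              (cutoff R₁ R₀ (B5Ineq137Torus.T P 0)) *ᵥ f) ⟨x, μ⟩‖ ≤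
          P.spacing k * (c₀ * (((⌊(((P.L : ℝ) ^ k) - 1 + R₀) / sg⌋₊ : ℝ) + 3) ^ (d + 1)) *
            (1 + (P.L : ℝ) ^ k * ((R₀ - R₁)⁻¹ + (sg : ℝ)⁻¹)) * Real.exp (-(1 / (8 * (L : ℝ) ^ s) * (((P.L : ℝ) ^ k)⁻¹ * D))) * F) := by
  obtain ⟨s₁, H1⟩ := input110_deriv_regular_deep (d + 1) L (Nat.succ_pos d) hL ha e creg β hcreg hβ
  obtain ⟨s₂, H2⟩ := inputs_regular (d + 1) L (Nat.succ_pos d) hL ha e creg β hcreg hβ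
  obtain ⟨K, hK0, hK⟩ := exists_abs_cutoff_sub_le
  set Λ₀ : ℝ := max K (3 * Real.pi * (d + 1 : ℕ) / 2) with hΛ₀def
  have hΛ₀0 : 0 ≤ Λ₀ := hK0.trans (le_max_left _ _)
  refine ⟨max s₁ s₂, fun s hs => ?_⟩
  have hs₁ : s₁ ≤ s := (le_max_left _ _).trans hs
  have hs₂ : s₂ ≤ s := (le_max_right _ _).trans hs
  obtain ⟨c₁, e₁, hc₁, he₁, G1⟩ := H1 s hs₁
  obtain ⟨c₂, e₂, hc₂, he₂, G2⟩ := H2 s hs₂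
  set C : ℝ := max c₁ (2 * c₂ * Λ₀ + 1) with hCdef
  have hC1 : c₁ ≤ C := le_max_left _ _
  have hC2 : 2 * c₂ * Λ₀ + 1 ≤ C := le_max_right _ _
  have hC0 : 0 ≤ C := hc₁.le.trans hC1
  refine ⟨C, min e₁ e₂, lt_of_lt_of_le hc₁ hC1, lt_min he₁ he₂, ?_⟩
  intro P hPd hPL k hk1 hkK hks hsize A ec hec hece hreg c M0 hfit0 hN0 sg W hsg R R₀ R₁ hRm hR₁ hR10 hW hgap x μ hx hdeep hxe hdeepe
    f F D hF hD hsupp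
  obtain ⟨-, I2, -⟩ := G2 P hPd hPL hk1 hkK hks hsize A hec (hece.trans (min_le_right _ _)) hreg
  have hece₁ : ec ≤ e₁ := hece.trans (min_le_left _ _)
  have hn : 1 ≤ P.L ^ k := Nat.one_le_pow _ _ P.L_pos
  have hk : 0 + k ≤ P.m + P.K := by omega
  have hρR : ((rowMargin L (d + 1) k s : ℕ) : ℝ) < R := by linarith
  have hR1 : 1 < R := by
    have : (0 : ℝ) ≤ ((rowMargin L (d + 1) k s : ℕ) : ℝ) := Nat.cast_nonneg _
    linarith
  have hR0 : 0 ≤ R := zero_le_one.trans hR1.le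
  have hR₀ : 0 ≤ R₀ := hR₁.trans hR10.le
  have hs0 : 0 < sg := hsg
  have hsr : (0 : ℝ) < sg := by exact_mod_cast hs0
  have hgap' : 0 < R₀ - R₁ := sub_pos.2 hR10
  have hLr : (0 : ℝ) < L := by exact_mod_cast (show 0 < L by omega)
  have hLs : (0 : ℝ) < (L : ℝ) ^ s := pow_pos hLr s
  have hLpos : (0 : ℝ) < P.L := P.cast_L_pos
  have hLk : (0 : ℝ) < (P.L : ℝ) ^ k := pow_pos hLpos _
  have hε : 0 < ((P.L : ℝ) ^ k)⁻¹ := inv_pos.mpr hLk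
  have hF0 : 0 ≤ F := (norm_nonneg _).trans (hF x)
  have hsp0 : 0 < P.spacing k := P.spacing_pos k
  have heps : 0 < P.eps := P.eps_pos
  have hζ0 := cutoff_eq_zero_of_le (P := P) hR10
  have hdeep₀ := depth_mono hPd (show R₀ ≤ R₀ + R by linarith) hdeep
  have hdeepe₀ := depth_mono hPd (show R₀ ≤ R₀ + R by linarith) hdeepe
  -- the rate
  set δ : ℝ := 1 / (8 * (L : ℝ) ^ s) with hδdef
  have hδ0 : 0 < δ := by positivity
  have hδ4 : δ ≤ 1 / (4 * (L : ℝ) ^ s) := one_div_le_one_div_of_le (by positivity) (by nlinarith)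
  -- abbreviations
  set A' : ℝ := B1RG242Torus.α P a k * (P.L : ℝ) ^ (k * P.d) with hA'def
  set U : GaugeField P 0 U1 := expGauge P e A with hUdef
  set ζ := cutoff R₁ R₀ (B5Ineq137Torus.T P 0) with hζdef
  set x' := x.shift μ with hx'def
  set cubeB := cubeFamB hPd (P.L ^ k) c M0 sg W (L ^ k * L ^ s) with hcubeBdef
  set m : ℝ := ((⌊(((P.L : ℝ) ^ k) - 1 + R₀) / sg⌋₊ : ℝ) + 3) ^ (d + 1) with hmdef
  have hm0 : 0 ≤ m := by rw [hmdef]; positivity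
  set E : ℝ := Real.exp (-(δ * (((P.L : ℝ) ^ k)⁻¹ * D))) with hEdef
  have hE0 : 0 < E := Real.exp_pos _
  have hεD : 0 ≤ ((P.L : ℝ) ^ k)⁻¹ * D := mul_nonneg hε.le hD
  have hE1 : Real.exp (-(1 / (4 * (L : ℝ) ^ s) * (((P.L : ℝ) ^ k)⁻¹ * D))) ≤ E := exp_le_exp_of_rate hδ4 hεD
  -- the sources
  set g' : ↥(labels (P.L ^ k) M0 sg) → Balaban1983to89.Site P 0 → ℂ :=
    fun α y => (ζ x' y : ℂ) * (lamFam hPd (P.L ^ k) c M0 sg α x' y : ℂ) * f y with hg'def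
  set dg : ↥(labels (P.L ^ k) M0 sg) → Balaban1983to89.Site P 0 → ℂ :=
    fun α y => ((ζ x' y : ℂ) * (lamFam hPd (P.L ^ k) c M0 sg α x' y : ℂ) - (ζ x y : ℂ) * (lamFam hPd (P.L ^ k) c M0 sg α x y : ℂ)) * f y
    with hdgdef
  -- the bond identity (p29)
  have hid : covD P.eps⁻¹ (cfg U) (gLocT A' P.eps⁻¹ U k cubeB (lamFam hPd (P.L ^ k) c M0 sg) ζ *ᵥ f) ⟨x, μ⟩ =
      ∑ α, covD P.eps⁻¹ (cfg U) (gBox A' P.eps⁻¹ U k (cubeB α) *ᵥ g' α) ⟨x, μ⟩ +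
      ∑ α, ((P.eps⁻¹ : ℝ) : ℂ) * (gBox A' P.eps⁻¹ U k (cubeB α) *ᵥ dg α) x :=
    covD_gLocT_apply P.eps⁻¹ (cfg U) A' P.eps⁻¹ U k cubeB (lamFam hPd (P.L ^ k) c M0 sg) ζ f ⟨x, μ⟩
  rw [hid]
  -- the active-label sets of the two endpoints
  set Sx : Finset ↥(labels (P.L ^ k) M0 sg) := (activeLabels hPd (P.L ^ k) c sg R₀ (blkIter k x)).subtype
    fun α => α ∈ labels (P.L ^ k) M0 sg with hSxdef
  set Sx' : Finset ↥(labels (P.L ^ k) M0 sg) := (activeLabels hPd (P.L ^ k) c sg R₀ (blkIter k x')).subtype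
    fun α => α ∈ labels (P.L ^ k) M0 sg with hSx'def
  have hcardx : (Sx.card : ℝ) ≤ m := by
    have h1 := card_subtype_activeLabels_le (hPd := hPd) (c := c) (M0 := M0) hn hs0 hR₀ (blkIter k x)
    have e1 : (((P.L ^ k : ℕ) : ℕ) : ℝ) = (P.L : ℝ) ^ k := by push_cast; rfl
    rw [hSxdef, hmdef]; rw [e1] at h1; exact h1
  have hcardx' : (Sx'.card : ℝ) ≤ m := by
    have h1 := card_subtype_activeLabels_le (hPd := hPd) (c := c) (M0 := M0) hn hs0 hR₀ (blkIter k x')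
    have e1 : (((P.L ^ k : ℕ) : ℕ) : ℝ) = (P.L : ℝ) ^ k := by push_cast; rfl
    rw [hSx'def, hmdef]; rw [e1] at h1; exact h1
  have hSx : ∀ (α : ↥(labels (P.L ^ k) M0 sg)) (y : Balaban1983to89.Site P 0),
      ζ x y * lamFam hPd (P.L ^ k) c M0 sg α x y ≠ 0 → α ∈ Sx := by
    intro α y hne
    rw [hSxdef, Finset.mem_subtype]
    exact mem_activeLabels_of_ne_zero_of_deep hk hs0 hfit0 hζ0 (mem_blockK.2 rfl) hdeep₀ hne
  have hSx' : ∀ (α : ↥(labels (P.L ^ k) M0 sg)) (y : Balaban1983to89.Site P 0),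
      ζ x' y * lamFam hPd (P.L ^ k) c M0 sg α x' y ≠ 0 → α ∈ Sx' := by
    intro α y hne
    rw [hSx'def, Finset.mem_subtype]
    exact mem_activeLabels_of_ne_zero_of_deep hk hs0 hfit0 hζ0 (mem_blockK.2 rfl) hdeepe₀ hne
  have hcardU : ((Sx ∪ Sx').card : ℝ) ≤ 2 * m := by
    have h1 : ((Sx ∪ Sx').card : ℝ) ≤ (Sx.card : ℝ) + (Sx'.card : ℝ) := by exact_mod_cast Finset.card_union_le _ _
    linarith
  -- the source `x` is `rowMargin`-deep in every hull active at either endpoint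
  have hdeep_x' : ∀ (α : ↥(labels (P.L ^ k) M0 sg)) (y₀ : Balaban1983to89.Site P 0),
      ζ x' y₀ * lamFam hPd (P.L ^ k) c M0 sg α x' y₀ ≠ 0 → x ∈ deepRows ((rowMargin L (d + 1) k s : ℕ) : ℝ) (cubeB α) := by
    intro α y₀ hy₀
    obtain ⟨-, -, hfar⟩ := rowHyp_ii_hull hPd hn hs0 hfit0 hR0 hR₀ hρR hgap hW (L ^ k * L ^ s) hζ0 hxe hdeepe α y₀ hy₀
    refine mem_deepRows.2 fun y hy => ?_
    by_contra hnot
    have h1 := (hfar y hnot).1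
    have h2 := abs_le.1 (abs_T_shift_sub_le x y μ)
    linarith
  have hdeep_x : ∀ (α : ↥(labels (P.L ^ k) M0 sg)) (y₀ : Balaban1983to89.Site P 0),
      ζ x y₀ * lamFam hPd (P.L ^ k) c M0 sg α x y₀ ≠ 0 → x ∈ deepRows ((rowMargin L (d + 1) k s : ℕ) : ℝ) (cubeB α) :=
    fun α y₀ hy₀ => (rowHyp_ii_hull hPd hn hs0 hfit0 hR0 hR₀ hρR hgap hW (L ^ k * L ^ s) hζ0 hx hdeep α y₀ hy₀).1
  have hrow_of_deep : ∀ {α : ↥(labels (P.L ^ k) M0 sg)}, x ∈ deepRows ((rowMargin L (d + 1) k s : ℕ) : ℝ) (cubeB α) →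
      ∀ y, B5Ineq137Torus.T P 0 x y ≤
        ((2 * (5 * (L ^ k * L ^ s) / 8 + L ^ k) + 2 * (L ^ k * L ^ s) * (d + 1 + 1) + 1 : ℕ) : ℝ) → y ∈ cubeB α := by
    intro α hxd y hy
    refine (mem_deepRows.1 hxd) y ?_
    unfold rowMargin
    exact hy
  have hζabs : ∀ z y, |ζ z y| ≤ 1 := fun z y => by
    rw [hζdef, abs_of_nonneg (cutoff_nonneg _ _ _ _ _)]; exact cutoff_le_one _ _ _ _ _
  -- TERM 1: the derivative member of (1.10) for the hulls active at `x'` (r01, regular background, deep rows)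
  set B₁ : ℝ := P.spacing k * (c₁ * Real.exp (-(1 / (4 * (L : ℝ) ^ s) * (((P.L : ℝ) ^ k)⁻¹ * D))) * F) with hB₁def
  have hB₁0 : 0 ≤ B₁ := by positivity
  have hterm1 : ∀ α, ‖covD P.eps⁻¹ (cfg U) (gBox A' P.eps⁻¹ U k (cubeB α) *ᵥ g' α) ⟨x, μ⟩‖ ≤ B₁ := by
    intro α
    by_cases hex : ∃ y, ζ x' y * lamFam hPd (P.L ^ k) c M0 sg α x' y ≠ 0
    · obtain ⟨y₀, hy₀⟩ := hex
      have h1 := G1 P hPd hPL hk1 hkK hks hsize (cubeB α) (bbHull_bigBlock _ _) A hec hece₁ (fun z _ μ' ν => hreg z μ' ν) x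
        (hrow_of_deep (hdeep_x' α y₀ hy₀)) (g' α) F D
        (fun y => norm_rowSource_le (hζabs x' y) (abs_lam_le_one (sum_abs_lamT_le_one hfit0) α x' y) hF y)
        (fun y hy => hsupp y (rowSource_ne_zero hy).2) μ
      have e1 : covD P.eps⁻¹ (cfg U) (gBox A' P.eps⁻¹ U k (cubeB α) *ᵥ g' α) ⟨x, μ⟩ =
          covD P.eps⁻¹ (cfg (expGauge P e A)) (gBox A' P.eps⁻¹ (expGauge P e A) k (cubeB α) *ᵥ g' α) ⟨x, μ⟩ := by rw [hUdef]
      rw [e1]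
      exact h1
    · push Not at hex
      have h0 : g' α = 0 := by
        funext y; rw [hg'def]; dsimp only; rw [← Complex.ofReal_mul, hex y, Complex.ofReal_zero, zero_mul]; rfl
      rw [h0, mulVec_zero]
      simp only [covD, Pi.zero_apply, mul_zero, sub_zero, norm_zero]
      exact hB₁0
  have hzero1 : ∀ α, α ∉ Sx' → covD P.eps⁻¹ (cfg U) (gBox A' P.eps⁻¹ U k (cubeB α) *ᵥ g' α) ⟨x, μ⟩ = 0 := by
    intro α hα
    have h0 : g' α = 0 := by
      funext y
      by_contra hne
      exact hα (hSx' α y (rowSource_ne_zero hne).1)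
    rw [h0, mulVec_zero]
    simp only [covD, Pi.zero_apply, mul_zero, sub_zero]
  have hsum1 : ‖∑ α, covD P.eps⁻¹ (cfg U) (gBox A' P.eps⁻¹ U k (cubeB α) *ᵥ g' α) ⟨x, μ⟩‖ ≤ m * B₁ := by
    rw [← Finset.sum_subset (Finset.subset_univ Sx') (fun α _ hα => hzero1 α hα)]
    calc ‖∑ α ∈ Sx', covD P.eps⁻¹ (cfg U) (gBox A' P.eps⁻¹ U k (cubeB α) *ᵥ g' α) ⟨x, μ⟩‖
        ≤ ∑ α ∈ Sx', ‖covD P.eps⁻¹ (cfg U) (gBox A' P.eps⁻¹ U k (cubeB α) *ᵥ g' α) ⟨x, μ⟩‖ := norm_sum_le _ _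
      _ ≤ ∑ α ∈ Sx', B₁ := Finset.sum_le_sum fun α _ => hterm1 α
      _ = Sx'.card * B₁ := by rw [Finset.sum_const, nsmul_eq_mul]
      _ ≤ m * B₁ := mul_le_mul_of_nonneg_right hcardx' hB₁0
  -- TERM 2: the value member of (1.10) (§3) on the difference sources, for the hulls active at `x` or `x'`
  set Λ : ℝ := K / (R₀ - R₁) + 3 * Real.pi * (d + 1 : ℕ) / (2 * sg) with hΛdef
  have hΛ0 : 0 ≤ Λ := by rw [hΛdef]; positivity
  set B₂ : ℝ := P.spacing k ^ 2 * (c₂ * Real.exp (-(δ * (((P.L : ℝ) ^ k)⁻¹ * D))) * (Λ * F)) with hB₂def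
  have hB₂0 : 0 ≤ B₂ := by positivity
  have hterm2 : ∀ α, ‖(gBox A' P.eps⁻¹ U k (cubeB α) *ᵥ dg α) x‖ ≤ B₂ := by
    intro α
    by_cases hex : ∃ y, dg α y ≠ 0
    · obtain ⟨y₀, hy₀⟩ := hex
      have hact : ζ x' y₀ * lamFam hPd (P.L ^ k) c M0 sg α x' y₀ ≠ 0 ∨ ζ x y₀ * lamFam hPd (P.L ^ k) c M0 sg α x y₀ ≠ 0 := by
        by_contra hno
        rw [not_or, not_not, not_not] at hno
        apply hy₀
        rw [hdgdef]; dsimp only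
        rw [← Complex.ofReal_mul, ← Complex.ofReal_mul, hno.1, hno.2]; simp
      have hxd : x ∈ deepRows ((rowMargin L (d + 1) k s : ℕ) : ℝ) (cubeB α) := by
        rcases hact with h1 | h1
        · exact hdeep_x' α y₀ h1
        · exact hdeep_x α y₀ h1
      have h2 := I2 (cubeB α) (bbHull_bigBlock _ _) x hxd (dg α) (Λ * F) D
        (fun y => norm_rowSource_sub_le hPd hs0 hfit0 hN0 hK0 hR10 (hK R₁ R₀ hR10 (B5Ineq137Torus.T P 0)) α.1 hx hxe hF y)
        hD (fun y hy => hsupp y (right_ne_zero_of_mul hy))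
      have e2 : (gBox A' P.eps⁻¹ U k (cubeB α) *ᵥ dg α) x = (gBox A' P.eps⁻¹ (expGauge P e A) k (cubeB α) *ᵥ dg α) x := by
        rw [hUdef]
      rw [e2]
      exact h2
    · push Not at hex
      have h0 : dg α = 0 := funext hex
      rw [h0, mulVec_zero, Pi.zero_apply, norm_zero]
      exact hB₂0
  have hzero2 : ∀ α, α ∉ Sx ∪ Sx' → (gBox A' P.eps⁻¹ U k (cubeB α) *ᵥ dg α) x = 0 := by
    intro α hα
    rw [Finset.mem_union, not_or] at hα
    have h0 : dg α = 0 := by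
      funext y
      rw [hdgdef]; dsimp only
      have h1 : ζ x' y * lamFam hPd (P.L ^ k) c M0 sg α x' y = 0 := by
        by_contra hne; exact hα.2 (hSx' α y hne)
      have h2 : ζ x y * lamFam hPd (P.L ^ k) c M0 sg α x y = 0 := by
        by_contra hne; exact hα.1 (hSx α y hne)
      rw [← Complex.ofReal_mul, ← Complex.ofReal_mul, h1, h2]; simp
    rw [h0, mulVec_zero, Pi.zero_apply]
  have hsum2 : ‖∑ α, ((P.eps⁻¹ : ℝ) : ℂ) * (gBox A' P.eps⁻¹ U k (cubeB α) *ᵥ dg α) x‖ ≤ P.eps⁻¹ * (2 * m * B₂) := by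
    rw [← Finset.mul_sum, norm_mul, Complex.norm_real, Real.norm_eq_abs, abs_of_pos (inv_pos.mpr heps)]
    refine mul_le_mul_of_nonneg_left ?_ (inv_pos.mpr heps).le
    rw [← Finset.sum_subset (Finset.subset_univ (Sx ∪ Sx')) (fun α _ hα => hzero2 α hα)]
    calc ‖∑ α ∈ Sx ∪ Sx', (gBox A' P.eps⁻¹ U k (cubeB α) *ᵥ dg α) x‖
        ≤ ∑ α ∈ Sx ∪ Sx', ‖(gBox A' P.eps⁻¹ U k (cubeB α) *ᵥ dg α) x‖ := norm_sum_le _ _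
      _ ≤ ∑ α ∈ Sx ∪ Sx', B₂ := Finset.sum_le_sum fun α _ => hterm2 α
      _ = (Sx ∪ Sx').card * B₂ := by rw [Finset.sum_const, nsmul_eq_mul]
      _ ≤ 2 * m * B₂ := mul_le_mul_of_nonneg_right hcardU hB₂0
  -- assembling (verbatim from p29's `deriv230_flat_cwt`)
  have hscale : P.eps⁻¹ * P.spacing k ^ 2 = P.spacing k * (P.L : ℝ) ^ k := by
    rw [Params.spacing]
    field_simp
  have hΛle : Λ ≤ Λ₀ * ((R₀ - R₁)⁻¹ + (sg : ℝ)⁻¹) := by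
    rw [hΛdef, mul_add]
    refine add_le_add ?_ ?_
    · rw [div_eq_mul_inv]
      exact mul_le_mul_of_nonneg_right (le_max_left _ _) (inv_pos.mpr hgap').le
    · have e5 : 3 * Real.pi * (d + 1 : ℕ) / (2 * sg) = (3 * Real.pi * (d + 1 : ℕ) / 2) * (sg : ℝ)⁻¹ := by
        field_simp
      rw [e5]
      exact mul_le_mul_of_nonneg_right (le_max_right _ _) (inv_pos.mpr hsr).le
  have h1 : m * B₁ ≤ P.spacing k * (C * m * 1 * E * F) := by
    have : B₁ ≤ P.spacing k * (C * E * F) := by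
      rw [hB₁def]
      refine mul_le_mul_of_nonneg_left ?_ hsp0.le
      exact mul_le_mul_of_nonneg_right (mul_le_mul hC1 hE1 (Real.exp_pos _).le hC0) hF0
    calc m * B₁ ≤ m * (P.spacing k * (C * E * F)) := mul_le_mul_of_nonneg_left this hm0
      _ = P.spacing k * (C * m * 1 * E * F) := by ring
  have h2 : P.eps⁻¹ * (2 * m * B₂) ≤ P.spacing k * (C * m * ((P.L : ℝ) ^ k * ((R₀ - R₁)⁻¹ + (sg : ℝ)⁻¹)) * E * F) := by
    have e6 : P.eps⁻¹ * (2 * m * B₂) =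
        P.spacing k * ((2 * c₂ * Λ) * m * (P.L : ℝ) ^ k * Real.exp (-(δ * (((P.L : ℝ) ^ k)⁻¹ * D))) * F) := by
      rw [hB₂def]
      have : P.eps⁻¹ * (2 * m * (P.spacing k ^ 2 * (c₂ * Real.exp (-(δ * (((P.L : ℝ) ^ k)⁻¹ * D))) * (Λ * F)))) =
          (P.eps⁻¹ * P.spacing k ^ 2) * (2 * c₂ * Λ * m * Real.exp (-(δ * (((P.L : ℝ) ^ k)⁻¹ * D))) * F) := by ring
      rw [this, hscale]; ring
    rw [e6]
    refine mul_le_mul_of_nonneg_left ?_ hsp0.le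
    have hcoef : 2 * c₂ * Λ * m * (P.L : ℝ) ^ k ≤ C * m * ((P.L : ℝ) ^ k * ((R₀ - R₁)⁻¹ + (sg : ℝ)⁻¹)) := by
      have h3 : 2 * c₂ * Λ ≤ C * ((R₀ - R₁)⁻¹ + (sg : ℝ)⁻¹) := by
        calc 2 * c₂ * Λ ≤ 2 * c₂ * (Λ₀ * ((R₀ - R₁)⁻¹ + (sg : ℝ)⁻¹)) := mul_le_mul_of_nonneg_left hΛle (by positivity)
          _ = (2 * c₂ * Λ₀) * ((R₀ - R₁)⁻¹ + (sg : ℝ)⁻¹) := by ring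
          _ ≤ C * ((R₀ - R₁)⁻¹ + (sg : ℝ)⁻¹) :=
              mul_le_mul_of_nonneg_right (by linarith) (by positivity)
      calc 2 * c₂ * Λ * m * (P.L : ℝ) ^ k = (2 * c₂ * Λ) * (m * (P.L : ℝ) ^ k) := by ring
        _ ≤ (C * ((R₀ - R₁)⁻¹ + (sg : ℝ)⁻¹)) * (m * (P.L : ℝ) ^ k) := mul_le_mul_of_nonneg_right h3 (by positivity)
        _ = C * m * ((P.L : ℝ) ^ k * ((R₀ - R₁)⁻¹ + (sg : ℝ)⁻¹)) := by ring
    exact mul_le_mul_of_nonneg_right (mul_le_mul hcoef le_rfl (Real.exp_pos _).le (by positivity)) hF0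
  refine ((norm_add_le _ _).trans (add_le_add hsum1 hsum2)).trans ?_
  calc m * B₁ + P.eps⁻¹ * (2 * m * B₂)
      ≤ P.spacing k * (C * m * 1 * E * F) + P.spacing k * (C * m * ((P.L : ℝ) ^ k * ((R₀ - R₁)⁻¹ + (sg : ℝ)⁻¹)) * E * F) :=
        add_le_add h1 h2
    _ = P.spacing k * (C * m * (1 + (P.L : ℝ) ^ k * ((R₀ - R₁)⁻¹ + (sg : ℝ)⁻¹)) * E * F) := by ring

end Deriv230

/-! ## §8 (v1.3) Non-vacuity: every hypothesis of `opClose231_regular_torus_cwt` met at once on a genuine `Setup` torus chosen after the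
thresholds -/

section Instance

open BIJ88NeumannPropagatorFlatDecayCube (mem_cubeT_iff_val)

/-- The instance torus of the series: `d = 1`, `L = 3` (odd), `K = 1`, `m = s + 6` — `|T^{(0)}| = 2·3^{s+7}` fine sites per direction.
[cite: Balaban1987RG1, (0.1) p.251] -/
private theorem sites_Ps (s : ℕ) :
    (⟨1, 3, s + 6, 1, le_rfl, ⟨⟨1, rfl⟩, Nat.one_lt_succ_succ 1⟩⟩ : Params).sitesPerDir 0 = 2 * 3 ^ (s + 7) := by
  show 2 * 3 ^ (s + 6 + 1 - 0) = 2 * 3 ^ (s + 7)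
  rfl

/-- kernel: `rowMargin 3 1 1 s ≤ 16·3^s + 7`. [folklore] -/
private theorem rowMargin_le (s : ℕ) : rowMargin 3 (0 + 1) 1 s ≤ 16 * 3 ^ s + 7 := by
  unfold rowMargin
  have : (3 : ℕ) ^ 1 = 3 := by norm_num
  rw [this]
  omega

/-- **THE HYPOTHESES OF `opClose231_regular_torus_cwt` ARE JOINTLY SATISFIABLE — THRESHOLDS INCLUDED** (so the (2.31) bound with `Ω = T_η`
at a regular background for the printed data is not a statement about the empty set): for every charge/coupling data `(a, e, c, β)` THERE ARE a
block exponent `s` (the threshold `s₀` itself), constants `c₀, e₁ > 0`, and — chosen AFTER them — the `Setup` torus `ℤ/(2·3^{s+7})` (`d = 1`,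
`L = 3`, `m = s + 6`, `K = 1`), the level `k = 1`, the background `A = 0` (which is (2.23)-regular at `e_k = e₁`), the reference box
`Ω₀ = [0, 3^{s+5})` (`c = 0`, `M₀ = 3^{s+4}`), grid spacing `s_g = 1`, radii `R = rowMargin + 1`, `R₀ = 1`, `R₁ = 0`, half-width
`W = rowMargin + 3` and the site `x ≡ rowMargin + 2` of `Ω₀` at chart depth `≥ R₀ + R`, meeting EVERY displayed hypothesis (`k + s ≤ m + K`,
`3L^kL^s ≤ |T^{(0)}|`, the fit and the torus gap of `Ω₀`, `rowMargin < R`, `2s_g/3 + R₀/2 + R ≤ W`, the depth window — all by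
`rowMargin 3 1 1 s ≤ 16·3^s + 7 < 3^{s+5}/2`); consequently the (2.31) operator bound holds there for every source `f` (`D = 0`).  This
corrects HONEST SCOPE (v) of v1: the thresholds are existential but the torus may be chosen after them.
[cite: BalabanImbrieJaffe1988, (2.31) p.263] -/
theorem opClose231_regular_torus_cwt_nonvacuous {a : ℝ} (ha : 0 < a) (e creg β : ℝ) (hcreg : 0 ≤ creg) (hβ : 0 < β) :
    ∃ (s : ℕ) (P : Params) (hPd : P.d = 0 + 1), P.L = 3 ∧ P.sitesPerDir 0 = 2 * 3 ^ (s + 7) ∧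
    ∃ c₀ e₁ : ℝ, 0 < c₀ ∧ 0 < e₁ ∧ ∃ (M W : ℕ) (R : ℝ) (x : Balaban1983to89.Site P 0), 0 < R ∧
      x ∈ (cubeT hPd (P.L ^ 1) (fun _ => 0) fun i => P.L ^ 1 * (fun _ => M) i) ∧
      ∀ (f : Balaban1983to89.Site P 0 → ℂ) (F : ℝ), (∀ y, ‖f y‖ ≤ F) →
        ‖(gLocT (B1RG242Torus.α P a 1 * (P.L : ℝ) ^ (1 * P.d)) P.eps⁻¹ (expGauge P e (fun _ => 0 : PBond P 0 → ℝ)) 1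
              (cubeFamB hPd (P.L ^ 1) (fun _ => 0) (fun _ => M) 1 W (3 ^ 1 * 3 ^ s)) (lamFam hPd (P.L ^ 1) (fun _ => 0) (fun _ => M) 1)
              (cutoff 0 1 (B5Ineq137Torus.T P 0)) *ᵥ f) x -
            (gBox (B1RG242Torus.α P a 1 * (P.L : ℝ) ^ (1 * P.d)) P.eps⁻¹ (expGauge P e (fun _ => 0 : PBond P 0 → ℝ)) 1 univ *ᵥ f) x‖ ≤
          P.spacing 1 ^ 2 * (c₀ * (((⌊(((P.L : ℝ) ^ 1) - 1 + 1) / (1 : ℕ)⌋₊ : ℝ) + 3) ^ (0 + 1) *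
              Real.exp (-(1 / (8 * (3 : ℝ) ^ s) * (((P.L : ℝ) ^ 1)⁻¹ * (2 * R)))) +
                Real.exp (-(1 / (8 * (3 : ℝ) ^ s) / 2 * (((P.L : ℝ) ^ 1)⁻¹ * 0)))) *
            Real.exp (-(1 / (8 * (3 : ℝ) ^ s) / 2 * (((P.L : ℝ) ^ 1)⁻¹ * 0))) * F) := by
  obtain ⟨s₀, H0⟩ := opClose231_regular_torus_cwt 0 3 (by norm_num) ha e creg β hcreg hβ
  obtain ⟨c₀, e₁, hc₀, he₁, H⟩ := H0 s₀ le_rfl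
  set s := s₀ with hsdef
  -- the torus, the margin, the box, the point
  set P : Params := ⟨1, 3, s + 6, 1, le_rfl, ⟨⟨1, rfl⟩, Nat.one_lt_succ_succ 1⟩⟩ with hPdef
  have hN : P.sitesPerDir 0 = 2 * 3 ^ (s + 7) := sites_Ps s
  set ρ : ℕ := rowMargin 3 (0 + 1) 1 s with hρdef
  have hρ : ρ ≤ 16 * 3 ^ s + 7 := rowMargin_le s
  have hX1 : 1 ≤ 3 ^ s := Nat.one_le_pow _ _ (by norm_num)
  have h35 : (3 : ℕ) ^ (s + 5) = 243 * 3 ^ s := by rw [pow_add]; ring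
  have h37 : (3 : ℕ) ^ (s + 7) = 2187 * 3 ^ s := by rw [pow_add]; ring
  have h34 : (3 : ℕ) ^ 1 * 3 ^ (s + 4) = 3 ^ (s + 5) := by rw [← pow_add]; ring_nf
  set v : ℕ := ρ + 2 with hvdef
  have hvN : v < P.sitesPerDir 0 := by rw [hN, h37]; omega
  set x : Balaban1983to89.Site P 0 := fun _ => ((v : ℕ) : ZMod (P.sitesPerDir 0)) with hxdef
  have hxv : ∀ μ : Fin P.d, (x μ).val = v := by
    intro μ
    show ZMod.val ((v : ℕ) : ZMod (P.sitesPerDir 0)) = v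
    rw [ZMod.val_natCast, Nat.mod_eq_of_lt hvN]
  have hfit : ∀ i : Fin (0 + 1), (fun _ => 0 : Fin (0 + 1) → ℕ) i * P.L ^ 1 + P.L ^ 1 * (fun _ => 3 ^ (s + 4) : Fin (0 + 1) → ℕ) i ≤
      P.sitesPerDir 0 := by
    intro i
    show 0 * 3 ^ 1 + 3 ^ 1 * 3 ^ (s + 4) ≤ P.sitesPerDir 0
    rw [hN, h34, h35, h37]; omega
  have hxmem : x ∈ (cubeT rfl (P.L ^ 1) (fun _ => 0) fun i => P.L ^ 1 * (fun _ => 3 ^ (s + 4) : Fin (0 + 1) → ℕ) i) := by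
    rw [mem_cubeT_iff_val rfl hfit]
    intro μ
    rw [hxv μ]
    show 0 * 3 ^ 1 ≤ v ∧ v < 0 * 3 ^ 1 + 3 ^ 1 * 3 ^ (s + 4)
    rw [h34, h35]; omega
  refine ⟨s, P, rfl, rfl, hN, c₀, e₁, hc₀, he₁, 3 ^ (s + 4), ρ + 3, (ρ : ℝ) + 1, x, by positivity, hxmem, fun f F hF => ?_⟩
  set A0 : PBond P 0 → ℝ := fun _ => 0 with hA0def
  have hreg : ∀ (z : Balaban1983to89.Site P 0) (μ ν : Fin P.d),
      P.spacing 1 * |e| / e₁ * |A0 ⟨z.shift μ, ν⟩ - A0 ⟨z, ν⟩| ≤ creg * e₁ ^ (β - 1) / (3 : ℝ) ^ 1 := by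
    intro z μ ν
    rw [hA0def, sub_self, abs_zero, mul_zero]
    exact div_nonneg (mul_nonneg hcreg (Real.rpow_nonneg he₁.le _)) (by norm_num)
  have h := H P rfl rfl 1 le_rfl le_rfl (by show 1 + s ≤ s + 6 + 1; omega) (by rw [hN, h37]; omega) A0 e₁ he₁ le_rfl hreg
    (fun _ => 0) (fun _ => 3 ^ (s + 4)) hfit 1 (ρ + 3) le_rfl ((ρ : ℝ) + 1) 1 0 (by rw [hρdef]; linarith) le_rfl one_pos
    (by push_cast; linarith) (fun i => ?_) x hxmem (fun i => ?_) f F 0 hF le_rfl (fun y _ => B5Ineq137Torus.T_nonneg P 0 x y)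
  · simpa using h
  · rw [hN]
    have e1 : ((P.L ^ 1 * 3 ^ (s + 4) : ℕ) : ℝ) = 243 * (3 : ℝ) ^ s := by
      rw [show P.L = 3 from rfl, h34, h35]; push_cast; ring
    rw [e1]; push_cast
    have hρr : (ρ : ℝ) ≤ 16 * (3 : ℝ) ^ s + 7 := by exact_mod_cast hρ
    have hX : (1 : ℝ) ≤ (3 : ℝ) ^ s := by exact_mod_cast hX1
    rw [show ((3 : ℝ)) ^ (s + 7) = 2187 * (3 : ℝ) ^ s by rw [pow_add]; ring]
    linarith
  · have hb : (boxCoord (rfl : P.d = 0 + 1) (P.L ^ 1) (fun _ => 0) x i : ℝ) = v := by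
      unfold boxCoord
      rw [hxv (Fin.cast (rfl : P.d = 0 + 1).symm i)]
      push_cast
      ring
    rw [hb]
    have e1 : ((P.L ^ 1 * 3 ^ (s + 4) : ℕ) : ℝ) = 243 * (3 : ℝ) ^ s := by
      rw [show P.L = 3 from rfl, h34, h35]; push_cast; ring
    rw [e1, hvdef]; push_cast
    have hρr : (ρ : ℝ) ≤ 16 * (3 : ℝ) ^ s + 7 := by exact_mod_cast hρ
    have hX : (1 : ℝ) ≤ (3 : ℝ) ^ s := by exact_mod_cast hX1
    constructor <;> linarith

end Instance

/-! ## §9 (v1.4) The gauge orbit: the value members of (2.31)/(2.30) at every gauge transform `u = (e^{ieεA})^h` of a regular background -/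

section GaugeOrbit

variable {d : ℕ}

open BIJ88Sect3Statements (toC norm_toC)
open BIJ88DeltaLoc234Torus (mulOp gLocT_gaugeAct gBox_gaugeAct)
open BIJ88NeumannPropagatorFlatDecay (mulOp_conjTranspose_mulVec mulOp_mulVec)
open BIJ88NeumannNoZeroModesTorus (IsBlockUnion isBlockUnion_univ)
open BIJ85NeumannPropagatorRegularDecay (isBlockUnion_of_bigBlocks)

/-- kernel: the big-block hulls are unions of `k`-blocks (`L^kL^s`-blocks are unions of `L^k`-blocks).
[cite: BalabanImbrieJaffe1988, (2.27) p.263] -/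
theorem isBlockUnion_cubeFamB (hPd : P.d = d + 1) {k s : ℕ} (hk : 0 + k ≤ P.m + P.K) (c M0 : Fin (d + 1) → ℕ) (sg W : ℕ)
    (α : ↥(labels (P.L ^ k) M0 sg)) : IsBlockUnion k (cubeFamB hPd (P.L ^ k) c M0 sg W (P.L ^ k * P.L ^ s) α) :=
  isBlockUnion_of_bigBlocks (s := s) hk (bbHull_bigBlock _ _)

/-- kernel: a conjugated operator applied to a vector, read at a site: `(M_hBM_hᴴf)(x) = h(x)·(B(h̄f))(x)`.
[cite: BalabanImbrieJaffe1985, (2.7) p.303] -/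
theorem mulOp_sandwich_mulVec_apply (h : GaugeTransf P 0 U1) (B : Matrix (Balaban1983to89.Site P 0) (Balaban1983to89.Site P 0) ℂ)
    (f : Balaban1983to89.Site P 0 → ℂ) (x : Balaban1983to89.Site P 0) :
    ((mulOp h * B * (mulOp h)ᴴ) *ᵥ f) x = toC (h x) * (B *ᵥ fun y => (starRingEnd ℂ) (toC (h y)) * f y) x := by
  rw [← mulVec_mulVec, ← mulVec_mulVec, mulOp_conjTranspose_mulVec, mulOp_mulVec]

/-- kernel: the gauge-rotated source has the same size. [cite: BalabanImbrieJaffe1985, (2.7) p.303] -/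
theorem norm_conj_toC_mul (h : GaugeTransf P 0 U1) (f : Balaban1983to89.Site P 0 → ℂ) (y : Balaban1983to89.Site P 0) :
    ‖(starRingEnd ℂ) (toC (h y)) * f y‖ = ‖f y‖ := by
  rw [norm_mul, RCLike.norm_conj, norm_toC, one_mul]

/-- **(2.31) WITH `Ω = T_η`, OPERATOR FORM, ON THE WHOLE GAUGE ORBIT OF A (2.23)-REGULAR BACKGROUND** — the form in which [I] §4.5 meets
the small-field region (`u = (e^{ieεA})^h` after an axial gauge fixing): for every gauge transformation `h`, the bound of
`opClose231_regular_torus_cwt` holds VERBATIM for `u = (e^{ieεA})^h` (same `s₀, c₀, e₁`, same data) — `G_{k,loc}(u^h) = M_hG_{k,loc}(u)M_hᴴ`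
(p31's `gLocT_gaugeAct`; the hulls are `k`-block unions), `G_k(T_η,u^h) = M_hG_k(T_η,u)M_hᴴ` (`gBox_gaugeAct`), `|h| = 1`, and the rotated
source `h̄f` has the size and support of `f`.
[cite: BalabanImbrieJaffe1988, (2.31) p.263] [cite: BalabanImbrieJaffe1985, (6.3.2) p.320] -/
theorem opClose231_regular_torus_cwt_gaugeOrbit (d L : ℕ) (hL : 2 ≤ L) {a : ℝ} (ha : 0 < a) (e creg β : ℝ) (hcreg : 0 ≤ creg)
    (hβ : 0 < β) :
    ∃ s₀ : ℕ, ∀ s : ℕ, s₀ ≤ s → ∃ c₀ e₁ : ℝ, 0 < c₀ ∧ 0 < e₁ ∧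
      ∀ (P : Params) (hPd : P.d = d + 1), P.L = L → ∀ (k : ℕ), 1 ≤ k → k ≤ P.K → k + s ≤ P.m + P.K →
      3 * (L ^ k * L ^ s) ≤ P.sitesPerDir 0 →
      ∀ (A : PBond P 0 → ℝ) (ec : ℝ), 0 < ec → ec ≤ e₁ →
      (∀ (z : Balaban1983to89.Site P 0) (μ ν : Fin P.d),
          P.spacing k * |e| / ec * |A ⟨z.shift μ, ν⟩ - A ⟨z, ν⟩| ≤ creg * ec ^ (β - 1) / (L : ℝ) ^ k) →
      ∀ (h : GaugeTransf P 0 U1) (c M0 : Fin (d + 1) → ℕ), (∀ i, c i * P.L ^ k + P.L ^ k * M0 i ≤ P.sitesPerDir 0) →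
      ∀ (sg W : ℕ), 1 ≤ sg → ∀ (R R₀ R₁ : ℝ), ((rowMargin L (d + 1) k s : ℕ) : ℝ) < R → 0 ≤ R₁ → R₁ < R₀ →
        2 * (sg : ℝ) / 3 + R₀ / 2 + R ≤ W → (∀ i, ((P.L ^ k * M0 i : ℕ) : ℝ) + R ≤ P.sitesPerDir 0) →
      ∀ (x : Balaban1983to89.Site P 0), x ∈ (cubeT hPd (P.L ^ k) c fun i => P.L ^ k * M0 i) →
        (∀ i, R₀ + R ≤ (boxCoord hPd (P.L ^ k) c x i : ℝ) ∧ (boxCoord hPd (P.L ^ k) c x i : ℝ) + (R₀ + R) ≤ (P.L ^ k * M0 i : ℕ) - 1) →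
      ∀ (f : Balaban1983to89.Site P 0 → ℂ) (F D : ℝ), (∀ y, ‖f y‖ ≤ F) → 0 ≤ D → (∀ y, f y ≠ 0 → D ≤ B5Ineq137Torus.T P 0 x y) →
        ‖(gLocT (B1RG242Torus.α P a k * (P.L : ℝ) ^ (k * P.d)) P.eps⁻¹ (GaugeField.gaugeAct h (expGauge P e A)) k
              (cubeFamB hPd (P.L ^ k) c M0 sg W (L ^ k * L ^ s)) (lamFam hPd (P.L ^ k) c M0 sg)
              (cutoff R₁ R₀ (B5Ineq137Torus.T P 0)) *ᵥ f) x -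
            (gBox (B1RG242Torus.α P a k * (P.L : ℝ) ^ (k * P.d)) P.eps⁻¹ (GaugeField.gaugeAct h (expGauge P e A)) k univ *ᵥ f) x‖ ≤
          P.spacing k ^ 2 * (c₀ * (((⌊(((P.L : ℝ) ^ k) - 1 + R₀) / sg⌋₊ : ℝ) + 3) ^ (d + 1) *
              Real.exp (-(1 / (8 * (L : ℝ) ^ s) * (((P.L : ℝ) ^ k)⁻¹ * (2 * R)))) +
                Real.exp (-(1 / (8 * (L : ℝ) ^ s) / 2 * (((P.L : ℝ) ^ k)⁻¹ * R₁)))) *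
            Real.exp (-(1 / (8 * (L : ℝ) ^ s) / 2 * (((P.L : ℝ) ^ k)⁻¹ * D))) * F) := by
  obtain ⟨s₀, H0⟩ := opClose231_regular_torus_cwt d L hL ha e creg β hcreg hβ
  refine ⟨s₀, fun s hs => ?_⟩
  obtain ⟨c₀, e₁, hc₀, he₁, H⟩ := H0 s hs
  refine ⟨c₀, e₁, hc₀, he₁, ?_⟩
  intro P hPd hPL k hk1 hkK hks hsize A ec hec hece hreg h c M0 hfit0 sg W hsg R R₀ R₁ hRm hR₁ hR10 hW hgap x hx hdeep f F D hF hD hsupp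
  have hk : 0 + k ≤ P.m + P.K := by omega
  have hA0 : 0 < B1RG242Torus.α P a k * (P.L : ℝ) ^ (k * P.d) :=
    mul_pos (mul_pos (B1.aSeq_pos ha (B1RG242Torus.one_lt_cast_L P) hk1) (inv_pos.mpr (pow_pos (P.spacing_pos k) 2)))
      (pow_pos P.cast_L_pos _)
  have hc' : P.eps⁻¹ ≠ 0 := inv_ne_zero P.eps_pos.ne'
  have hcube : ∀ α, IsBlockUnion k (cubeFamB hPd (P.L ^ k) c M0 sg W (L ^ k * L ^ s) α) := by
    intro α
    rw [← hPL]
    exact isBlockUnion_cubeFamB hPd hk c M0 sg W α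
  set f' : Balaban1983to89.Site P 0 → ℂ := fun y => (starRingEnd ℂ) (toC (h y)) * f y with hf'def
  have hF' : ∀ y, ‖f' y‖ ≤ F := fun y => by rw [hf'def]; dsimp only; rw [norm_conj_toC_mul]; exact hF y
  have hsupp' : ∀ y, f' y ≠ 0 → D ≤ B5Ineq137Torus.T P 0 x y := fun y hy => hsupp y (right_ne_zero_of_mul hy)
  have hb := H P hPd hPL k hk1 hkK hks hsize A ec hec hece hreg c M0 hfit0 sg W hsg R R₀ R₁ hRm hR₁ hR10 hW hgap x hx hdeep f' F D hF' hD
    hsupp'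
  rw [gLocT_gaugeAct hk hc' hA0 h (expGauge P e A) hcube, gBox_gaugeAct hk hc' hA0 h (expGauge P e A) (isBlockUnion_univ k),
    mulOp_sandwich_mulVec_apply, mulOp_sandwich_mulVec_apply, ← mul_sub, norm_mul, norm_toC, one_mul]
  exact hb

/-- **(2.30), OPERATOR FORM, ON THE WHOLE GAUGE ORBIT OF A (2.23)-REGULAR BACKGROUND**: for every gauge transformation `h`, the bound of
`opDecay230_regular_cwt` holds verbatim for `u = (e^{ieεA})^h`. [cite: BalabanImbrieJaffe1988, (2.30) p.263]
[cite: BalabanImbrieJaffe1985, (6.3.2) p.320] -/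
theorem opDecay230_regular_cwt_gaugeOrbit (d L : ℕ) (hL : 2 ≤ L) {a : ℝ} (ha : 0 < a) (e creg β : ℝ) (hcreg : 0 ≤ creg) (hβ : 0 < β) :
    ∃ s₀ : ℕ, ∀ s : ℕ, s₀ ≤ s → ∃ c₀ e₁ : ℝ, 0 < c₀ ∧ 0 < e₁ ∧
      ∀ (P : Params) (hPd : P.d = d + 1), P.L = L → ∀ (k : ℕ), 1 ≤ k → k ≤ P.K → k + s ≤ P.m + P.K →
      3 * (L ^ k * L ^ s) ≤ P.sitesPerDir 0 →
      ∀ (A : PBond P 0 → ℝ) (ec : ℝ), 0 < ec → ec ≤ e₁ →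
      (∀ (z : Balaban1983to89.Site P 0) (μ ν : Fin P.d),
          P.spacing k * |e| / ec * |A ⟨z.shift μ, ν⟩ - A ⟨z, ν⟩| ≤ creg * ec ^ (β - 1) / (L : ℝ) ^ k) →
      ∀ (h : GaugeTransf P 0 U1) (c M0 : Fin (d + 1) → ℕ), (∀ i, c i * P.L ^ k + P.L ^ k * M0 i ≤ P.sitesPerDir 0) →
      ∀ (sg W : ℕ), 1 ≤ sg → ∀ (R R₀ R₁ : ℝ), ((rowMargin L (d + 1) k s : ℕ) : ℝ) < R → 0 ≤ R₁ → R₁ < R₀ →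
        2 * (sg : ℝ) / 3 + R₀ / 2 + R ≤ W → (∀ i, ((P.L ^ k * M0 i : ℕ) : ℝ) + R ≤ P.sitesPerDir 0) →
      ∀ (x : Balaban1983to89.Site P 0), x ∈ (cubeT hPd (P.L ^ k) c fun i => P.L ^ k * M0 i) →
        (∀ i, R₀ + R ≤ (boxCoord hPd (P.L ^ k) c x i : ℝ) ∧ (boxCoord hPd (P.L ^ k) c x i : ℝ) + (R₀ + R) ≤ (P.L ^ k * M0 i : ℕ) - 1) →
      ∀ (f : Balaban1983to89.Site P 0 → ℂ) (F D : ℝ), (∀ y, ‖f y‖ ≤ F) → 0 ≤ D → (∀ y, f y ≠ 0 → D ≤ B5Ineq137Torus.T P 0 x y) →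
        ‖(gLocT (B1RG242Torus.α P a k * (P.L : ℝ) ^ (k * P.d)) P.eps⁻¹ (GaugeField.gaugeAct h (expGauge P e A)) k
              (cubeFamB hPd (P.L ^ k) c M0 sg W (L ^ k * L ^ s)) (lamFam hPd (P.L ^ k) c M0 sg)
              (cutoff R₁ R₀ (B5Ineq137Torus.T P 0)) *ᵥ f) x‖ ≤
          P.spacing k ^ 2 * ((((⌊(((P.L : ℝ) ^ k) - 1 + R₀) / sg⌋₊ : ℝ) + 3) ^ (d + 1)) *
            (c₀ * Real.exp (-(1 / (8 * (L : ℝ) ^ s) * (((P.L : ℝ) ^ k)⁻¹ * D))) * F)) := by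
  obtain ⟨s₀, H0⟩ := opDecay230_regular_cwt d L hL ha e creg β hcreg hβ
  refine ⟨s₀, fun s hs => ?_⟩
  obtain ⟨c₀, e₁, hc₀, he₁, H⟩ := H0 s hs
  refine ⟨c₀, e₁, hc₀, he₁, ?_⟩
  intro P hPd hPL k hk1 hkK hks hsize A ec hec hece hreg h c M0 hfit0 sg W hsg R R₀ R₁ hRm hR₁ hR10 hW hgap x hx hdeep f F D hF hD hsupp
  have hk : 0 + k ≤ P.m + P.K := by omega
  have hA0 : 0 < B1RG242Torus.α P a k * (P.L : ℝ) ^ (k * P.d) :=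
    mul_pos (mul_pos (B1.aSeq_pos ha (B1RG242Torus.one_lt_cast_L P) hk1) (inv_pos.mpr (pow_pos (P.spacing_pos k) 2)))
      (pow_pos P.cast_L_pos _)
  have hc' : P.eps⁻¹ ≠ 0 := inv_ne_zero P.eps_pos.ne'
  have hcube : ∀ α, IsBlockUnion k (cubeFamB hPd (P.L ^ k) c M0 sg W (L ^ k * L ^ s) α) := by
    intro α
    rw [← hPL]
    exact isBlockUnion_cubeFamB hPd hk c M0 sg W α
  set f' : Balaban1983to89.Site P 0 → ℂ := fun y => (starRingEnd ℂ) (toC (h y)) * f y with hf'def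
  have hF' : ∀ y, ‖f' y‖ ≤ F := fun y => by rw [hf'def]; dsimp only; rw [norm_conj_toC_mul]; exact hF y
  have hsupp' : ∀ y, f' y ≠ 0 → D ≤ B5Ineq137Torus.T P 0 x y := fun y hy => hsupp y (right_ne_zero_of_mul hy)
  have hb := H P hPd hPL k hk1 hkK hks hsize A ec hec hece hreg c M0 hfit0 sg W hsg R R₀ R₁ hRm hR₁ hR10 hW hgap x hx hdeep f' F D hF' hD
    hsupp'
  rw [gLocT_gaugeAct hk hc' hA0 h (expGauge P e A) hcube, mulOp_sandwich_mulVec_apply, norm_mul, norm_toC, one_mul]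
  exact hb

end GaugeOrbit

end

end Literature.MathematicalPhysics.QuantumFieldTheory.BalabanImbrieJaffe1984to88.BIJ88Close231RegularTorusCwt
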